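import Literature.MathematicalPhysics.QuantumFieldTheory.Balaban1983to89.T4BoundaryCarrier

/-!
# T4BoundaryRate — the two-run rate of Bałaban's BOUNDARY PIECES `𝐁^{(j)}(X; U, A)` reduced, in the kernel, to typed
leaves BY INDUCTION OVER THE CREATION STEP: a Lipschitz GENERATION STEP with an operator-rate remainder, influence
kernels over the OLDER pieces, and a CONTRACTION of the rate profile under those kernels (cell `pub-balaban`, T4-DAG §5
row T4-U3.E, spine estimate NE5, boundary-functional member — fan-out prover P3; typing + bookkeeping only; v1.2 adds the
input/operator split of the generation step, §7, and names the carriers' conventions; v1.3 adds the Cauchy toy, §8; v1.4 adds the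
printed localization gain as a damping shape of any power and the tilted-average toy, §9; v1.5 adds the fluctuation-difference
factorisation of the input modulus, the displacement toy and the explicit constant, §10; v1.5.1 DOCFIX re-transliterates the (3.15)
quotation of [I] p. 273 verbatim — plain contour integral sign, the fraction 1/t_□², «r max{…, |∇^ξ_𝐔δ𝐇_j|_X, |Δ^ξ_𝐔δ𝐇_j|_X}»; v1.5.2
DOCFIX (XREAD C-ref6-132 V1/V2) quotes [II] (1.33) with «Σ_{Y∈D_k} … B)» and (1.36) with «E₀ε₁C₁M^q exp C₂κ₁» verbatim; v1.6 adds
the layered profile of the displacement-over-margin factor of BOUNDARY parents over the multi-scale cover, its geometric regime and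
the no-go separating it from §9's arbitrary-power regime, §11; v1.6.1 DOCFIX adds the nearest PUBLISHED one-run SHAPE of §11's per-collar
displacement factor and of the Cauchy step over it — [Dimock2013BalabanII] §3.9, [Dimock2013BalabanIII] §2.7, the scalar φ⁴₃ template,
prior art only: nothing imported, nothing of it asserted for Bałaban's terms; v1.6.2 DOCFIX adds the audited series' OWN one-run
displayed template of that factor — [III] p. 276's «Theorems 3.7–3.10 [13]» = [Balaban1985BackgroundPropagators] (3.89)–(3.94)
pp. 409–410 (Theorem 3.7, Corollary 3.8) and p. 412, render-read, CONTEXT only: the propagators, one run; v1.6.3 DOCFIX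
(lineage gen 17, cell GAPS G-ne5p3-12) corrects the CARRIER-EXTENSION sentence of the CONVENTIONS paragraph: run B's tables are
extended off run B's space BY RUN A's TRANSPORTED VALUES, not by 0 — two-sided zero-extension makes the two-run binders
uninhabitable; declarations byte-identical)

HONEST FRAMING (T4-DAG PAGE 1).  The cell's T4 target is rung (B)+1: existence AND uniqueness of the ε → 0 limit of
Bałaban's unit-scale averaged loop expectations on a FIXED finite torus — strictly beyond ultraviolet stability
([Balaban1988Convergent] Cor. 3 p. 264; [Balaban1989LargeFieldII] Thm 1 p. 355), NOT infinite volume, NOT a mass gap, NOT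
the Clay problem.  The spine estimate NE5 of node U3 is the η-RATE AT FIXED ARGUMENTS of the pieces of the two runs'
final densities (run A: K steps from spacing ε; run B: K + 1 steps from ε/L; pairing j ↔ j + 1); its boundary-functional
member is the hypothesis shape `T4BoundaryCarrier.NE5B`: `|𝐁^A(X; g, transport U, a) − 𝐁^B(X; g, U, a)| ≤ C₅θ^{scale X}
e^{−κd(X)}` for every admissible pending field `a`, with `C₅` independent of `a`, of the background and of the scale.
NOTHING OF THIS IS PRINTED: the manuscripts under audit construct ONE run.  This module therefore ASSERTS NOTHING about
Bałaban's objects: every `def … : Prop` below is a HYPOTHESIS SHAPE over the ABSTRACT carriers of `T4BoundaryCarrier`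
(labelled NOT PRINTED), and every `theorem` is kernel-checked real-analysis bookkeeping about the shapes — the reduction of
`NE5B` to the leaves, the located necessity of the contraction leaf, and non-vacuity.  The paper-level record with the
printed loci quoted by page, the null-search log for the unprinted leaves and the located gaps is the cell record
`t4/T4-EST-U3-NE5B-P3.md`.  Value = the exact quantifier structure of the induction over the creation step that a proof of
`NE5B` must run, with the missing two-run inequalities typed and the printed one-run template of each named; NOT summit
progress.

Printed context (verbatim, read on the ×2 journal-page renders by this seat; the manuscripts under audit are quoted for
CONTEXT only — no disputed step of theirs is used anywhere below).
* OLD PIECES PERSIST, THE NEW PIECE IS GENERATED FROM ALL OLDER ONES (the triangular generation structure).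
  [Balaban1988Convergent] (2.40)–(2.41) p. 261: *"𝐁_k […] is given by the sum Σ_{j=1}^k 𝐁^{(j)}(U_k, A, {S_i}), (2.40) and a
  term in this sum has the localized representation 𝐁^{(j)}(U_k, A, {S_i}) = Σ_X 𝐁^{(j)}(X, U_k, A, {S_i∩X}), (2.41) where the
  sum is over domains X ∈ 𝐃_j such, that X∩Ω_j ≠ ∅, and X∩Z_j~ ≠ ∅."*; p. 262: *"the newly created expressions 𝐄^{(k)},
  𝐑^{(k)}, 𝐁^{(k)} are defined on slightly larger spaces […] and they have better decay properties, with the number κ replaced,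
  for example, by (1 + 4β)κ."*; (3.25) p. 270 WITH (3.27) p. 271 — a READING merging two displays, not a quotation: the
  persisting old pieces `𝐁_k(U_{k+1})`, `𝐑″_k(U_{k+1})` sit in the PREFACTOR `exp[A_k(1/g_k², U_{k+1}) + E₀^{(k)}]` of (3.25) (A_k the
  k-th action, which contains 𝐁_k), while (3.27) itself writes the logarithm of the last fluctuation-field integral of
  (3.25) as `∫₀¹dt ⟨{𝐁_k(U_k(…)) − 𝐁_k(U_{k+1}) + A(…) − A(…)} + V^{(k)}(S_{k+1})⟩_{s=1,t} + ∫₀¹ds ⟨{𝐑″_k(U_k(…)) −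
  𝐑″_k(U_{k+1})}⟩_{s,t=0} + log[…(s = 0, t = 0)…]`, p. 271: *"Introduce now auxiliary parameters s, t, the parameter t
  multiplying the expressions 𝐁_k, A((1/g_k²(·)) − (1/g_k²), …), V^{(k)}, s multiplying 𝐑″_k."*, *"Here ⟨·⟩_{s,t} denotes the
  expectation value with respect to the probabilistic measure Z_{s,t}^{−1}dμ_{C^{(k)}(Λ_{k+1})}(A)χ_k exp[−⟨A, C*Δ^{(k)}CA_k⟩ + 𝐏^{(k)}
  + {…}_{s,t} + tV^{(k)}(S_k)]"* (so the interpolating measure itself carries t·𝐁_k: the generated piece is NOT linear in the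
  older pieces — §7) — and the three sentences after (3.27): *"The first is the integral over t of the expectation value
  of the boundary terms, and it contributes to 𝐁^{(k+1)} only. The second is the
  integral over s of the expectation value of the R-terms, and it contributes to 𝐑^{(k+1)} and 𝐁^{(k+1)}. The third expression
  is the logarithm of the fluctuation field integral involving the regular terms of the effective action only, and it
  contributes to 𝐄^{(k+1)} and 𝐁^{(k+1)}."* — so the OLD pieces `𝐁_k(U_{k+1})`, `𝐑″_k(U_{k+1})` persist unchanged as functionals,
  the NEW boundary piece is generated from ALL older boundary pieces (the t-integral), from the older R-terms (the
  s-integral, taken at t = 0: no boundary terms in it) and from the regular terms (taken at s = t = 0: neither), i.e. the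
  generation is TRIANGULAR in the kind ordering E ≺ R ≺ B; p. 276: *"The expression determined by the boundary terms 𝐁_k is
  much simpler […]. To its terms we apply the formulas (3.6), (3.7) [I], and next we localize the obtained expressions. The
  localized expansion is over domains Y₀ ∈ 𝐃_k having nonempty intersections with Λ_{k+1}."*; p. 277: *"The terms of the
  expansion can be estimated as in (2.42), but with the additional factor O(ε_k) arising from the bound of the fluctuation
  field."*; p. 279: *"Thus we have finished the decomposition of the logarithm of the fluctuation field integral in (3.25)
  into the sum of the three terms: 𝐄^{(k+1)}, 𝐑″^{(k+1)}, and 𝐁^{(k+1)}. These terms satisfy all the conditions of the inductive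
  assumption."*  [Balaban1988Convergent, (2.40)–(2.42) pp. 261–262, (3.27) p. 271, pp. 276–279]
* THE R-STEP'S NEW BOUNDARY PIECES.  [Balaban1989LargeFieldII] p. 390: *"To the first group we assign all the terms with the
  localization domains X intersecting the large field region Z_k~ ∪ ∪_{i=1}^m Y_i~ […]. The terms of the first group are new
  boundary terms, and they are denoted by 𝐁′^{(k)}(X)."*, (1.99) *"|𝐑′^{(k)}(X, (𝐔, 𝐉))| ≤ O(1)c₁ exp(−(1 + ½β)κd_{k,∪Y_i}(X))"*,
  (1.101) *"A_k(1/(g_k(·))², U_k) = A′_k(1/(g_k(·))², U_k) + Σ_X 𝐑′^{(k)}(X, U_k) + Σ_X 𝐁′^{(k)}(X, U_k)."*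
  [Balaban1989LargeFieldII, (1.98)–(1.101) p. 390]
* THE ONE-RUN TEMPLATE OF THE SCALE DAMPING (old terms feel a recent fluctuation field only through "irrelevant terms").
  [Balaban1987RG1] p. 271: *"In the first case dist(X, □) ≥ M, the distance is in the scale η, hence in the scale ξ
  dist^{(ξ)}(X, □) ≥ M(L^jη)^{−1}. In the second case X is a big domain in ξ-scale, for example d_j(X) ≥ (L^jη)^{−1}. Thus either
  the exponential decay of propagators corresponding to ξ-scale, or the exponential bound (1.18) should give a small factor
  O((L^jη)^N) with an arbitrary power N, enough to control the sums."*, (3.6) *"𝐄^{(j)}(X, U_j(exp iB_□ Ū^j_{k+1})) = 𝐄^{(j)}(X,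
  exp iξ𝐇_j(B_□)U_{k+1})"*, (3.9) *"|δ𝐇_j| ≤ B₃ exp(−½δ₀ dist^{(ξ)}(X, □) − ½δ₀M(L^jη)^{−1}) × 2L^jη|ζ_□𝐇_k(B′)| on X"*; p. 272:
  *"Thus in both cases we have irrelevant terms."*  [Balaban1987RG1, (3.5)–(3.9) pp. 271–272]

NOT PRINTED anywhere in [Balaban1987RG1], [Balaban1988Convergent], [Balaban1989LargeFieldII] (cell record
`t4/T4-EST-U3-NE5B-P3.md` §4, located absence with null-search log over the held corpus and the galaxy corpora): (a) the
two-run rate `NE5B` itself; (b) `GenLip` — a Lipschitz estimate of ONE generation step (the t- and s-expectations of (3.27), the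
expansions (3.6)–(3.7) [I] applied to 𝐁_k, the localization of p. 276, and the R-operation's first group (1.98)–(1.101)) in its
OLDER INPUT PIECES, with influence kernels, up to an OPERATOR-RATE remainder `Cop·θ^{scale X}e^{−κd(X)}` absorbing the η-rate of
the step's covariances / propagators / minimizers (spine estimate NE2, `T4EtaRate`), the closeness of the two runs' internal
backgrounds (NE3, `T4OutputRate.BackgroundsClose`) times the printed-ingredient background modulus (`LipBackgroundFl`), and the
unpaired oldest run-B scale; print has the one-run size bound with *"the additional factor O(ε_k)"* (p. 277) and no modulus;
(c) `KernelContracts` / `EKernelContracts` — the statement that the influence of the scale-j inputs on a scale-(k+1) output is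
damped by a factor beating the rate loss θ^{j−(k+1)}; print has the ONE-RUN template (3.5)–(3.9) [I] (*"a small factor
O((L^jη)^N) with an arbitrary power N"*, *"irrelevant terms"*), applied to boundary terms by reference (p. 276), never for a
difference of two runs, and — located gap — the per-output slice sums over older large-field geometry are controlled in print
only through the small factors of the pending 𝐓-operations, not term by term.

CONVENTIONS (UNPRINTED; recorded as DATA of the carriers — named at referee t4-ref2's request, cell GAPS-T4 G-t4r2-2, repair
(i): on the carrier side by `T4BoundaryCarrier` v1.1 items (d), (e), restated here for this module's binders).  Comparing the
two runs' boundary pieces `𝐁^{(j)}(X, U_k, A, {S_i∩X})` (2.41) "at the same arguments" presupposes: (a)–(b) the conventions of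
`T4OutputRate` §1 (ONE common index type `Dom` of localization domains after the pairing j ↔ j + 1; the background transport
run B → run A); (c) the convention of `T4BoundaryCarrier` §1 (ONE common carrier `Fl` of pending fluctuation fields); (d) the
identification of the two runs' LARGE-FIELD DATA `{S_i ∩ X}` of (2.41), and of its admissibility clause *"X∩Ω_j ≠ ∅, and
X∩Z_j~ ≠ ∅"*, THROUGH THE COMMON INDEX `Dom`: one `X : C.Dom` names the same localization domain AND the same restricted
large-field data (the sequences {Ω_i}, {Λ_i}, {S_i} restricted to X) in both runs — `Dom` indexes the SYNCHRONISED domain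
structures of node U5a/U5b's good class (cell obligation O-X14-1; `T4BoundaryCarrier` (d): *"an index `X : C.Dom` stands for a
localization domain TOGETHER WITH the restricted large-field data {S_i∩X} […] ONE AND THE SAME for both runs"*); outside the
good class nothing is compared here (node U5.E's bad-class bound is a different row); before U5a's synchronisation the two
runs' large-field regions are different objects (different lattices, coupling-dependent cube sizes (2.5) p. 255), so (d) is a
genuine convention of the same standing as (c), not a theorem; the auxiliary variables 𝐉 of (2.42) are part of the background
datum (𝐔, 𝐉); (e) INTENDED BACKGROUND CARRIERS (`T4BoundaryCarrier` (e)): `BgB` (resp. `BgA`) stands for run B's (resp. run A's)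
printed regularity/analyticity space Ũ^c_j(X, α̃₀, α̃₁) of (2.34)–(2.39) p. 261 (β = 1/4; *"The spaces defined above are invariant
with respect to G-valued gauge transformations"*) — the space on which property (ii) *"it has an extension to an analytic
function on the space Ũ^c_j(X, α̃₀, α̃₁)"* and the bound (iv) (2.42) are printed FOR ALL ITS (complex) CONFIGURATIONS (𝐔, 𝐉) —
restricted as the instancer needs (`T4OutputRate` §1: the instancer chooses the subtypes).  FOR THE INDUCTION OF THIS MODULE
the intended instance is the full complex space, NOT only its real points: an older piece enters a generation step through
its functional derivative ((3.7) [I], §7 `InputLipB`), so the two-run discrepancy of the inputs must be carried on a complex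
neighbourhood of the arguments used, where a Cauchy estimate converts it into a derivative bound — at real points alone the
induction hypothesis would not feed the next step (hazard H-ne5p3g2-1 of the cell record; a choice WITHIN the latitude of
`T4BoundaryCarrier` (e), booked with its owner).  These spaces depend on the step: p. 277 *"on the other hand we have to use a
part of the analyticity domains of terms in 𝐁_k for the function 𝐇_k. […] The analyticity domains become smaller after each
step, but the difference is very small and exponentially decreasing in the number of steps."*  A step-indexed family of
spaces is encoded on ONE carrier type by EXTENDING the value tables off their spaces (v1.6.3, GAPS G-ne5p3-12 — the
INHABITABLE convention, correcting v1.2–v1.6.2's «by 0 off its own space, both runs alike», which is harmless only for the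
ONE-table sup binders): run A's table is extended by 0 off run A's space; run B's table (and run B's generation map, §7) is
extended off run B's space `S_B(X)` BY RUN A's TRANSPORTED VALUE, `BB g U a X := BA g (transport U) a X` for `U ∉ S_B(X)` —
so that every TWO-run binder below (`BDiscAt`, `GenLip`, `OpDisc`, the target `NE5B`), which quantifies over ALL `U : C.BgB`,
is TRIVIAL off run B's space (difference `0`) and GENUINE on it; with two-sided zero-extension the target would read
`|BA g (transport U) a X| ≤ C₅θ^{scale X}e^{−κd(X)}` at every `U ∉ S_B(X)` whose block average is regular, which is false for
large scales (only (2.42) holds there) — the carrier `BgB` must nevertheless be LARGER than the final-step space, because the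
chart of §10 and the encoding of §12e (satellite `T4BoundaryRateCollar`) read the parents' tables at displaced ∕ complex
configurations inside the parent's space and outside the child's (p. 277, quoted above).  The companion hazard
H-ne5p3g2-2: the transport must map run B's space into run A's (one block averaging improves regularity — the content of
the cell's averaging modules, not assumed here), which is what makes run A's transported tables ADMISSIBLE
inputs in §7's `genLip_of_split` (its hypothesis `hadmA`).

## What is typed and what is proved

§1 THE GENERATION DATUM (structure `Generation C`: for each domain X the finite sets `parents X` / `eparents X` of OLDER
boundary / regular pieces feeding it — finite because the torus is fixed and finite — with `scale Y < scale X`, and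
nonnegative influence kernels `K`, `KE`) and the LEAVES, all binders, all UNIFORM IN the pending field with a-INDEPENDENT
constants: `BDiscAt` / `EDiscAt` (an older piece obeys the two-run bound with a given constant at ALL admissible arguments);
`GenLip` (NOT PRINTED; (b) above); `KernelContracts`, `EKernelContracts` (NOT PRINTED; (c) above: the kernels map the rate
profile `θ^{scale}e^{−κd}` of the inputs into `λ·θ^{scale X}e^{−κd(X)}`); `KernelDamped` (the scale-sliced form with a damping
factor `ω^{scale X − j}` per slice, the two-run analogue of (3.9) [I]).
§2 BOOKKEEPING [folklore]: `geomTail_le` (Σ_{j<n} r^{n−j} ≤ r/(1−r)); `kernelContracts_of_damped` (slice damping with ω < θ ⇒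
contraction with `λ = M(ω/θ)/(1 − ω/θ)`): the rate loss θ^{j−(k+1)} of an old input is beaten exactly when the damping is
STRICTLY faster than the rate, which is where "irrelevant terms" enters a two-run comparison.
§3 THE REDUCTION [folklore]: `ne5B_of_generation` — `GenLip` + `KernelContracts lamB` (lamB < 1) + `EKernelContracts lamE` + the sibling
member's rate `T4OutputRate.NE5` of the regular inputs (hypothesis BY NAME; triangularity of (3.27) makes this non-circular) ⇒
`NE5B` with the SCALE-INDEPENDENT constant `C₅ = (Cop + lamE·CE)/(1 − lamB)`, by strong induction over `scale X` (the renewal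
identity `Cop + lamE·CE + lamB·C₅ = C₅`); `ne5B_of_damped` (the same from the sliced form).
§4 LOCATED NECESSITY [folklore]: `chainCarriers` / `chainGeneration` / `chain_genLip` / `no_uniform_constant_without_contraction`
— an explicit instance (a chain of domains, one parent each, kernel `θ`, so the profile is reproduced with lamB = 1 EXACTLY, no
contraction) on which `GenLip` holds with `Cop = 1` and the two-run discrepancy of the scale-n piece IS `(n + 1)θⁿ`: `NE5B` fails
for EVERY constant.  So the contraction leaf cannot be dropped from §3, and a damping merely EQUAL to the rate (ω = θ) does
not suffice — the cell's "recent scales carry the rate, old scales fade" needs the fading to be strictly faster than the rate.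
§5 NON-VACUITY [folklore]: `hypotheses_nonvacuous` — on `T4BoundaryCarrier.trivialCarriers` with the empty generation datum and
zero functionals every hypothesis of §3 holds at once (lamB = 0).
§6 (v1.1, additive) THE SLICED DAMPING SPLIT [folklore]: `PerParentDamped` (binder, NOT PRINTED: the influence of ONE
older piece `Y` on the discrepancy at `X` is at most `k₀·ω^{scale X − scale Y}·w X Y` — the ANALYTIC part, one-run template
(3.9) [I]) × `SliceCount` (binder: the localization-weighted COUNT of older parents of one creation step inside the output,
`Σ_{Y: scale Y = j} w X Y e^{−κd(Y)} ≤ Mc·e^{−κd(X)}` — the COMBINATORIAL part, i.e. exactly the located geometry dependence of the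
constant, now its own hypothesis) ⇒ `KernelDamped` with `M = k₀·Mc` (`kernelDamped_of_perParent`); the end-to-end composition
`ne5B_of_perParent`; the chain instance of §4 satisfies both binders non-degenerately (`chain_perParentDamped`, `chain_sliceCount`).
§7 (v1.2, additive) `GenLip` ONE LEVEL DOWN — THE INPUT/OPERATOR SPLIT [folklore]: the generation step typed as a MAP on the
VALUE TABLES of the older pieces (`GenMap`; (3.25)/(3.27): the new boundary piece is produced from the tables
{(U, a) ↦ 𝐁^{(j)}(Y; U, a)}_Y through the t-interpolated expectation, whose measure (3.27) itself carries t·𝐁_k — the map is NOT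
linear in the tables, whence a Lipschitz split and not a superposition), run B's pieces represented by run B's map on run
B's tables (`RepresentsB`), run A's by run A's map (`RepresentsA`); `InputLipB` (NOT PRINTED as a modulus): run B's map is
Lipschitz in its INPUT TABLES within an admissible class, with the kernels `G.K`/`G.KE` — ONE run, two input families; print
has the size bound p. 277 and the one-run MECHANISM (3.6)–(3.7) [I] p. 271: an older term enters the step through its
functional derivative `(δ/δ𝐀)𝐄^{(j)}`, bounded *"Using the above bound, and the analyticity properties of 𝐄^{(j)}"* (pp. 271–272
[I]) — which is why the input discrepancy must be controlled on the (complex) printed spaces and not only at real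
configurations (hazard H-ne5p3g2-1); `OpDisc` (NOT PRINTED): run A's map at the transported background versus run B's map FED
WITH RUN A's TRANSPORTED TABLES — the two-run proper part (the step's operators, covariances and minimizers at two spacings =
spine estimate NE2, the internal backgrounds = NE3 × `LipBackgroundFl`, the unpaired oldest run-B scale) at rate
`Cop·θ^{scale X}e^{−κd(X)}`; `genLip_of_split`: the four ⇒ `GenLip` of §1 with the SAME kernels — so the two-run kernel `K` of §1
IS run B's ONE-RUN input kernel and the contraction leaf of §3 is a one-run statement about run B's generation map (cell
gap G-ne5p3-2 relocated: what remains two-run is `OpDisc` alone); the chain instance of §4 realises the split with `Cop = 1`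
(`chainGenA`, `chainGenB`, `chain_representsA/B`, `chain_inputLipB`, `chain_opDisc`, `chain_genLip_of_split`).  NEAREST
PUBLISHED SHAPE (prior art for the FORM of `GenLip`, a theorem about a different model — many-boson systems, no gauge
field, no large-field hierarchy problem in the UV; nothing about [III] follows from it and it is not used as a hypothesis):
[BFKT2010PowerSeriesII] p. 16 *"we shall compare E_{ε_n}(ε/2; ·) and E_{ε_n}(ε; ·) for each n […]. This is done by induction
on n. For the induction step, we use Proposition III.6"*, Prop. III.6 p. 18: *"‖R_{δ,ε}E − R_{δ,ε/2}Ẽ‖_{2δ} ≤ 2^{36}e^{18K_j}εδ²|||v|||²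
r(δ)²κ(2δ)⁶ + q‖E − Ẽ‖_δ"* — a source ∝ ε plus Lipschitz propagation of the two-run discrepancy with amplification q, i.e.
the shape `Cop·θ^{scale} + Σ K·(input discrepancy)` (located by the cell's literature seat, `t4/T4-LITERATURE.md` §1.32;
pages of the held text `paper:doi-10-1063-1-3329938` read by this seat).  §7 also records the HONEST SLICE COUNT of
Bałaban's geometry: `SliceCountGrowing` (binder, NOT PRINTED: the decay-weighted count of the older parents of step j inside the
output may grow like `V^{scale X − j}`, V the volume entropy per step — in d = 4 up to L⁴ scale-j domains per unit of
scale-(j+1) volume — the output's own size being absorbed by the printed decay surplus (1 + 4β)κ of p. 262),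
`sliceCountGrowing_of_sliceCount` (V = 1 is §6), `kernelDamped_of_perParent_growing` (⇒ `KernelDamped` with damping `ω·V`),
`ne5B_of_perParent_growing` (the smallness is now `k₀Mc(ωV/θ)/(1 − ωV/θ) < 1`: the per-step damping must beat the rate TIMES the
volume entropy, ωV < θ).

§8 (v1.3, additive) THE CAUCHY TOY — WHY THE CARRIERS OF THE INDUCTION MUST BE COMPLEX [folklore]: a minimal instance of
`InputLipB` in which an older piece enters the generated one THROUGH ITS FIELD-DERIVATIVE (the mechanism of (3.6)–(3.7) [I];
published for small-field scalar models — prior art for the MECHANISM only, a different model, nothing about [III] follows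
from it — as [Dimock2013] §4.9, arXiv:1108.1335 PDF p. 32, the paragraph introducing Lemma 22 (p. 33) [held corpus chunk
p0034; v1.3 wrote «pagination p. 34», corrected at a cross-reader's request]: *"one can show that μ*_k, E*_k are analytic functions of
μ_k, E_k on this domain. This means we can use Cauchy bounds to get estimates on partial derivatives in a slightly smaller
region."*).  Carriers `cauchyCarriers`: backgrounds `ℂ × Fin 2` = a one-dimensional complex «field» z with a component index —
the ENCODING of complex-valued tables on the cell's real-valued carriers (component 0 = Re, 1 = Im); generation map
`cauchyGen ρ`: the piece m + 1 at (z, i), ‖z‖ < ρ, is the i-th component of the complex derivative at z of the parent's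
rebuilt table `cplx f m a`, zero-extended off the core ball; admissible class `CauchyAdm ρ r`: the rebuilt tables are
ℂ-differentiable on the LARGER ball of radius ρ + r.  THEOREMS: `cauchy_inputLipB` — `InputLipB` holds with kernel `2 / r`
(Cauchy's estimate on circles of radius r inside the margin, Mathlib `Complex.norm_deriv_le_of_forall_mem_sphere_norm_le`; the
factor 2 is the price of bounding a complex discrepancy through its two real components, `Complex.norm_le_abs_re_add_abs_im`):
the output lives on a SMALLER ball than its inputs and the kernel is inverse to the margin — p. 277's *"The analyticity
domains become smaller after each step"* in its simplest form; `real_points_insufficient` — for every K there are admissible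
(entire) tables agreeing to within 1 at every REAL field whose generated pieces differ by more than K at the origin (witness:
0 against the components of sin(N·), N > K): NO kernel can be fed by a discrepancy known at real configurations only.  This
is the kernel form of hazard H-ne5p3g2-1 and the reason for the reading «complex points» in convention (e) above; it models
nothing of [III] beyond the mechanism named.

§9 (v1.4, additive) THE PRINTED LOCALIZATION GAIN AS A DAMPING SHAPE OF ANY POWER; THE TILTED-AVERAGE TOY [folklore].
(9a) `ExpDamped G L c k₀ w` (binder, NOT PRINTED for the two-run discrepancy kernel; the printed ONE-RUN template typed
literally): `K X Y ≤ k₀·exp(−c·L^{scale X − scale Y})·w X Y` — (3.9) [I]'s `exp(−½δ₀M(L^jη)^{−1})`, p. 272's `exp(−δκ(L^jη)^{−1})`, with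
`(L^jη)^{−1} = L^{k−j}` the scale separation; `exp_neg_mul_mul_pow_le` (`e^{−cx}·x^N ≤ (N/(ce))^N`) ⇒ `perParentDamped_of_expDamped`:
§6's `PerParentDamped` with `ω = (L^N)⁻¹` for EVERY power `N` and the L-independent constant `k₀·(N/(ce))^N` — the typed form of
*"a small factor O((L^jη)^N) with an arbitrary power N"*; `ne5B_of_expDamped`: the end-to-end composition through
`ne5B_of_perParent_growing`, whose effective-damping condition `(L^N)⁻¹·V < θ` is met by choosing `N` above the volume-entropy
and rate exponents (`inv_pow_mul_pow_lt`: θ = L^{−a}, V = L^{b}, any N > a + b) and whose smallness holds for `L ≥ 2(1 + K)`, K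
the product of the constants (`smallness_of_le`, `smallness_of_large`; the end-to-end constant is then ≤ 2(Cop + lamE·CE));
`chain_expDamped` (non-degeneracy on §4's chain).  READING [analysis, this cell]: at the level of SHAPES the located
volume-entropy growth `V^{scale X − j}` of §7's `SliceCountGrowing` is neutralised by the printed arbitrary-power gain, as p. 271
[I] says it is in one run (*"enough to control the sums"*) — CONDITIONAL on the two-run discrepancy kernel of `InputLipB`
inheriting the one-run damping, which is NOT PRINTED (the cell gap on `InputLipB` is unchanged).  (9b) WHERE THE
CONTRACTION DOES NOT COME FROM — the tilted-average toy: on §4's chain carriers the generation map `lseGen` (the piece m + 1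
is the logarithm of the uniform exponential average of the tables of ALL its parents 0, …, m — the shape of the
t-expectation ⟨·⟩_{s,t} of (3.27), whose measure carries the older tables through t·𝐁_k), the class `LseAdm M` of tables
bounded by M, the datum `lseGeneration M` (every older piece a parent, kernel `e^{2M}/#parents`).  THEOREMS:
`abs_log_sum_exp_sub_le` (the logarithm of an exponential sum of P arguments bounded by M is Lipschitz with the kernel
`e^{2M}/P` per argument — from `x + 1 ≤ eˣ` and `log u ≤ u − 1`), `lse_inputLipB` — §7's `InputLipB` BY NAME for this genuinely
nonlinear map; `lse_shift` — a shift common to all parents passes through EXACTLY; `lse_noContraction` — ANY generation datum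
validating `InputLipB` for `lseGen` on `LseAdm M` (M > 0, window nonempty) has kernel rows of total mass ≥ 1 (witness: the
zero tables against the constant tables M).  So an expectation-type nonlinearity is MASS-PRESERVING and cannot supply the
contraction leaf of §3 (cf. §4: mass exactly 1 ⇒ no uniform constant); in (3.27) the contraction can only come from the
localization gain acting on the DIFFERENCE `𝐁_k(U_k(·)) − 𝐁_k(U_{k+1})` carried by the t-integrand — (3.6)–(3.9) [I] applied to
𝐁_k by [III] p. 276, i.e. (9a).  Both toys model nothing of [III] beyond the mechanism named.

§10 (v1.5, additive) `InputLipB` ONE LEVEL DOWN — THE FLUCTUATION-DIFFERENCE FACTORISATION; THE DISPLACEMENT TOY; THE EXPLICIT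
CONSTANT [folklore].  (10a) By (3.15) p. 268 and (3.27) p. 271 [III] the older pieces enter the last fluctuation-field integral ONLY
through the inserted differences `𝐁_k(U_k(exp i[g_kC𝐀_k − hD̃(g_kC𝐀_k)]V^{(k)})) − 𝐁_k(U_{k+1})` (in the t-integrand, and multiplied
by t in the measure ⟨·⟩_{s,t}).  Typed: `FluctChart C A` (datum: the admissible fluctuation configurations `supp X` — the second
factor of the printed space (3.43) p. 276 —, the output's CORE `core X` of backgrounds — its own, smaller space, p. 277 —, and the
displaced background `chart X U 𝒜`), `fluct ch f X Y U 𝒜 a := f Y (chart X U 𝒜) a − f Y U a` (LINEAR in the table, `fluct_sub`), and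
two leaves: `TiltLip G ch Φ W κ Adm KT` (binder, NOT PRINTED as a modulus, ONE run: the generation map depends on the older boundary
tables only through their inserted differences on `core × supp` and is Lipschitz in them with kernel `KT` — mass-type, cf. §9b)
and `FluctDamped G ch W κ Adm σ` (binder: a discrepancy bound `D·e^{−κd(Y)}` of two admissible tables at ALL backgrounds controls
the discrepancy of their inserted differences on the core by the factor `σ X Y`).  THEOREMS: `inputLipB_of_fluct` — §7's
`InputLipB` BY NAME for the datum with kernel `KT·σ` (`fluctGeneration`); `fluctDamped_of_one` — `FluctDamped` follows BY
LINEARITY from its ONE-TABLE form `FluctDampedOne` (a sup bound of ONE admissible table controls its own inserted differences by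
`σ`) as soon as the admissible class is closed under differences: the damping of the two-run discrepancy kernel has NO two-run
content beyond membership of run A's transported tables in run B's linear admissible class — hypothesis `hadmA` of §7 (the
cell's hazard H-ne5p3g2-2) — because the printed mechanism is linear in the functional; `perParentDamped_of_fluct` /
`expDamped_of_fluct` (a bounded tilt modulus and a geometric, resp. super-exponential, profile of `σ` in the scale separation
give §6's `PerParentDamped`, resp. §9's `ExpDamped`, with constant `kT·s₀`); `ne5B_of_fluct`, `ne5B_of_fluct_exp` (end-to-end
through `ne5B_of_split`, `ne5B_of_expDamped` BY NAME).  PRINTED MECHANISM of `FluctDampedOne`, [I] p. 273 [render p0273], typed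
ABSTRACTLY and asserted for nothing of Bałaban's: the old term's variation under the fluctuation-induced displacement of its
background is *"the Cauchy integral (1/2πi)∫_{|t_□|=r} dt_□ (1/t_□²)𝐄^{(j)}(X,…,…), (3.15) with the radius r given by the
equality r max{|δ𝐇_j|_X, |P₁δ𝐇_j|_X, |∇^ξ_𝐔δ𝐇_j|_X, |Δ^ξ_𝐔δ𝐇_j|_X} = ⅓α₂"*, whence *"|(3.15)| ≤ (1/r)E₀exp(−κd_j(X)) ≤
E₀exp(−κd_j(X))6α₂^{−1}L^jηB₀B₃ × exp(−½δ₀dist^{(ξ)}(X,□) − ½δ₀M(L^jη)^{−1})|ζ_□𝐇_k(B′)|, (3.17)"* — `σ` = DISPLACEMENT OVER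
MARGIN, times the term's own one-run sup bound (1.18) — and *"Let us stress that it follows only from the fact that 𝐇_j(B(t))
satisfies (3.14) with 1/3α₂, and δ𝐇_j satisfies (3.9)"*; [III] p. 276 applies *"the formulas (3.6), (3.7) [I]"* to the terms of
𝐁_k and p. 277 takes the margin from *"a part of the analyticity domains of terms in 𝐁_k"*.  LOCATED [analysis, this cell;
sharpens §9's reading]: the super-exponential factor of (3.17) is the FAR SECTOR only ((3.9): dist^{(ξ)}(X,□) ≥ M(L^jη)^{−1};
`ExpDamped`); for big old domains the small factor is the term's own decay (p. 272, from (1.18)); and for the NEAR sector [I]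
p. 273 says *"This case includes all localization domains of small sizes, and with small distances to □, hence without
obvious small factors. The real renormalization problem is connected exactly with this case"* — treated by (3.18)ff [I] and by
[II] for the E-terms, whose count-versus-decay arithmetic IS displayed ([Balaban1988RG2Cluster, (1.26) p. 8, (1.30)–(1.32) and
Lemma 1, (1.33)–(1.36) p. 9]: *"𝐄_k(U_k(exp iB′V^{(k)})) − 𝐄_k(U_k(V^{(k)})) = Σ_{Y∈D_k} 𝐕′_k(Y, U_{k+1}, B)"*, (1.33), with
*"|𝐕′_k(Y, 𝐔, 𝐉, B)| ≤ E₀ε₁C₁M^q exp C₂κ₁ exp(−(1−2δ)κd_k(Y))"*, (1.36)).  For BOUNDARY pieces print displays NO profile of `σ`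
in the scale separation and NO such arithmetic (p. 276 *"much simpler"*, p. 277 *"estimated as in (2.42), but with the additional
factor O(ε_k)"*, *"They contribute to the bound (2.38)"*); the reading that their `σ` is damped GEOMETRICALLY — the decay of
𝐇_k(B′) from Ω_{k+1} across the layers Ω_j∖Ω_{j+1} of the multi-scale cover of p. 275 (*"the exponential decay of
propagators and minimizing functions yields additional small factors"*, p. 276) against the *"exponentially decreasing"*
margins of p. 277 — is this cell's; whence the
GEOMETRIC profile is the primary end-to-end form (`ne5B_of_fluct`) and §3's contraction requires that ratio `ω` to beat `θ/V`
(§7) — NOT PRINTED (the cell gap on `InputLipB` is now split into `TiltLip`, the profile of `σ`, and `hadmA`).  (10b) THE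
DISPLACEMENT TOY on §8's carriers: `shiftChart ρ s` (displacements `|𝒜| ≤ s` of the complex background, core `‖z‖ < ρ`),
`CauchyAdmT`; `cauchy_fluctDampedOne` — `FluctDampedOne` with `σ = 4s/r` for `s ≤ r/2`, by Cauchy's estimate on circles of radius
`r/2` and the mean value inequality on the disc of radius `ρ + r/2` (Mathlib); `cauchy_fluctDamped` (linearity); `fd_tiltLip` +
`fd_inputLipB` — the finite-displacement generation map `fdGen` realises `TiltLip` with modulus 1, hence `InputLipB` with kernel
`4s/r`: the FINITE displacement over the margin, against §8's derivative kernel `2/r`; `fluct_idTab` (`σ` is not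
`o(displacement)`).  (10c) THE EXPLICIT CONSTANT (records a cross-reader's advisory on v1.4): `ne5B_mono`, `div_le_two_mul`,
`smallness_half_of_le`, `constant_le_two_of_large`, `ne5B_of_expDamped_two` — in §9's regime (`θ = (L^a)⁻¹`, `V = L^b`,
`ω = (L^N)⁻¹`, `a + b + 1 ≤ N`, `L ≥ 2(1 + k₀(N/(ce))^N·Mc)`) `NE5B` holds with the constant `2·(Cop + lamE·CE)`.

§11 (v1.6, additive) THE PROFILE OF `σ` FOR BOUNDARY PARENTS — THE LAYERED FORM OVER THE MULTI-SCALE COVER; ITS REGIME [folklore].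
`LayeredDamped G σ s₀ δ ρ w` (binder, NOT PRINTED as a display; the located reading of [III] pp. 255–256, 261, 276–277 typed
abstractly and asserted for nothing of Bałaban's): `σ X Y ≤ s₀·Σ_{i ≤ scale Y} δ^{(scale X − scale Y)+i}·ρ^i·w X Y` — a sum, over
the layers on which the parent's printed space (2.34)–(2.39) constrains the background (*"on X∩(Ω_n∖Ω_{n+1}) for n = 1, …, j − 1,
or on X∩Ω_j for n = j"*, p. 261), of (displacement bound on the layer)/(gap on the layer).  The displacement is sourced in the
fluctuation region (*"the fluctuation field is localized in Ω_{k+1}, and the exponential decay of propagators and minimizing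
functions yields additional small factors"*, p. 276; for the terms of 𝐁_k *"The localized expansion is over domains Y₀ ∈ 𝐃_k
having nonempty intersections with Λ_{k+1}"*, p. 276) and reaches the parent across the collars of the scales in between, each
*"at least equal to 2MR_j"* wide in its own scale (p. 256), walked by random walks over *"cubes in proper scales"* (p. 276):
whence a scale-free ratio `δ` per collar — a HYPOTHESIS (print displays no per-collar constant of 𝐇_k in the geometry {Ω_j}:
*"we apply Theorems 3.7–3.10 [13] in their full generality"*, p. 276); the located content of p. 277's *"The localization of the
fluctuation field, and the exponential decay of the minimizing function 𝐇_k imply that this difference is still much greater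
than bounds on this function"* is that it holds at EVERY number of steps as soon as `δ ≤ 1/2` (`displacement_le_domainDifference`).
The GAP between the scale-j parent's space and the index-(k+1) space on the layer `n ≤ j` is `β(2^{−(j−n)} − 2^{−(k+1−n)})α_{·,n} ≥
½β2^{−(j−n)}α_{·,n}` — UNIFORM IN k, halving per OLDER layer of the parent (absorbed with the unit conversions in `ρ`); p. 277's
*"exponentially decreasing"* difference is the per-STEP shrink of the CURRENT space, not the parent's gap — this SHARPENS the
wording of §10's reading above (*"against the 'exponentially decreasing' margins"*); parents reaching later layers pay their
own localization decay, booked in the weights.  THEOREMS: `layerSum_le` (`Σ_i δ^{m+i}ρ^i ≤ δ^m/(1 − δρ)`, the geometric sum);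
`profile_of_layered` — the layered form IS §10's geometric profile, ratio `δ`, constant `s₀/(1 − δρ)`, as soon as the
per-collar decay beats the older layers' factors (`δρ < 1`); `layeredDamped_of_profile` (converse: the binder generalises
§10's hypothesis form); `perParentDamped_of_layered`; `ne5B_of_layered` — END-TO-END through `ne5B_of_fluct` BY NAME with the
effective-damping condition `δ·V < θ` (the per-collar decay must beat the rate times the volume entropy);
`ne5B_of_layered_two` (the constant `2·(Cop + lamE·CE)` when `δV/θ ≤ 1/(2(1 + K))`, `K = kT·(s₀/(1 − δρ))·Mc`); NUMBERS
`exp_neg_mul_pow_lt_inv_pow` (`δ = e^{−c}`, `V = L^b`, `θ = (L^a)⁻¹`: `δV < θ ⇐ c > (a + b)·log L` — FIXED powers of the blocking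
factor against the collar constant; cf. (2.5) p. 255 *"R_j is the smallest number of the form L^r such, that
R_j ≥ (log g_j^{−2})^r"*); NO-GO `not_expDamped_of_geometric_lower` with the instance `starGeneration` (`star_perParentDamped`,
`star_geometric_lower`, `star_not_expDamped`): a kernel realising the geometric profile from below at every scale separation is
NOT `ExpDamped` for any `L > 1`, `c > 0`, `k₀ ≥ 0` — §9's arbitrary-power route (`ne5B_of_expDamped`, `ne5B_of_fluct_exp`) is
unavailable for such a kernel, §7/§10's geometric route is the one, and the located slice-count growth must then be beaten by
the per-collar decay, not by a power of `L`.  THE CELL GAP, TYPED NOT DECIDED: in the located reading the profile of `σ` for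
boundary parents is GEOMETRIC with the ratio of the per-collar decay of 𝐇_k across the multi-scale cover — neither a power of
`L` (no power gain on the parent's own layer: p. 276's *"replace η = L^{−k} by L^{−n}"* gives `L^jL^{−n}`, = 1 at `n = j`; [I]
p. 273 *"without obvious small factors"*) nor super-exponential; print displays neither the per-collar constant nor the two-run
form of any of it — `δ`, `ρ`, `FluctDamped`, `TiltLip` remain hypotheses, and §3's contraction leaf is, for boundary parents,
exactly the inequality `δ·V < θ` between three located-but-undisplayed constants.  THE SERIES' OWN ONE-RUN TEMPLATE OF THE
PER-COLLAR FACTOR (v1.6.2; CONTEXT only — ONE run, the PROPAGATORS; read by this cell as IMAGES on the renders ref1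
`1985-cmp99-background-propagators` p021/p022/p024 = journal pp. 409/410/412, and `1987-cmp109-rg-I-small-field` p051 = p. 299,
`1988-cmp119-convergent-renormalization` p043 = p. 285 for the reference): [III] p. 276's *"Theorems 3.7–3.10 [13]"* is [13] of
[I]'s reference list (*"13. Bałaban, T.: Propagators for lattice gauge theories in a background field. Commun. Math. Phys. 99,
389–434 (1985)"*; [III]'s own list has only [I], [II] *"and references therein"*) = [Balaban1985BackgroundPropagators].  There,
for the propagators of a sequence {Ω_j}: (3.89) *"|(K(h_□)G′_□h_□λ)(x)| ≤ O(M^{−1})e^{−δ₀(L^jη)^{−1}|y−y′|}|λ|"* *"for x∈Δ(y), supp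
λ ⊂ Δ(y′), y, y′ ∈ □ ∈ 𝒟_j. It is exactly the bound (2.44) of [4], rescaled to η-scale."*; Theorem 3.7: *"For M sufficiently large,
and a configuration U satisfying (3.35), the operator G′ can be represented as G′ = G′₀(I − R′)^{−1} = G′₀Σ_{n=0}^∞R′^n =
Σ_ω h_{□₀}G′_{□₀}h_{□₀}K(h_{□₁})G′_{□₁}h_{□₁}·····K(h_{□_n})G′_{□_n}h_{□_n}, (3.90) where ω = (□₀, □₁, ···, □_n), □_i ∈ 𝒟,
□_i∩□_{i+1} ≠ ∅. The expansion is convergent in all norms appearing in the inequalities (3.42)–(3.47)."*; p. 410: *"There are two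
important factors, one is a product of the factors O(M^{−1}), and one is an exponential factor, connected with this in (3.89)."*,
each localized term *"can be estimated by"* (3.92) *"O(1)(L^jη)²e^{−δ₀d(y,y₁)}O(M^{−1})e^{−δ₀d(y₁,y₂)}·····O(M^{−1})e^{−δ₀d(y_n,y′)}
|Δ(y′)λ|"*, (3.93) *"d(ω, y, y′) = inf_{(y₁,y₂,…,y_n)} (d(y, y₁) + d(y₁, y₂) + ··· + d(y_{n−1}, y_n) + d(y_n, y′))"*, Corollary 3.8:
*"The term in the expansion (3.90) corresponding to a walk ω = (□₀, □₁,…, □_n) depends on U restricted to □̃₀⁵∪□̃₁⁵∪…∪□̃_n⁵,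
and |Δ(y)h_{□₀}G′_{□₀}h_{□₀}Π_{i=1}^n K(h_{□_i})G′_{□_i}h_{□_i}Δ(y′)λ| ≤ O(1)(L^jη)²O(M^{−1/2})^{|ω|}M^{−1/2|ω|}e^{−(1/2)δ₀d(ω,y,y′)}|Δ(y′)λ|
(3.94) for y ∈ □₀∩Λ_j, y′ ∈ □_n. Similar estimates hold for the other norms."*; p. 412: *"We have proved in [2] that if we have a
difference of propagators defined on two domains, then in an estimate of this difference we have, besides the usual factors
connected with propagators of a considered type, an exponential factor with a distance between localizations and a closest
point where a change was made. Such inequalities were proved using only the random walk expansions, hence they are valid for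
all propagators we have considered in [4]."*, *"they are valid for propagators defined by sequences {Ω_j} with Ω₀ contained in a
cube for which the condition (3.25) is satisfied"*, and such differences *"can be estimated by the usual factors multiplied by
e^{−2δ₀M}. We have to notice only that the operators may differ outside □̃₀, and the distance from □̃ to □̃₀ᶜ is at least M (on
L^{−j}-scale)."*  READING [analysis, this cell]: in the audited series itself the ONE-run propagators of the multi-scale
sequence have a random walk expansion over the cubes of the multi-scale partition 𝒟 whose terms carry `O(M^{−1/2})` per step and
`e^{−½δ₀d(ω,y,y′)}` with the distances measured in the cubes' OWN scales ((3.89): `δ₀(L^jη)^{−1}|y − y′|` in □ ∈ 𝒟_j), and a change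
of the domain at scaled distance ≥ M costs `e^{−2δ₀M}`: the scale-free, per-collar shape of (b)'s `δ` below (with [III]'s collar
widths *"at least equal to 2MR_j"*, p. 256) IS DISPLAYED — for the propagators G′, G, ONE run.  Its transfer to the minimizers 𝐇_k
and to the inserted fluctuation differences of the terms of 𝐁_k is [III] p. 276's sentence *"we apply Theorems 3.7–3.10 [13] in
their full generality"*, not a display, and nothing of it exists for two runs: `δ` stays a hypothesis of this module, and
`LayeredDamped`'s «print displays no per-collar constant» reads: none for 𝐇_k, none for the boundary terms, none for two runs.
NEAREST PUBLISHED SHAPE (v1.6.1; ONE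
run, the scalar φ⁴₃ model done Bałaban's way, PRIOR ART ONLY — nothing imported, nothing of it asserted for Bałaban's terms or for
two runs; read by this cell in the author's arXiv e-print TeX sources held in the cell inputs, `inputs/files/dimock/src/1304.0705/
1304.0705.tex` ll. 1304–1318 with the footnote ll. 428–429 (= held corpus `paper:arxiv-1304.0705`, chunk 12 of 24) and
`inputs/files/dimock/src/1212.5562/1212.5562.tex` ll. 3589–3592; macros expanded: 𝖭 = the last step, 𝛀 = the sequence of
small-field regions, X^♮ = X shrunk by [r_k] layers of cubes): [Dimock2013BalabanIII, §2.7 «final localization»] *"|φ_{𝖭,δ𝛀′} −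
φ_{𝖭,𝛀″}| ≤ e^{−r_𝖭/2}"*, *"This holds since G_{𝖭,δ𝛀′} and G_{𝖭,𝛀″} have random walk expansions differing only in Ω^{2♮}_{𝖭+1} which
is at least [r_𝖭] layers of M-cubes away from Λ_𝖭 − Ω^♮_{𝖭+1}. Hence we can write"* the contour integral *"(1/2πi)∫_{|t| = e^{r_𝖭}/2}
dt/(t(t−1)) E⁺_𝖭(X, φ_{𝖭,δ𝛀″} + t(φ_{𝖭,δ𝛀′} − φ_{𝖭,𝛀″}))"* [contour radius and the primes/δ's exactly as in the source] *"and have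
the estimate |E⁺_𝖭(X, φ_{𝖭,δ𝛀′}) − E⁺_𝖭(X, φ_{𝖭,𝛀″})| ≤ e^{−r_𝖭/2}CM³λ_𝖭^{−4δ}e^{−κd_M(X)} ≤ λ_𝖭^{n₀+1}e^{−κd_M(X)}"*, with the
footnote of §2.1 *"Let r_k = (−log λ_k)^r. Recall that for a union of M cubes X in 𝕋^{−k}_{𝖬+𝖭−k}, X* is an enlargement by
[r_k] layers of M cubes, and X^♮ is a shrinkage of X by [r_k] layers of M cubes."*; and at the GENERAL step [Dimock2013BalabanII,
§3.9 «estimates», proof of the local expansion of R^{(6)}_{𝛑,Ω_{k+1}} (Lemma 3.8 by count of the e-print source, label `r6`)] *"But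
Ω^♮_{k+1} and Ω^c_{k+1} are separated by [r_{k+1}] layers of LM cubes. Thus the minimum number of steps is approximately
2[r_{k+1}], which allows us to extract a factor e^{−r_{k+1}}."* — i.e. in the published scalar template a change of the Green's
function [r] LAYERS OF CUBES AWAY (cubes of the layer's own scale) displaces the background by `e^{−r/2}`, scale-free in the
number of layers crossed = the shape of (b)'s per-collar ratio `δ` of `LayeredDamped` below (with r_k = (−log λ_k)^r in the place
of (2.5)'s R_j ≥ (log g_j^{−2})^r), and the activity difference is a Cauchy contour integral in the interpolation parameter over
a margin `e^{+r/2}` times the displacement = the shape of §10's `FluctDampedOne` with `σ` = displacement/margin.  Not render-read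
(no PDF rasteriser on the hub in this session; the PDFs are `inputs/files/dimock/1304.0705.pdf`, `…/1212.5562.pdf`); the
gauge-field version and every TWO-RUN form remain NOT PRINTED.

CITATION HEADER.  derivedFrom: [Balaban1988Convergent, (2.2)–(2.5) p.255, p.256, (2.34)–(2.42) pp.261–262, (3.15) p.268,
(3.25) p.270, (3.27) p.271, pp.275–279] (shape of the generation step, the inserted fluctuation differences, the printed spaces,
the multi-scale cover and its collars, CONTEXT only);
[Balaban1989LargeFieldII, (1.98)–(1.101) p.390] (the R-step's boundary pieces, CONTEXT only);
[Balaban1987RG1, (3.5)–(3.9) pp.271–272, (3.14)–(3.18) p.273] (one-run template of the damping and of the input mechanism — the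
Cauchy form (3.15)–(3.17) of the displacement-over-margin factor —, CONTEXT only); [Balaban1988RG2Cluster, (1.26) p.8,
(1.30)–(1.36) p.9] (the E-terms' displayed count-versus-decay arithmetic and Lemma 1, CONTEXT only);
[Balaban1985BackgroundPropagators, (3.89)–(3.94) pp.409–410 (Thm 3.7, Cor. 3.8), p.412] (the series' ONE-run random walk expansion
of the multi-scale propagators — factors O(M^{−1})e^{−δ₀d} per step with distances in the cubes' own scales; differences of
propagators defined on two domains — = [13] of [I] cited on [III] p.276, CONTEXT only);
[BFKT2010PowerSeriesII, Prop. III.6 p.18] (nearest published SHAPE of the generation-step Lipschitz propagation, prior art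
only); [Dimock2013, Lemma 22] (published one-run MECHANISM of the input modulus — analyticity in the input activities + Cauchy —
prior art only); [Dimock2013BalabanIII, §2.7; Dimock2013BalabanII, §3.9] (published one-run SHAPE of §11's per-collar displacement
factor — *"at least [r_𝖭] layers of M-cubes away"* ⇒ `e^{−r_𝖭/2}` — and of the Cauchy step over it, scalar φ⁴₃ template, prior art
only); tree `T4BoundaryCarrier` (carriers, `NE5B`), `T4OutputRate` (`NE5`, `Window`).  All theorems [folklore] (finite sums,
strong induction, the triangle inequality, explicit instances, Cauchy's estimate from Mathlib in §8, the elementary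
inequalities `x + 1 ≤ eˣ`, `log u ≤ u − 1` in §9, Cauchy's estimate and the mean value inequality from Mathlib in §10, geometric
sums and `exists_pow_lt_of_lt_one` from Mathlib in §11).
-/

namespace Literature.MathematicalPhysics.QuantumFieldTheory.Balaban1983to89.T4BoundaryRate

open Finset T4OutputRate T4BoundaryCarrier
open scoped BigOperators

/-! ## §1 The generation datum and the leaves (binders only — nothing asserted) -/

/-- THE GENERATION DATUM over the boundary carriers (printed in words: (3.27) p. 271, p. 276, (1.98)–(1.101) p. 390; the
finite sets and kernels themselves are NOT PRINTED objects but bookkeeping of "which older pieces feed the piece indexed by X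
and how strongly"): `parents X` = the older BOUNDARY pieces entering the generation of X (the t-integral of (3.27) and the
R-step's first group), `eparents X` = the older REGULAR inputs (E- and R-pieces: the s-integral and the third expression of
(3.27)), both of strictly smaller creation step, with nonnegative influence kernels.  Finite sets: the torus is fixed and
finite, so every `𝐃_j` is finite. [cite: Balaban1988Convergent, (3.27) p.271] -/
structure Generation (C : T4BoundaryCarrier.Carriers) where
  /-- the older boundary pieces feeding `X` -/
  parents : C.Dom → Finset C.Dom
  /-- they are strictly older -/
  parents_lt : ∀ X, ∀ Y ∈ parents X, C.scale Y < C.scale X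
  /-- the older regular (E- and R-) inputs feeding `X` -/
  eparents : C.Dom → Finset C.Dom
  /-- they are strictly older -/
  eparents_lt : ∀ X, ∀ Y ∈ eparents X, C.scale Y < C.scale X
  /-- influence kernel of the older boundary pieces -/
  K : C.Dom → C.Dom → ℝ
  K_nonneg : ∀ X Y, 0 ≤ K X Y
  /-- influence kernel of the older regular inputs -/
  KE : C.Dom → C.Dom → ℝ
  KE_nonneg : ∀ X Y, 0 ≤ KE X Y

variable {C : T4BoundaryCarrier.Carriers}

/-- Binder: the boundary piece indexed by `Y` obeys the two-run bound with constant `D Y` (times the printed decay factor) at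
ALL admissible arguments — every coupling sequence of the window, every run-B background (seen by run A through the
transport), every admissible pending field.  Conventions (a)–(d) of the module docstring are in force: one `Y : C.Dom` = the
same localization domain AND the same large-field data `{S_i ∩ Y}` in both runs; `U : C.BgB` ranges over run B's printed space
(2.34)–(2.39) (zero-extended off it), seen by run A through the transport. [cite: Balaban1988Convergent, (2.42) p.261] -/
def BDiscAt (BA : BFunctional C C.BgA) (BB : BFunctional C C.BgB) (W : Set (ℕ → ℝ)) (κ : ℝ) (D : C.Dom → ℝ)
    (Y : C.Dom) : Prop :=
  ∀ g ∈ W, ∀ (U : C.BgB), ∀ a ∈ C.admFl, |BA g (C.transport U) a Y - BB g U a Y| ≤ D Y * Real.exp (-(κ * C.d Y))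

/-- Binder: the regular input indexed by `Y` obeys the two-run bound with constant `D Y` at all admissible arguments.
[cite: Balaban1988Convergent, (2.27) p.259] -/
def EDiscAt (EA : Functional C.toCarriers C.BgA) (EB : Functional C.toCarriers C.BgB) (W : Set (ℕ → ℝ)) (κ : ℝ)
    (D : C.Dom → ℝ) (Y : C.Dom) : Prop :=
  ∀ g ∈ W, ∀ (U : C.BgB), |EA g (C.transport U) Y - EB g U Y| ≤ D Y * Real.exp (-(κ * C.d Y))

/-- **HYPOTHESIS SHAPE `GenLip`** (NOT PRINTED): ONE GENERATION STEP IS LIPSCHITZ IN ITS OLDER INPUTS up to an operator-rate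
remainder.  Whatever nonnegative constants `D`, `DE` bound the two-run discrepancies of the older boundary pieces `parents X`
and of the older regular inputs `eparents X` at all admissible arguments, the discrepancy of the piece indexed by `X` is at
most `Cop·θ^{scale X}e^{−κd(X)}` (the η-rate of the step's own operators, the internal-background closeness times the background
modulus, the unpaired oldest run-B scale — everything not carried by an input piece) plus the kernel-weighted input bounds.
Print has the one-run size bound of the generated terms, *"estimated as in (2.42), but with the additional factor O(ε_k)"*
(p. 277), and no modulus in the inputs. [cite: Balaban1988Convergent, (3.27) p.271] -/
def GenLip (G : Generation C) (BA : BFunctional C C.BgA) (BB : BFunctional C C.BgB)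
    (EA : Functional C.toCarriers C.BgA) (EB : Functional C.toCarriers C.BgB) (W : Set (ℕ → ℝ)) (κ θ Cop : ℝ) : Prop :=
  ∀ (X : C.Dom) (D DE : C.Dom → ℝ),
    (∀ Y ∈ G.parents X, 0 ≤ D Y) → (∀ Y ∈ G.eparents X, 0 ≤ DE Y) →
    (∀ Y ∈ G.parents X, BDiscAt BA BB W κ D Y) → (∀ Y ∈ G.eparents X, EDiscAt EA EB W κ DE Y) →
    ∀ g ∈ W, ∀ (U : C.BgB), ∀ a ∈ C.admFl,
      |BA g (C.transport U) a X - BB g U a X| ≤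
        Cop * θ ^ C.scale X * Real.exp (-(κ * C.d X))
          + ∑ Y ∈ G.parents X, G.K X Y * (D Y * Real.exp (-(κ * C.d Y)))
          + ∑ Y ∈ G.eparents X, G.KE X Y * (DE Y * Real.exp (-(κ * C.d Y)))

/-- **HYPOTHESIS SHAPE `KernelContracts`** (NOT PRINTED): the boundary influence kernel maps the RATE PROFILE
`θ^{scale Y}e^{−κd(Y)}` of the older pieces into `lamB·θ^{scale X}e^{−κd(X)}`.  Since `scale Y < scale X` and θ < 1, the inputs' profile
is LARGER than the output's by θ^{scale Y − scale X}; the binder says the kernel's own smallness (the one-run template: *"a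
small factor O((L^jη)^N) with an arbitrary power N"*, [I] p. 271; *"the additional factor O(ε_k)"*, p. 277; the decay surplus
(1 + 4β)κ, p. 262) beats that loss with total mass `lamB`. [cite: Balaban1987RG1, (3.9) p.271] -/
def KernelContracts (G : Generation C) (κ θ lamB : ℝ) : Prop :=
  ∀ X : C.Dom, ∑ Y ∈ G.parents X, G.K X Y * (θ ^ C.scale Y * Real.exp (-(κ * C.d Y))) ≤
    lamB * (θ ^ C.scale X * Real.exp (-(κ * C.d X)))

/-- **HYPOTHESIS SHAPE `EKernelContracts`** (NOT PRINTED): the same for the influence kernel of the older REGULAR inputs,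
with total mass `lamE` (no smallness needed: it multiplies the sibling member's constant once). [cite: Balaban1988Convergent, (3.27) p.271] -/
def EKernelContracts (G : Generation C) (κ θ lamE : ℝ) : Prop :=
  ∀ X : C.Dom, ∑ Y ∈ G.eparents X, G.KE X Y * (θ ^ C.scale Y * Real.exp (-(κ * C.d Y))) ≤
    lamE * (θ ^ C.scale X * Real.exp (-(κ * C.d X)))

/-- **HYPOTHESIS SHAPE `KernelDamped`** (NOT PRINTED; the scale-sliced form): the total influence of the older boundary
pieces OF CREATION STEP `j` on the piece indexed by `X`, decay weights included, is at most `M·ω^{scale X − j}e^{−κd(X)}` — a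
DAMPING FACTOR ω per step of scale separation, the two-run analogue of the factor `L^jη = L^{−(k−j)}` of (3.8)–(3.9) [I]
(there for one run and any power).  The constant `M` carries the slice's COUNT of older pieces inside the output's
localization (older large-field geometry) — see the located gap in the module docstring. [cite: Balaban1987RG1, (3.9) p.271] -/
def KernelDamped (G : Generation C) (κ ω M : ℝ) : Prop :=
  ∀ X : C.Dom, ∀ j ∈ range (C.scale X),
    ∑ Y ∈ (G.parents X).filter (fun Y => C.scale Y = j), G.K X Y * Real.exp (-(κ * C.d Y)) ≤
      M * ω ^ (C.scale X - j) * Real.exp (-(κ * C.d X))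

/-! ## §2 Bookkeeping: slice damping strictly faster than the rate ⇒ contraction of the profile -/

/-- Geometric tail: `Σ_{j<n} r^{n−j} ≤ r/(1 − r)` for `0 ≤ r < 1`. [folklore] -/
theorem geomTail_le {r : ℝ} (hr0 : 0 ≤ r) (hr1 : r < 1) (n : ℕ) :
    ∑ j ∈ range n, r ^ (n - j) ≤ r / (1 - r) := by
  have h1r : 0 < 1 - r := by linarith
  induction n with
  | zero => simpa using div_nonneg hr0 h1r.le
  | succ n ih =>
    have hsplit : ∑ j ∈ range (n + 1), r ^ (n + 1 - j) = r * ∑ j ∈ range n, r ^ (n - j) + r := by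
      rw [sum_range_succ, Nat.add_sub_cancel_left, mul_sum]
      congr 1
      · refine sum_congr rfl fun j hj => ?_
        have hj' : j ≤ n := (mem_range.mp hj).le
        rw [show n + 1 - j = (n - j) + 1 by omega, pow_succ, mul_comm]
      · simp
    rw [hsplit]
    have hstep : r * (r / (1 - r)) + r = r / (1 - r) := by
      field_simp
      ring
    calc r * ∑ j ∈ range n, r ^ (n - j) + r ≤ r * (r / (1 - r)) + r := by
          have := mul_le_mul_of_nonneg_left ih hr0
          linarith
      _ = r / (1 - r) := hstep

/-- SLICE DAMPING ⇒ CONTRACTION: if the scale-j slice of the boundary kernel is damped by `M·ω^{scale X − j}` and the damping is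
STRICTLY FASTER than the rate, `ω < θ`, then the kernel contracts the rate profile with total mass `lamB = M(ω/θ)/(1 − ω/θ)`:
`Σ_Y K·θ^{scale Y}e^{−κd(Y)} = Σ_{j<scale X} θ^j·(slice j) ≤ Mθ^{scale X}e^{−κd(X)}·Σ_{j<scale X}(ω/θ)^{scale X − j}`. [folklore] -/
theorem kernelContracts_of_damped {G : Generation C} {κ θ ω M : ℝ} (hθ : 0 < θ) (hω : 0 ≤ ω) (hωθ : ω < θ)
    (hM : 0 ≤ M) (h : KernelDamped G κ ω M) :
    KernelContracts G κ θ (M * (ω / θ) / (1 - ω / θ)) := by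
  intro X
  set n := C.scale X with hn
  have hr0 : 0 ≤ ω / θ := div_nonneg hω hθ.le
  have hr1 : ω / θ < 1 := (div_lt_one hθ).mpr hωθ
  have hmaps : ∀ Y ∈ G.parents X, C.scale Y ∈ range n := fun Y hY => mem_range.mpr (G.parents_lt X Y hY)
  -- slice the sum by creation step
  rw [← sum_fiberwise_of_maps_to hmaps]
  -- bound each slice
  have hslice : ∀ j ∈ range n,
      ∑ Y ∈ (G.parents X).filter (fun Y => C.scale Y = j), G.K X Y * (θ ^ C.scale Y * Real.exp (-(κ * C.d Y))) ≤
        θ ^ j * (M * ω ^ (n - j) * Real.exp (-(κ * C.d X))) := by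
    intro j hj
    have hrw : ∑ Y ∈ (G.parents X).filter (fun Y => C.scale Y = j), G.K X Y * (θ ^ C.scale Y * Real.exp (-(κ * C.d Y)))
        = θ ^ j * ∑ Y ∈ (G.parents X).filter (fun Y => C.scale Y = j), G.K X Y * Real.exp (-(κ * C.d Y)) := by
      rw [mul_sum]
      refine sum_congr rfl fun Y hY => ?_
      rw [(mem_filter.mp hY).2]
      ring
    rw [hrw]
    exact mul_le_mul_of_nonneg_left (h X j hj) (pow_nonneg hθ.le j)
  refine (sum_le_sum hslice).trans ?_
  -- rewrite θ^j ω^{n-j} = θ^n (ω/θ)^{n-j}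
  have hpow : ∀ j ∈ range n, θ ^ j * (M * ω ^ (n - j) * Real.exp (-(κ * C.d X))) =
      M * (θ ^ n * Real.exp (-(κ * C.d X))) * (ω / θ) ^ (n - j) := by
    intro j hj
    have hjn : j ≤ n := (mem_range.mp hj).le
    have hθn : θ ^ n = θ ^ j * θ ^ (n - j) := by rw [← pow_add, Nat.add_sub_cancel' hjn]
    rw [hθn, div_pow]
    have hθnj : θ ^ (n - j) ≠ 0 := pow_ne_zero _ hθ.ne'
    field_simp
    try ring
  rw [sum_congr rfl hpow, ← mul_sum]
  have htail := geomTail_le hr0 hr1 n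
  have hpos : 0 ≤ M * (θ ^ n * Real.exp (-(κ * C.d X))) :=
    mul_nonneg hM (mul_nonneg (pow_nonneg hθ.le n) (Real.exp_pos _).le)
  calc M * (θ ^ n * Real.exp (-(κ * C.d X))) * ∑ j ∈ range n, (ω / θ) ^ (n - j)
      ≤ M * (θ ^ n * Real.exp (-(κ * C.d X))) * ((ω / θ) / (1 - ω / θ)) := mul_le_mul_of_nonneg_left htail hpos
    _ = M * (ω / θ) / (1 - ω / θ) * (θ ^ n * Real.exp (-(κ * C.d X))) := by ring

/-! ## §3 The reduction: induction over the creation step -/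

/-- **THE REDUCTION OF `NE5B` TO THE LEAVES** (kernel bookkeeping; asserts nothing about Bałaban's pieces).  Assume the
generation step is Lipschitz in its older inputs up to the operator-rate remainder `Cop` (`GenLip`), the boundary kernel
contracts the rate profile with mass `lamB < 1` (`KernelContracts`), the regular kernel has mass `lamE` (`EKernelContracts`), and the
older REGULAR inputs obey the sibling member's rate `T4OutputRate.NE5` with constant `CE` (a hypothesis BY NAME — non-circular
by the triangularity E ≺ R ≺ B of (3.27)).  THEN every boundary piece obeys `NE5B` with the SCALE-INDEPENDENT, a-INDEPENDENT
constant `C₅ = (Cop + lamE·CE)/(1 − lamB)`.  Proof: strong induction over the creation step `scale X`; at the step, feed `GenLip` the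
induction hypothesis `D Y = C₅θ^{scale Y}` on the strictly older parents and `DE Y = CEθ^{scale Y}`, contract, and close with the
renewal identity `Cop + lamE·CE + lamB·C₅ = C₅`. [folklore] -/
theorem ne5B_of_generation {G : Generation C} {BA : BFunctional C C.BgA} {BB : BFunctional C C.BgB}
    {EA : Functional C.toCarriers C.BgA} {EB : Functional C.toCarriers C.BgB} {W : Set (ℕ → ℝ)}
    {κ θ Cop CE lamB lamE : ℝ}
    (hGen : GenLip G BA BB EA EB W κ θ Cop) (hK : KernelContracts G κ θ lamB) (hKE : EKernelContracts G κ θ lamE)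
    (hE : NE5 EA EB W κ θ CE)
    (hθ : 0 ≤ θ) (hCop : 0 ≤ Cop) (hCE : 0 ≤ CE) (hlamE : 0 ≤ lamE) (hlamB : lamB < 1) :
    NE5B BA BB W κ θ ((Cop + lamE * CE) / (1 - lamB)) := by
  set C₅ := (Cop + lamE * CE) / (1 - lamB) with hC₅
  have h1 : 0 < 1 - lamB := by linarith
  have hC₅0 : 0 ≤ C₅ := div_nonneg (by positivity) h1.le
  have hren : Cop + lamE * CE + lamB * C₅ = C₅ := by
    rw [hC₅]
    field_simp
    ring
  -- the claim at every creation step, by strong induction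
  suffices hmain : ∀ n : ℕ, ∀ X : C.Dom, C.scale X = n → ∀ g ∈ W, ∀ (U : C.BgB), ∀ a ∈ C.admFl,
      |BA g (C.transport U) a X - BB g U a X| ≤ C₅ * θ ^ C.scale X * Real.exp (-(κ * C.d X)) by
    intro a ha g hg U X
    simpa [atFl_apply] using hmain (C.scale X) X rfl g hg U a ha
  intro n
  induction n using Nat.strong_induction_on with
  | _ n ih =>
    intro X hX g hg U a ha
    -- feed GenLip the induction hypothesis on the parents and the sibling rate on the regular inputs
    have hD : ∀ Y ∈ G.parents X, BDiscAt BA BB W κ (fun Y => C₅ * θ ^ C.scale Y) Y := by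
      intro Y hY g' hg' U' a' ha'
      have hlt : C.scale Y < n := hX ▸ G.parents_lt X Y hY
      have := ih (C.scale Y) hlt Y rfl g' hg' U' a' ha'
      simpa [mul_assoc] using this
    have hDE : ∀ Y ∈ G.eparents X, EDiscAt EA EB W κ (fun Y => CE * θ ^ C.scale Y) Y := by
      intro Y _ g' hg' U'
      have := hE g' hg' U' Y
      simpa [mul_assoc] using this
    have hstep := hGen X (fun Y => C₅ * θ ^ C.scale Y) (fun Y => CE * θ ^ C.scale Y)
      (fun Y _ => mul_nonneg hC₅0 (pow_nonneg hθ _)) (fun Y _ => mul_nonneg hCE (pow_nonneg hθ _)) hD hDE g hg U a ha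
    -- contract the two kernel sums
    have hB : ∑ Y ∈ G.parents X, G.K X Y * (C₅ * θ ^ C.scale Y * Real.exp (-(κ * C.d Y))) ≤
        C₅ * (lamB * (θ ^ C.scale X * Real.exp (-(κ * C.d X)))) := by
      have hrw : ∑ Y ∈ G.parents X, G.K X Y * (C₅ * θ ^ C.scale Y * Real.exp (-(κ * C.d Y))) =
          C₅ * ∑ Y ∈ G.parents X, G.K X Y * (θ ^ C.scale Y * Real.exp (-(κ * C.d Y))) := by
        rw [mul_sum]; exact sum_congr rfl fun Y _ => by ring
      rw [hrw]
      exact mul_le_mul_of_nonneg_left (hK X) hC₅0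
    have hEs : ∑ Y ∈ G.eparents X, G.KE X Y * (CE * θ ^ C.scale Y * Real.exp (-(κ * C.d Y))) ≤
        CE * (lamE * (θ ^ C.scale X * Real.exp (-(κ * C.d X)))) := by
      have hrw : ∑ Y ∈ G.eparents X, G.KE X Y * (CE * θ ^ C.scale Y * Real.exp (-(κ * C.d Y))) =
          CE * ∑ Y ∈ G.eparents X, G.KE X Y * (θ ^ C.scale Y * Real.exp (-(κ * C.d Y))) := by
        rw [mul_sum]; exact sum_congr rfl fun Y _ => by ring
      rw [hrw]
      exact mul_le_mul_of_nonneg_left (hKE X) hCE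
    calc |BA g (C.transport U) a X - BB g U a X|
        ≤ Cop * θ ^ C.scale X * Real.exp (-(κ * C.d X))
            + ∑ Y ∈ G.parents X, G.K X Y * (C₅ * θ ^ C.scale Y * Real.exp (-(κ * C.d Y)))
            + ∑ Y ∈ G.eparents X, G.KE X Y * (CE * θ ^ C.scale Y * Real.exp (-(κ * C.d Y))) := hstep
      _ ≤ Cop * θ ^ C.scale X * Real.exp (-(κ * C.d X)) + C₅ * (lamB * (θ ^ C.scale X * Real.exp (-(κ * C.d X))))
            + CE * (lamE * (θ ^ C.scale X * Real.exp (-(κ * C.d X)))) := by linarith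
      _ = (Cop + lamE * CE + lamB * C₅) * (θ ^ C.scale X * Real.exp (-(κ * C.d X))) := by ring
      _ = C₅ * θ ^ C.scale X * Real.exp (-(κ * C.d X)) := by rw [hren]; ring

/-- The reduction from the SLICED damping form: `GenLip` + `KernelDamped ω M` with `ω < θ` and `M(ω/θ)/(1 − ω/θ) < 1` +
`EKernelContracts lamE` + the sibling rate ⇒ `NE5B`.  The smallness condition is on the product of the slice constant `M` (which
carries O(ε_k) AND the older large-field geometry) and the damping-to-rate ratio. [folklore] -/
theorem ne5B_of_damped {G : Generation C} {BA : BFunctional C C.BgA} {BB : BFunctional C C.BgB}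
    {EA : Functional C.toCarriers C.BgA} {EB : Functional C.toCarriers C.BgB} {W : Set (ℕ → ℝ)}
    {κ θ ω M Cop CE lamE : ℝ}
    (hGen : GenLip G BA BB EA EB W κ θ Cop) (hKd : KernelDamped G κ ω M) (hKE : EKernelContracts G κ θ lamE)
    (hE : NE5 EA EB W κ θ CE)
    (hθ : 0 < θ) (hω : 0 ≤ ω) (hωθ : ω < θ) (hM : 0 ≤ M) (hsmall : M * (ω / θ) / (1 - ω / θ) < 1)
    (hCop : 0 ≤ Cop) (hCE : 0 ≤ CE) (hlamE : 0 ≤ lamE) :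
    NE5B BA BB W κ θ ((Cop + lamE * CE) / (1 - M * (ω / θ) / (1 - ω / θ))) :=
  ne5B_of_generation hGen (kernelContracts_of_damped hθ hω hωθ hM hKd) hKE hE hθ.le hCop hCE hlamE hsmall

/-! ## §4 Located necessity of the contraction leaf: an explicit instance with lamB = 1 and NO uniform constant -/

/-- The chain carriers: domains `ℕ` with creation step `n ↦ n` and length 0; one background per run, zero gauge, identity
transport; one pending field, admissible. [folklore] -/
abbrev chainCarriers : T4BoundaryCarrier.Carriers where
  Dom := ℕ
  scale := fun n => n
  d := fun _ => 0
  d_nonneg := fun _ => le_rfl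
  BgA := Unit
  BgB := Unit
  gauge := fun _ _ => 0
  gauge_nonneg := fun _ _ => le_rfl
  transport := fun _ => ()
  Fl := Unit
  admFl := Set.univ

/-- The chain generation datum with kernel value `k₀ ≥ 0`: the piece `n + 1` has the single parent `n`, no regular inputs.
[folklore] -/
def chainGeneration (k₀ : ℝ) (hk : 0 ≤ k₀) : Generation chainCarriers where
  parents := fun n : ℕ => (range n).filter (fun m : ℕ => m + 1 = n)
  parents_lt := fun n m hm => by
    have h := (mem_filter.mp hm).1
    simpa using h
  eparents := fun _ => ∅
  eparents_lt := fun _ _ h => by simp at h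
  K := fun _ _ => k₀
  K_nonneg := fun _ _ => hk
  KE := fun _ _ => 0
  KE_nonneg := fun _ _ => le_rfl

/-- Run A's chain functional: the piece of creation step n is the constant `(n + 1)θⁿ`. [folklore] -/
def chainBA (θ : ℝ) : BFunctional chainCarriers chainCarriers.BgA := fun _ _ _ (n : ℕ) => ((n : ℝ) + 1) * θ ^ n

/-- Run B's chain functional: zero. [folklore] -/
def chainBB : BFunctional chainCarriers chainCarriers.BgB := fun _ _ _ _ => 0

/-- The zero regular inputs on the chain (run A). [folklore] -/
def chainEA : Functional chainCarriers.toCarriers chainCarriers.BgA := fun _ _ _ => 0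

/-- The zero regular inputs on the chain (run B). [folklore] -/
def chainEB : Functional chainCarriers.toCarriers chainCarriers.BgB := fun _ _ _ => 0

/-- On the chain, the parents of the piece `n + 1` are `{n}`. [folklore] -/
theorem chain_parents_succ (k₀ : ℝ) (hk : 0 ≤ k₀) (n : ℕ) :
    (chainGeneration k₀ hk).parents (n + 1) = ({n} : Finset ℕ) := by
  ext m
  simp only [chainGeneration, mem_filter, mem_range, mem_singleton]
  omega

/-- On the chain, the piece `0` has no parents. [folklore] -/
theorem chain_parents_zero (k₀ : ℝ) (hk : 0 ≤ k₀) : (chainGeneration k₀ hk).parents 0 = (∅ : Finset ℕ) := by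
  ext m
  simp [chainGeneration]

/-- On the chain with kernel `θ` the rate profile is reproduced EXACTLY: `KernelContracts` holds with lamB = 1 (the single
parent n of n + 1 contributes θ·θⁿ = θ^{n+1}; so no lamB < 1 is available when θ > 0). [folklore] -/
theorem chain_kernelContracts_one {θ : ℝ} (hθ : 0 ≤ θ) : KernelContracts (chainGeneration θ hθ) 0 θ 1 := by
  intro n
  cases n with
  | zero =>
    rw [chain_parents_zero, sum_empty]
    simp
  | succ n =>
    rw [chain_parents_succ, sum_singleton]
    simp [chainGeneration, pow_succ, mul_comm]

/-- The chain functionals satisfy `GenLip` with `Cop = 1` on the chain with kernel θ (zero regular inputs, any window, κ = 0):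
`(n + 2)θ^{n+1} ≤ θ^{n+1} + θ·D n` whenever `(n + 1)θⁿ ≤ D n`. [folklore] -/
theorem chain_genLip {θ : ℝ} (hθ : 0 ≤ θ) (W : Set (ℕ → ℝ)) :
    GenLip (chainGeneration θ hθ) (chainBA θ) chainBB chainEA chainEB W 0 θ 1 := by
  intro n D DE _ _ hD _ g hg U a ha
  cases n with
  | zero =>
    rw [chain_parents_zero, sum_empty]
    simp [chainGeneration, chainBA, chainBB]
  | succ n =>
    have hpar : n ∈ (chainGeneration θ hθ).parents (n + 1) := by
      rw [chain_parents_succ]; exact mem_singleton_self n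
    have hIH := hD n hpar g hg U a ha
    have hθn : 0 ≤ θ ^ n := pow_nonneg hθ n
    have hθn1 : 0 ≤ θ ^ (n + 1) := pow_nonneg hθ (n + 1)
    have hA : |chainBA θ g (chainCarriers.transport U) a n - chainBB g U a n| = ((n : ℝ) + 1) * θ ^ n := by
      simp only [chainBA, chainBB, sub_zero]
      exact abs_of_nonneg (mul_nonneg (by positivity) hθn)
    have hA1 : |chainBA θ g (chainCarriers.transport U) a (n + 1) - chainBB g U a (n + 1)| =
        ((n : ℝ) + 1 + 1) * θ ^ (n + 1) := by
      simp only [chainBA, chainBB, sub_zero]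
      rw [abs_of_nonneg (mul_nonneg (by positivity) hθn1)]
      push_cast
      ring
    rw [hA] at hIH
    rw [hA1, chain_parents_succ, sum_singleton]
    simp only [chainGeneration, sum_empty, add_zero, chainCarriers, zero_mul, neg_zero, Real.exp_zero, mul_one,
      one_mul] at hIH ⊢
    have hθD : θ * (((n : ℝ) + 1) * θ ^ n) ≤ θ * D n := mul_le_mul_of_nonneg_left hIH hθ
    calc ((n : ℝ) + 1 + 1) * θ ^ (n + 1) = θ ^ (n + 1) + θ * (((n : ℝ) + 1) * θ ^ n) := by ring
      _ ≤ θ ^ (n + 1) + θ * D n := by linarith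

/-- **LOCATED NECESSITY OF THE CONTRACTION LEAF** [folklore].  On the chain instance with kernel θ > 0 every hypothesis of
`ne5B_of_generation` holds EXCEPT `lamB < 1` (the profile is reproduced with lamB = 1 exactly: damping EQUAL to the rate),
with `Cop = 1` and zero regular inputs — and `NE5B` FAILS FOR EVERY CONSTANT, because the discrepancy of the scale-n piece is
`(n + 1)θⁿ`.  So a scale-uniform constant in the two-run rate of the boundary pieces needs the influence of old pieces to
fade STRICTLY faster than the rate θ^{scale} degrades toward old scales; "bounded influence" or "fading at the rate" is not
enough. -/
theorem no_uniform_constant_without_contraction {θ : ℝ} (hθ0 : 0 < θ) :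
    GenLip (chainGeneration θ hθ0.le) (chainBA θ) chainBB chainEA chainEB (Window 1) 0 θ 1 ∧
      KernelContracts (chainGeneration θ hθ0.le) 0 θ 1 ∧ EKernelContracts (chainGeneration θ hθ0.le) 0 θ 0 ∧
      NE5 chainEA chainEB (Window 1) 0 θ 0 ∧ ∀ C₅ : ℝ, ¬ NE5B (chainBA θ) chainBB (Window 1) 0 θ C₅ := by
  refine ⟨chain_genLip hθ0.le _, chain_kernelContracts_one hθ0.le, ?_, ?_, ?_⟩
  · intro n
    simp [chainGeneration]
  · intro g _ U X
    simp [chainEA, chainEB]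
  · intro C₅ hNE
    -- the window is inhabited by the constant sequence 1
    have hg : (fun _ : ℕ => (1 : ℝ)) ∈ Window 1 := fun _ => ⟨one_pos, le_rfl⟩
    obtain ⟨n, hn⟩ : ∃ n : ℕ, C₅ < (n : ℝ) + 1 := ⟨⌈C₅⌉₊, by linarith [Nat.le_ceil C₅]⟩
    have h := hNE () (Set.mem_univ _) (fun _ => (1 : ℝ)) hg () n
    have hA : |atFl (chainBA θ) () (fun _ => (1 : ℝ)) (chainCarriers.transport ()) n - atFl chainBB () (fun _ => 1) () n|
        = ((n : ℝ) + 1) * θ ^ n := by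
      simp only [chainBA, chainBB, sub_zero]
      exact abs_of_nonneg (mul_nonneg (by positivity) (pow_nonneg hθ0.le n))
    rw [hA] at h
    simp only [mul_zero, neg_zero, Real.exp_zero, mul_one] at h
    have hθn : 0 < θ ^ n := pow_pos hθ0 n
    have : (n : ℝ) + 1 ≤ C₅ := le_of_mul_le_mul_right h hθn
    linarith

/-! ## §5 Non-vacuity of the hypothesis list of §3 -/

/-- The EMPTY generation datum on any carriers: no parents, zero kernels. [folklore] -/
def emptyGeneration (C : T4BoundaryCarrier.Carriers) : Generation C where
  parents := fun _ => ∅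
  parents_lt := fun _ _ h => by simp at h
  eparents := fun _ => ∅
  eparents_lt := fun _ _ h => by simp at h
  K := fun _ _ => 0
  K_nonneg := fun _ _ => le_rfl
  KE := fun _ _ => 0
  KE_nonneg := fun _ _ => le_rfl

/-- NON-VACUITY: on `T4BoundaryCarrier.trivialCarriers` with the empty generation datum and zero functionals, every
hypothesis of `ne5B_of_generation` holds at once (Cop = CE = lamE = lamB = 0, θ = 1/2), and so does its conclusion — the hypothesis
list is jointly satisfiable by shape.  (Says nothing about Bałaban's pieces.) [folklore] -/
theorem hypotheses_nonvacuous :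
    let C := trivialCarriers
    let G := emptyGeneration C
    let BA : BFunctional C C.BgA := fun _ _ _ _ => 0
    let BB : BFunctional C C.BgB := fun _ _ _ _ => 0
    let EA : Functional C.toCarriers C.BgA := fun _ _ _ => 0
    let EB : Functional C.toCarriers C.BgB := fun _ _ _ => 0
    GenLip G BA BB EA EB (Window 1) 1 (1 / 2) 0 ∧ KernelContracts G 1 (1 / 2) 0 ∧ EKernelContracts G 1 (1 / 2) 0 ∧
      NE5 EA EB (Window 1) 1 (1 / 2) 0 ∧ NE5B BA BB (Window 1) 1 (1 / 2) ((0 + 0 * 0) / (1 - 0)) := by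
  refine ⟨?_, ?_, ?_, ?_, ?_⟩
  · intro X D DE _ _ _ _ g _ U a _
    simp [emptyGeneration]
  · intro X; simp [emptyGeneration]
  · intro X; simp [emptyGeneration]
  · intro g _ U X; simp
  · intro a _ g _ U X
    simp [atFl_apply]

/-! ## §6 (v1.1, additive) The sliced damping split: per-parent analytic damping × slice geometry count -/

/-- **HYPOTHESIS SHAPE `PerParentDamped`** (NOT PRINTED, two-run; the ANALYTIC part of `KernelDamped`): the influence of the
single older piece localized in `Y` on the discrepancy of the new piece at `X` is at most `k₀ · ω^{scale X − scale Y} · w X Y`,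
with `w X Y ≥ 0` a localization weight of the output expansion.  One-run template: the factor `L^jη = L^{−(k−j)}` of
(3.8)–(3.9) [I] and the gain `O((L^jη)^N)` after localization (B12 p.271), applied to the boundary terms by B14 p.276 — there
for the SIZE of one run's term, here posited for the DIFFERENCE of two runs. [cite: Balaban1987RG1, (3.9) p.271] -/
def PerParentDamped (G : Generation C) (ω k₀ : ℝ) (w : C.Dom → C.Dom → ℝ) : Prop :=
  ∀ X : C.Dom, ∀ Y ∈ G.parents X, G.K X Y ≤ k₀ * ω ^ (C.scale X - C.scale Y) * w X Y

/-- **HYPOTHESIS SHAPE `SliceCount`** (NOT PRINTED; the COMBINATORIAL part of `KernelDamped`; the located geometry dependence of the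
constant made its own binder): for every output `X` and every older creation step `j`, the localization-weighted count of the
parents of step `j`, each with its own decay weight, is at most `Mc` times the output's decay weight:
`Σ_{Y ∈ parents X, scale Y = j} w X Y · e^{−κd(Y)} ≤ Mc · e^{−κd(X)}`.  In Bałaban's setting the parents of step `j` inside the
output's localization domain are the domains `Y ∈ 𝐃_j` meeting the large-field region `Z_j^~` ((2.41) p.261), so `Mc` counts
OLDER LARGE-FIELD GEOMETRY inside the output; print controls such sums only inside the weighted expansion (through the small
factors carried by the pending renormalization operations), not per boundary term — whence a sparse-geometry class or a
booking of `Mc` inside the pending weights is needed for a geometry-uniform constant (record §4, gap G-ne5p3-3).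
[cite: Balaban1988Convergent, (2.41) p.261] -/
def SliceCount (G : Generation C) (κ : ℝ) (w : C.Dom → C.Dom → ℝ) (Mc : ℝ) : Prop :=
  ∀ X : C.Dom, ∀ j ∈ range (C.scale X),
    ∑ Y ∈ (G.parents X).filter (fun Y => C.scale Y = j), w X Y * Real.exp (-(κ * C.d Y)) ≤ Mc * Real.exp (-(κ * C.d X))

/-- THE SPLIT [folklore]: per-parent damping with constant `k₀` and weights `w`, times the slice count `Mc` of the same weights,
gives the sliced kernel damping `KernelDamped` with `M = k₀ · Mc`. -/
theorem kernelDamped_of_perParent {G : Generation C} {κ ω k₀ Mc : ℝ} {w : C.Dom → C.Dom → ℝ}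
    (hω : 0 ≤ ω) (hk₀ : 0 ≤ k₀) (hP : PerParentDamped G ω k₀ w) (hS : SliceCount G κ w Mc) :
    KernelDamped G κ ω (k₀ * Mc) := by
  intro X j hj
  have hfac : 0 ≤ k₀ * ω ^ (C.scale X - j) := mul_nonneg hk₀ (pow_nonneg hω _)
  calc ∑ Y ∈ (G.parents X).filter (fun Y => C.scale Y = j), G.K X Y * Real.exp (-(κ * C.d Y))
      ≤ ∑ Y ∈ (G.parents X).filter (fun Y => C.scale Y = j),
          k₀ * ω ^ (C.scale X - j) * (w X Y * Real.exp (-(κ * C.d Y))) := by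
        apply sum_le_sum
        intro Y hY
        rcases mem_filter.mp hY with ⟨hYp, hYj⟩
        have h1 : G.K X Y ≤ k₀ * ω ^ (C.scale X - C.scale Y) * w X Y := hP X Y hYp
        rw [hYj] at h1
        have he : 0 ≤ Real.exp (-(κ * C.d Y)) := (Real.exp_pos _).le
        calc G.K X Y * Real.exp (-(κ * C.d Y))
            ≤ (k₀ * ω ^ (C.scale X - j) * w X Y) * Real.exp (-(κ * C.d Y)) := mul_le_mul_of_nonneg_right h1 he
          _ = k₀ * ω ^ (C.scale X - j) * (w X Y * Real.exp (-(κ * C.d Y))) := by ring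
    _ = k₀ * ω ^ (C.scale X - j) *
          ∑ Y ∈ (G.parents X).filter (fun Y => C.scale Y = j), w X Y * Real.exp (-(κ * C.d Y)) := by
        rw [mul_sum]
    _ ≤ k₀ * ω ^ (C.scale X - j) * (Mc * Real.exp (-(κ * C.d X))) :=
        mul_le_mul_of_nonneg_left (hS X j hj) hfac
    _ = k₀ * Mc * ω ^ (C.scale X - j) * Real.exp (-(κ * C.d X)) := by ring

/-- END-TO-END FROM THE SPLIT [folklore]: `GenLip` + `PerParentDamped k₀ w` + `SliceCount w Mc` + `EKernelContracts` + the
regular inputs' rate, with damping strictly faster than the rate (`ω < θ`) and the smallness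
`k₀·Mc·(ω/θ)/(1 − ω/θ) < 1`, give `NE5B` with the scale- and field-uniform constant
`(Cop + lamE·CE)/(1 − k₀·Mc·(ω/θ)/(1 − ω/θ))` — geometry enters ONLY through `Mc`. -/
theorem ne5B_of_perParent {G : Generation C} {BA : BFunctional C C.BgA} {BB : BFunctional C C.BgB}
    {EA : Functional C.toCarriers C.BgA} {EB : Functional C.toCarriers C.BgB} {W : Set (ℕ → ℝ)}
    {κ θ ω k₀ Mc Cop CE lamE : ℝ} {w : C.Dom → C.Dom → ℝ}
    (hGen : GenLip G BA BB EA EB W κ θ Cop) (hP : PerParentDamped G ω k₀ w) (hS : SliceCount G κ w Mc)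
    (hKE : EKernelContracts G κ θ lamE) (hE : NE5 EA EB W κ θ CE)
    (hθ : 0 < θ) (hω : 0 ≤ ω) (hωθ : ω < θ) (hk₀ : 0 ≤ k₀) (hMc : 0 ≤ Mc)
    (hsmall : k₀ * Mc * (ω / θ) / (1 - ω / θ) < 1) (hCop : 0 ≤ Cop) (hCE : 0 ≤ CE) (hlamE : 0 ≤ lamE) :
    NE5B BA BB W κ θ ((Cop + lamE * CE) / (1 - k₀ * Mc * (ω / θ) / (1 - ω / θ))) :=
  ne5B_of_damped hGen (kernelDamped_of_perParent hω hk₀ hP hS) hKE hE hθ hω hωθ (mul_nonneg hk₀ hMc) hsmall hCop hCE hlamE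

/-- NON-DEGENERACY OF THE TWO NEW BINDERS on the chain instance of §4 (kernel `k₀`, one parent `n` of `n + 1`): with unit
weights and any damping `0 < ω`, `PerParentDamped` holds with constant `k₀/ω` (the single parent is exactly one step older).
[folklore] -/
theorem chain_perParentDamped {k₀ ω : ℝ} (hk : 0 ≤ k₀) (hω : 0 < ω) :
    PerParentDamped (chainGeneration k₀ hk) ω (k₀ / ω) (fun _ _ => 1) := by
  intro n m hm
  cases n with
  | zero =>
    rw [chain_parents_zero] at hm
    simp at hm
  | succ n =>
    rw [chain_parents_succ, mem_singleton] at hm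
    subst hm
    have h1 : chainCarriers.scale (m + 1) - chainCarriers.scale m = 1 := Nat.add_sub_cancel_left m 1
    have h2 : k₀ / ω * ω = k₀ := by field_simp
    simp only [chainGeneration, h1, pow_one, mul_one, h2, le_refl]

/-- … and `SliceCount` holds with unit weights, κ = 0 and `Mc = 1` (each older creation step contributes at most its one
domain). [folklore] -/
theorem chain_sliceCount {k₀ : ℝ} (hk : 0 ≤ k₀) :
    SliceCount (chainGeneration k₀ hk) 0 (fun _ _ => 1) 1 := by
  intro n j hj
  cases n with
  | zero =>
    simp at hj
  | succ n =>
    rw [chain_parents_succ, filter_singleton]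
    by_cases hjn : n = j
    · subst hjn
      simp
    · have hjn' : ¬ (chainCarriers.scale n = j) := hjn
      simp [hjn']

/-! ## §7 (v1.2, additive) `GenLip` one level down: the input/operator split; the growing slice count -/

/-- VALUE TABLES of boundary pieces over a background carrier `Bg`: older domain ↦ background ↦ pending field ↦ value — the
form in which the older pieces enter a generation step ((3.25) p. 270 / (3.27) p. 271: through their values at the step's
internal backgrounds `U_k(…)`, `U_{k+1}`). [folklore] -/
abbrev BTable (C : T4BoundaryCarrier.Carriers) (Bg : Type) : Type := C.Dom → Bg → C.Fl → ℝ

/-- VALUE TABLES of regular inputs over a background carrier `Bg`. [folklore] -/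
abbrev ETable (C : T4BoundaryCarrier.Carriers) (Bg : Type) : Type := C.Dom → Bg → ℝ

/-- A GENERATION MAP over the background carrier `Bg`: (coupling sequence, tables of the older boundary pieces, tables of the
older regular inputs, output domain X, background, pending field) ↦ the value of the generated piece.  Abstract: nothing of
(3.27)–(3.30), pp. 276–279 or (1.98)–(1.101) is modelled. [folklore] -/
abbrev GenMap (C : T4BoundaryCarrier.Carriers) (Bg : Type) : Type :=
  (ℕ → ℝ) → BTable C Bg → ETable C Bg → C.Dom → Bg → C.Fl → ℝ

/-- Run B's own boundary tables at the coupling sequence `g`. [folklore] -/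
abbrev tabB (BB : BFunctional C C.BgB) (g : ℕ → ℝ) : BTable C C.BgB := fun Y U a => BB g U a Y

/-- Run A's own boundary tables at the coupling sequence `g`. [folklore] -/
abbrev tabA (BA : BFunctional C C.BgA) (g : ℕ → ℝ) : BTable C C.BgA := fun Y V a => BA g V a Y

/-- Run A's boundary tables PULLED BACK to run-B backgrounds along the transport. [folklore] -/
abbrev pullB (BA : BFunctional C C.BgA) (g : ℕ → ℝ) : BTable C C.BgB := fun Y U a => BA g (C.transport U) a Y

/-- Run B's own regular-input tables. [folklore] -/
abbrev etabB (EB : Functional C.toCarriers C.BgB) (g : ℕ → ℝ) : ETable C C.BgB := fun Y U => EB g U Y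

/-- Run A's own regular-input tables. [folklore] -/
abbrev etabA (EA : Functional C.toCarriers C.BgA) (g : ℕ → ℝ) : ETable C C.BgA := fun Y V => EA g V Y

/-- Run A's regular-input tables pulled back to run-B backgrounds along the transport. [folklore] -/
abbrev epullB (EA : Functional C.toCarriers C.BgA) (g : ℕ → ℝ) : ETable C C.BgB := fun Y U => EA g (C.transport U) Y

/-- Binder: run B's boundary pieces ARE the values of run B's generation map on run B's own older tables, at every admissible
argument ((3.25)/(3.27) read as "the piece indexed by X is a function of the older pieces' tables and of the step's own
operators"; for a piece with no parents the map ignores the tables). [cite: Balaban1988Convergent, (3.25) p.270] -/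
def RepresentsB (Φ : GenMap C C.BgB) (BB : BFunctional C C.BgB) (EB : Functional C.toCarriers C.BgB)
    (W : Set (ℕ → ℝ)) : Prop :=
  ∀ g ∈ W, ∀ (X : C.Dom) (U : C.BgB), ∀ a ∈ C.admFl, BB g U a X = Φ g (tabB BB g) (etabB EB g) X U a

/-- Binder: run A's boundary pieces are the values of run A's generation map on run A's own older tables.
[cite: Balaban1988Convergent, (3.25) p.270] -/
def RepresentsA (ΦA : GenMap C C.BgA) (BA : BFunctional C C.BgA) (EA : Functional C.toCarriers C.BgA)
    (W : Set (ℕ → ℝ)) : Prop :=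
  ∀ g ∈ W, ∀ (X : C.Dom) (V : C.BgA), ∀ a ∈ C.admFl, BA g V a X = ΦA g (tabA BA g) (etabA EA g) X V a

/-- **HYPOTHESIS SHAPE `InputLipB`** (NOT PRINTED as a modulus; ONE run, two input families): run B's generation map is
LIPSCHITZ IN ITS INPUT TABLES within an admissible class `Adm` — whatever nonnegative constants bound, at all admissible
arguments, the differences of two admissible families of older boundary tables on `parents X` and of regular tables on
`eparents X`, the two outputs at `X` differ by at most the kernel-weighted sum of those bounds, with the kernels `G.K`, `G.KE` of
the generation datum.  One-run mechanism in print, for SIZES only: (3.6)–(3.7) [I] p. 271 (an older term enters through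
`(δ/δ𝐀)𝐄^{(j)}(X, exp iξ𝐇_j(B(t))U_{k+1})`, bounded *"Using the above bound, and the analyticity properties of 𝐄^{(j)}"*), applied to
the boundary terms by [III] p. 276 and sized p. 277 *"as in (2.42), but with the additional factor O(ε_k)"*.  Because the input
enters through a derivative, a faithful `Adm`/discrepancy bound lives on the printed complex spaces (2.34)–(2.39), not only at
real configurations (hazard H-ne5p3g2-1 of the cell record). [cite: Balaban1987RG1, (3.7) p.271] -/
def InputLipB (G : Generation C) (Φ : GenMap C C.BgB) (W : Set (ℕ → ℝ)) (κ : ℝ)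
    (Adm : (ℕ → ℝ) → BTable C C.BgB → ETable C C.BgB → Prop) : Prop :=
  ∀ g ∈ W, ∀ (f f' : BTable C C.BgB) (e e' : ETable C C.BgB), Adm g f e → Adm g f' e' →
    ∀ (X : C.Dom) (D DE : C.Dom → ℝ),
      (∀ Y ∈ G.parents X, 0 ≤ D Y) → (∀ Y ∈ G.eparents X, 0 ≤ DE Y) →
      (∀ Y ∈ G.parents X, ∀ (U : C.BgB), ∀ a ∈ C.admFl, |f Y U a - f' Y U a| ≤ D Y * Real.exp (-(κ * C.d Y))) →
      (∀ Y ∈ G.eparents X, ∀ (U : C.BgB), |e Y U - e' Y U| ≤ DE Y * Real.exp (-(κ * C.d Y))) →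
      ∀ (U : C.BgB), ∀ a ∈ C.admFl,
        |Φ g f e X U a - Φ g f' e' X U a| ≤
          ∑ Y ∈ G.parents X, G.K X Y * (D Y * Real.exp (-(κ * C.d Y)))
            + ∑ Y ∈ G.eparents X, G.KE X Y * (DE Y * Real.exp (-(κ * C.d Y)))

/-- **HYPOTHESIS SHAPE `OpDisc`** (NOT PRINTED; the two-run proper part): run A's generation map at the transported background
versus run B's generation map FED WITH RUN A's TRANSPORTED TABLES differ by at most `Cop·θ^{scale X}e^{−κd(X)}` — everything the two
steps do differently to the SAME inputs: covariances, propagators, averaging and minimizers at spacings ε and ε/L (spine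
estimate NE2, `T4EtaRate`), the internal backgrounds `U_k(…)` of the two runs (NE3: `T4OutputRate.BackgroundsClose` times the
background modulus `LipBackgroundFl` of the transported tables), and run B's unpaired oldest scale.  The manuscripts construct
ONE run; no such comparison is printed. [cite: Balaban1988Convergent, (3.27) p.271] -/
def OpDisc (ΦA : GenMap C C.BgA) (Φ : GenMap C C.BgB) (BA : BFunctional C C.BgA) (EA : Functional C.toCarriers C.BgA)
    (W : Set (ℕ → ℝ)) (κ θ Cop : ℝ) : Prop :=
  ∀ g ∈ W, ∀ (X : C.Dom) (U : C.BgB), ∀ a ∈ C.admFl,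
    |ΦA g (tabA BA g) (etabA EA g) X (C.transport U) a - Φ g (pullB BA g) (epullB EA g) X U a| ≤
      Cop * θ ^ C.scale X * Real.exp (-(κ * C.d X))

/-- **THE SPLIT OF `GenLip`** [folklore].  If both runs' pieces are represented by their generation maps, run B's map is
input-Lipschitz within a class containing run B's own tables AND run A's transported tables (the latter membership is where
hazard H-ne5p3g2-2 — the transport maps run B's printed space into run A's — is consumed), and the operator discrepancy has rate
`Cop`, then `GenLip` of §1 holds with the SAME `Cop` and the SAME kernels: insert run B's map fed with run A's transported tables
and use the triangle inequality.  Consequently the two-run influence kernel of §1 IS run B's one-run input kernel. -/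
theorem genLip_of_split {G : Generation C} {ΦA : GenMap C C.BgA} {Φ : GenMap C C.BgB}
    {BA : BFunctional C C.BgA} {BB : BFunctional C C.BgB}
    {EA : Functional C.toCarriers C.BgA} {EB : Functional C.toCarriers C.BgB} {W : Set (ℕ → ℝ)} {κ θ Cop : ℝ}
    {Adm : (ℕ → ℝ) → BTable C C.BgB → ETable C C.BgB → Prop}
    (hRA : RepresentsA ΦA BA EA W) (hRB : RepresentsB Φ BB EB W) (hIL : InputLipB G Φ W κ Adm)
    (hOD : OpDisc ΦA Φ BA EA W κ θ Cop)
    (hadmA : ∀ g ∈ W, Adm g (pullB BA g) (epullB EA g)) (hadmB : ∀ g ∈ W, Adm g (tabB BB g) (etabB EB g)) :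
    GenLip G BA BB EA EB W κ θ Cop := by
  intro X D DE hD0 hDE0 hD hDE g hg U a ha
  have h1 := hOD g hg X U a ha
  have h2 := hIL g hg (pullB BA g) (tabB BB g) (epullB EA g) (etabB EB g) (hadmA g hg) (hadmB g hg) X D DE hD0 hDE0
    (fun Y hY U' a' ha' => hD Y hY g hg U' a' ha') (fun Y hY U' => hDE Y hY g hg U') U a ha
  have h3 := abs_sub_le (ΦA g (tabA BA g) (etabA EA g) X (C.transport U) a)
    (Φ g (pullB BA g) (epullB EA g) X U a) (Φ g (tabB BB g) (etabB EB g) X U a)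
  rw [hRA g hg X (C.transport U) a ha, hRB g hg X U a ha]
  linarith

/-- Run B's CHAIN generation map with kernel `k₀` (instance of §4): the piece `m + 1` is `k₀ ×` the table of its single parent
`m` read at the same arguments; the piece `0` is generated from nothing. [folklore] -/
def chainGenB (k₀ : ℝ) : GenMap chainCarriers chainCarriers.BgB := fun _ f _ (n : ℕ) U a =>
  match n with
  | 0 => 0
  | m + 1 => k₀ * f m U a

/-- Run A's CHAIN generation map: the same input part with kernel `θ` plus the OPERATOR SOURCE `θ^{m+1}` (and `1` for the
piece `0`). [folklore] -/
def chainGenA (θ : ℝ) : GenMap chainCarriers chainCarriers.BgA := fun _ f _ (n : ℕ) V a =>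
  match n with
  | 0 => 1
  | m + 1 => θ * f m V a + θ ^ (m + 1)

/-- On the chain, run B's zero functional is represented by `chainGenB k₀`. [folklore] -/
theorem chain_representsB (k₀ : ℝ) (W : Set (ℕ → ℝ)) : RepresentsB (chainGenB k₀) chainBB chainEB W := by
  intro g _ n U a _
  cases n with
  | zero => simp [chainGenB, chainBB]
  | succ m => simp [chainGenB, chainBB]

/-- On the chain, run A's functional `(n + 1)θⁿ` is represented by `chainGenA θ`: `(m + 2)θ^{m+1} = θ·(m + 1)θ^m + θ^{m+1}`. [folklore] -/
theorem chain_representsA (θ : ℝ) (W : Set (ℕ → ℝ)) : RepresentsA (chainGenA θ) (chainBA θ) chainEA W := by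
  intro g _ n V a _
  cases n with
  | zero => simp [chainGenA, chainBA]
  | succ m =>
    simp only [chainGenA, chainBA, Nat.succ_eq_add_one, pow_succ]
    push_cast
    ring

/-- On the chain, `chainGenB k₀` is input-Lipschitz with the chain kernel `k₀` (every table admissible, κ = 0). [folklore] -/
theorem chain_inputLipB {k₀ : ℝ} (hk : 0 ≤ k₀) (W : Set (ℕ → ℝ)) :
    InputLipB (chainGeneration k₀ hk) (chainGenB k₀) W 0 (fun _ _ _ => True) := by
  intro g _ f f' e e' _ _ n D DE _ _ hD _ U a ha
  cases n with
  | zero =>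
    rw [chain_parents_zero, sum_empty]
    simp [chainGenB, chainGeneration]
  | succ m =>
    have hpar : m ∈ (chainGeneration k₀ hk).parents (m + 1) := by
      rw [chain_parents_succ]; exact mem_singleton_self m
    have h := hD m hpar U a ha
    rw [chain_parents_succ, sum_singleton]
    simp only [chainGenB, chainGeneration, sum_empty, add_zero, chainCarriers, mul_zero, neg_zero, Real.exp_zero,
      mul_one] at h ⊢
    rw [← mul_sub, abs_mul, abs_of_nonneg hk]
    exact mul_le_mul_of_nonneg_left h hk

/-- On the chain, the operator discrepancy of `chainGenA θ` against `chainGenB θ` fed with run A's (identically transported)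
tables is EXACTLY the source `θ^{n}`: `OpDisc` holds with `Cop = 1`, non-degenerately. [folklore] -/
theorem chain_opDisc {θ : ℝ} (hθ : 0 ≤ θ) (W : Set (ℕ → ℝ)) :
    OpDisc (chainGenA θ) (chainGenB θ) (chainBA θ) chainEA W 0 θ 1 := by
  intro g _ n U a _
  cases n with
  | zero => simp [chainGenA, chainGenB]
  | succ m =>
    have hdiff : chainGenA θ g (tabA (chainBA θ) g) (etabA chainEA g) (m + 1) (chainCarriers.transport U) a
        - chainGenB θ g (pullB (chainBA θ) g) (epullB chainEA g) (m + 1) U a = θ ^ (m + 1) := by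
      simp only [chainGenA, chainGenB]
      ring
    rw [hdiff, abs_of_nonneg (pow_nonneg hθ _)]
    simp

/-- CONSISTENCY OF THE SPLIT WITH §4 [folklore]: on the chain, `genLip_of_split` recovers `chain_genLip` (`GenLip` with `Cop = 1`)
from the four binders of §7 — the split is realisable with the operator source carrying exactly the rate. -/
theorem chain_genLip_of_split {θ : ℝ} (hθ : 0 ≤ θ) (W : Set (ℕ → ℝ)) :
    GenLip (chainGeneration θ hθ) (chainBA θ) chainBB chainEA chainEB W 0 θ 1 :=
  genLip_of_split (Adm := fun _ _ _ => True) (chain_representsA θ W) (chain_representsB θ W) (chain_inputLipB hθ W)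
    (chain_opDisc hθ W) (fun _ _ => trivial) (fun _ _ => trivial)

/-- **HYPOTHESIS SHAPE `SliceCountGrowing`** (NOT PRINTED; the honest form of `SliceCount` in Bałaban's geometry): the
decay-weighted count of the older parents OF STEP `j` inside the output may GROW with the scale separation,
`Σ_{Y ∈ parents X, scale Y = j} w X Y·e^{−κd(Y)} ≤ Mc·V^{scale X − j}·e^{−κd(X)}`, `V` the volume entropy per step (up to L^d domains of
𝐃_j per unit of scale-(j+1) volume; the parents of step j are the `Y ∈ 𝐃_j` with *"X∩Z_j~ ≠ ∅"*-type admissibility inside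
the output, (2.41) p. 261), the output's own size being absorbed into `Mc` by the printed decay surplus of the newly created
terms, p. 262 *"with the number κ replaced, for example, by (1 + 4β)κ"*. [cite: Balaban1988Convergent, p.262] -/
def SliceCountGrowing (G : Generation C) (κ : ℝ) (w : C.Dom → C.Dom → ℝ) (Mc V : ℝ) : Prop :=
  ∀ X : C.Dom, ∀ j ∈ range (C.scale X),
    ∑ Y ∈ (G.parents X).filter (fun Y => C.scale Y = j), w X Y * Real.exp (-(κ * C.d Y)) ≤
      Mc * V ^ (C.scale X - j) * Real.exp (-(κ * C.d X))

/-- `SliceCount` is the case `V = 1` of `SliceCountGrowing`. [folklore] -/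
theorem sliceCountGrowing_of_sliceCount {G : Generation C} {κ Mc : ℝ} {w : C.Dom → C.Dom → ℝ}
    (h : SliceCount G κ w Mc) : SliceCountGrowing G κ w Mc 1 := by
  intro X j hj
  simpa using h X j hj

/-- THE SPLIT WITH VOLUME ENTROPY [folklore]: per-parent damping `k₀·ω^{scale X − scale Y}·w` times the growing slice count
`Mc·V^{scale X − j}` gives `KernelDamped` with the EFFECTIVE damping `ω·V` and `M = k₀·Mc`. -/
theorem kernelDamped_of_perParent_growing {G : Generation C} {κ ω k₀ Mc V : ℝ} {w : C.Dom → C.Dom → ℝ}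
    (hω : 0 ≤ ω) (hk₀ : 0 ≤ k₀) (hP : PerParentDamped G ω k₀ w) (hS : SliceCountGrowing G κ w Mc V) :
    KernelDamped G κ (ω * V) (k₀ * Mc) := by
  intro X j hj
  have hfac : 0 ≤ k₀ * ω ^ (C.scale X - j) := mul_nonneg hk₀ (pow_nonneg hω _)
  calc ∑ Y ∈ (G.parents X).filter (fun Y => C.scale Y = j), G.K X Y * Real.exp (-(κ * C.d Y))
      ≤ ∑ Y ∈ (G.parents X).filter (fun Y => C.scale Y = j),
          k₀ * ω ^ (C.scale X - j) * (w X Y * Real.exp (-(κ * C.d Y))) := by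
        apply sum_le_sum
        intro Y hY
        rcases mem_filter.mp hY with ⟨hYp, hYj⟩
        have h1 : G.K X Y ≤ k₀ * ω ^ (C.scale X - C.scale Y) * w X Y := hP X Y hYp
        rw [hYj] at h1
        have he : 0 ≤ Real.exp (-(κ * C.d Y)) := (Real.exp_pos _).le
        calc G.K X Y * Real.exp (-(κ * C.d Y))
            ≤ (k₀ * ω ^ (C.scale X - j) * w X Y) * Real.exp (-(κ * C.d Y)) := mul_le_mul_of_nonneg_right h1 he
          _ = k₀ * ω ^ (C.scale X - j) * (w X Y * Real.exp (-(κ * C.d Y))) := by ring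
    _ = k₀ * ω ^ (C.scale X - j) *
          ∑ Y ∈ (G.parents X).filter (fun Y => C.scale Y = j), w X Y * Real.exp (-(κ * C.d Y)) := by
        rw [mul_sum]
    _ ≤ k₀ * ω ^ (C.scale X - j) * (Mc * V ^ (C.scale X - j) * Real.exp (-(κ * C.d X))) :=
        mul_le_mul_of_nonneg_left (hS X j hj) hfac
    _ = k₀ * Mc * (ω * V) ^ (C.scale X - j) * Real.exp (-(κ * C.d X)) := by
        rw [mul_pow]
        ring

/-- END-TO-END WITH VOLUME ENTROPY [folklore]: `GenLip` + `PerParentDamped k₀ w` + `SliceCountGrowing w Mc V` + `EKernelContracts` +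
the regular inputs' rate, with the EFFECTIVE damping strictly faster than the rate (`ω·V < θ`) and the smallness
`k₀·Mc·(ωV/θ)/(1 − ωV/θ) < 1`, give `NE5B` with the scale- and field-uniform constant
`(Cop + lamE·CE)/(1 − k₀·Mc·(ωV/θ)/(1 − ωV/θ))`.  In the cell's bookkeeping (θ = rate per step, ω = the one-run damping per step of
scale separation, V = L^d): old scales fade only if the damping beats rate × volume entropy. -/
theorem ne5B_of_perParent_growing {G : Generation C} {BA : BFunctional C C.BgA} {BB : BFunctional C C.BgB}
    {EA : Functional C.toCarriers C.BgA} {EB : Functional C.toCarriers C.BgB} {W : Set (ℕ → ℝ)}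
    {κ θ ω k₀ Mc V Cop CE lamE : ℝ} {w : C.Dom → C.Dom → ℝ}
    (hGen : GenLip G BA BB EA EB W κ θ Cop) (hP : PerParentDamped G ω k₀ w) (hS : SliceCountGrowing G κ w Mc V)
    (hKE : EKernelContracts G κ θ lamE) (hE : NE5 EA EB W κ θ CE)
    (hθ : 0 < θ) (hω : 0 ≤ ω) (hV : 0 ≤ V) (hωθ : ω * V < θ) (hk₀ : 0 ≤ k₀) (hMc : 0 ≤ Mc)
    (hsmall : k₀ * Mc * (ω * V / θ) / (1 - ω * V / θ) < 1) (hCop : 0 ≤ Cop) (hCE : 0 ≤ CE) (hlamE : 0 ≤ lamE) :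
    NE5B BA BB W κ θ ((Cop + lamE * CE) / (1 - k₀ * Mc * (ω * V / θ) / (1 - ω * V / θ))) :=
  ne5B_of_damped hGen (kernelDamped_of_perParent_growing hω hk₀ hP hS) hKE hE hθ (mul_nonneg hω hV) hωθ
    (mul_nonneg hk₀ hMc) hsmall hCop hCE hlamE

/-- END-TO-END FROM THE SPLIT LEAVES [folklore]: the §7 binders (`RepresentsA/B`, `InputLipB`, `OpDisc`, admissibility of both
runs' tables) in place of `GenLip`, then `ne5B_of_perParent_growing`.  This is the finest reduction of the module: the two-run
content is `OpDisc` (rate `Cop`) alone; everything else is a ONE-RUN statement about run B's generation map or geometry. -/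
theorem ne5B_of_split {G : Generation C} {ΦA : GenMap C C.BgA} {Φ : GenMap C C.BgB}
    {BA : BFunctional C C.BgA} {BB : BFunctional C C.BgB}
    {EA : Functional C.toCarriers C.BgA} {EB : Functional C.toCarriers C.BgB} {W : Set (ℕ → ℝ)}
    {Adm : (ℕ → ℝ) → BTable C C.BgB → ETable C C.BgB → Prop}
    {κ θ ω k₀ Mc V Cop CE lamE : ℝ} {w : C.Dom → C.Dom → ℝ}
    (hRA : RepresentsA ΦA BA EA W) (hRB : RepresentsB Φ BB EB W) (hIL : InputLipB G Φ W κ Adm)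
    (hOD : OpDisc ΦA Φ BA EA W κ θ Cop)
    (hadmA : ∀ g ∈ W, Adm g (pullB BA g) (epullB EA g)) (hadmB : ∀ g ∈ W, Adm g (tabB BB g) (etabB EB g))
    (hP : PerParentDamped G ω k₀ w) (hS : SliceCountGrowing G κ w Mc V)
    (hKE : EKernelContracts G κ θ lamE) (hE : NE5 EA EB W κ θ CE)
    (hθ : 0 < θ) (hω : 0 ≤ ω) (hV : 0 ≤ V) (hωθ : ω * V < θ) (hk₀ : 0 ≤ k₀) (hMc : 0 ≤ Mc)
    (hsmall : k₀ * Mc * (ω * V / θ) / (1 - ω * V / θ) < 1) (hCop : 0 ≤ Cop) (hCE : 0 ≤ CE) (hlamE : 0 ≤ lamE) :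
    NE5B BA BB W κ θ ((Cop + lamE * CE) / (1 - k₀ * Mc * (ω * V / θ) / (1 - ω * V / θ))) :=
  ne5B_of_perParent_growing (genLip_of_split hRA hRB hIL hOD hadmA hadmB) hP hS hKE hE hθ hω hV hωθ hk₀ hMc hsmall
    hCop hCE hlamE

/-! ## §8 (v1.3, additive) The Cauchy toy: `InputLipB` by Cauchy's estimate on complex carriers; real points insufficient -/

open Metric

/-- The Cauchy-toy carriers: domains `ℕ` (creation step `n ↦ n`, length 0); backgrounds `ℂ × Fin 2` — a one-dimensional
complex «field» `z` together with a component index reading the real (`0`) or imaginary (`1`) part of a COMPLEX value: the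
encoding of complex-valued tables on the cell's real-valued carriers; identity transport; one pending field. [folklore] -/
abbrev cauchyCarriers : T4BoundaryCarrier.Carriers where
  Dom := ℕ
  scale := fun n => n
  d := fun _ => 0
  d_nonneg := fun _ => le_rfl
  BgA := ℂ × Fin 2
  BgB := ℂ × Fin 2
  gauge := fun _ _ => 0
  gauge_nonneg := fun _ _ => le_rfl
  transport := fun U => U
  Fl := Unit
  admFl := Set.univ

/-- Component reader: `cpart 0 w = Re w`, `cpart 1 w = Im w`. [folklore] -/
def cpart (i : Fin 2) (w : ℂ) : ℝ := if i = 0 then w.re else w.im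

/-- The component reader is additive. [folklore] -/
theorem cpart_sub (i : Fin 2) (w w' : ℂ) : cpart i w - cpart i w' = cpart i (w - w') := by
  unfold cpart
  split_ifs <;> simp

/-- A component is bounded by the norm. [folklore] -/
theorem abs_cpart_le (i : Fin 2) (w : ℂ) : |cpart i w| ≤ ‖w‖ := by
  unfold cpart
  split_ifs
  · exact Complex.abs_re_le_norm w
  · exact Complex.abs_im_le_norm w

/-- The complex-valued function of the field rebuilt from the two real components of the table of the piece `m`. [folklore] -/
def cplx (f : BTable cauchyCarriers (ℂ × Fin 2)) (m : ℕ) (a : Unit) : ℂ → ℂ :=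
  fun z => ⟨f m (z, 0) a, f m (z, 1) a⟩

/-- The Cauchy-toy generation datum with margin `r > 0`: the piece `n + 1` has the single parent `n`; kernel `2 / r`. [folklore] -/
noncomputable def cauchyGeneration (r : ℝ) (hr : 0 < r) : Generation cauchyCarriers where
  parents := fun n : ℕ => (range n).filter (fun m : ℕ => m + 1 = n)
  parents_lt := fun n m hm => by
    have h := (mem_filter.mp hm).1
    simpa using h
  eparents := fun _ => ∅
  eparents_lt := fun _ _ h => by simp at h
  K := fun _ _ => 2 / r
  K_nonneg := fun _ _ => by positivity
  KE := fun _ _ => 0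
  KE_nonneg := fun _ _ => le_rfl

/-- In the Cauchy toy the parents of the piece `n + 1` are `{n}`. [folklore] -/
theorem cauchy_parents_succ (r : ℝ) (hr : 0 < r) (n : ℕ) :
    (cauchyGeneration r hr).parents (n + 1) = ({n} : Finset ℕ) := by
  ext m
  simp only [cauchyGeneration, mem_filter, mem_range, mem_singleton]
  omega

/-- In the Cauchy toy the piece `0` has no parents. [folklore] -/
theorem cauchy_parents_zero (r : ℝ) (hr : 0 < r) : (cauchyGeneration r hr).parents 0 = (∅ : Finset ℕ) := by
  ext m
  simp [cauchyGeneration]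

/-- The Cauchy-toy generation map with core radius `ρ`: the piece `m + 1` at the field `z` of the core ball `‖z‖ < ρ` is the
(`i`-th component of the) complex FIELD-DERIVATIVE of the parent's table at `z`; zero-extended off the core ball. [folklore] -/
noncomputable def cauchyGen (ρ : ℝ) : GenMap cauchyCarriers (ℂ × Fin 2) :=
  fun _ f _ X U a =>
    match X with
    | 0 => 0
    | m + 1 => if ‖U.1‖ < ρ then cpart U.2 (deriv (cplx f m a) U.1) else 0

/-- The admissible class of the Cauchy toy: every table's complex rebuild is ℂ-differentiable on the LARGER ball of radius
`ρ + r` (core plus margin). [folklore] -/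
def CauchyAdm (ρ r : ℝ) :
    (ℕ → ℝ) → BTable cauchyCarriers (ℂ × Fin 2) → ETable cauchyCarriers (ℂ × Fin 2) → Prop :=
  fun _ f _ => ∀ (m : ℕ) (a : Unit), DifferentiableOn ℂ (cplx f m a) (ball (0 : ℂ) (ρ + r))

/-- **The Cauchy toy realises `InputLipB`** with kernel `2 / r`: a two-table discrepancy known at ALL (complex) fields of
the larger ball controls the field-derivative read on the core ball, by Cauchy's estimate on circles of radius `r`.
[folklore] -/
theorem cauchy_inputLipB (ρ r : ℝ) (hr : 0 < r) (W : Set (ℕ → ℝ)) (κ : ℝ) :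
    InputLipB (cauchyGeneration r hr) (cauchyGen ρ) W κ (CauchyAdm ρ r) := by
  intro g _ f f' e e' hf hf' X D DE hD _ hdisc _ U a ha
  cases X with
  | zero =>
    simp [cauchyGen, cauchyGeneration]
  | succ m =>
    rw [cauchy_parents_succ, sum_singleton]
    have hKE : ∑ Y ∈ (cauchyGeneration r hr).eparents (m + 1),
        (cauchyGeneration r hr).KE (m + 1) Y * (DE Y * Real.exp (-(κ * cauchyCarriers.d Y))) = 0 := by
      simp [cauchyGeneration]
    rw [hKE, add_zero]
    show |cauchyGen ρ g f e (m + 1) U a - cauchyGen ρ g f' e' (m + 1) U a| ≤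
      2 / r * (D m * Real.exp (-(κ * cauchyCarriers.d m)))
    set δ : ℝ := D m * Real.exp (-(κ * cauchyCarriers.d m)) with hδ
    have hm : m ∈ (cauchyGeneration r hr).parents (m + 1) := by
      rw [cauchy_parents_succ]; exact mem_singleton_self m
    have hδ0 : 0 ≤ δ := mul_nonneg (hD m hm) (Real.exp_pos _).le
    obtain ⟨z, i⟩ := U
    by_cases hz : ‖z‖ < ρ
    · simp only [cauchyGen, hz, if_true]
      have hzball : z ∈ ball (0 : ℂ) (ρ + r) := by
        rw [mem_ball, dist_zero_right]; linarith
      have hFd : DifferentiableAt ℂ (cplx f m a) z := (hf m a).differentiableAt (isOpen_ball.mem_nhds hzball)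
      have hF'd : DifferentiableAt ℂ (cplx f' m a) z := (hf' m a).differentiableAt (isOpen_ball.mem_nhds hzball)
      rw [cpart_sub, ← deriv_sub hFd hF'd]
      have hsub : closedBall z r ⊆ ball (0 : ℂ) (ρ + r) := by
        intro w hw
        rw [mem_closedBall, dist_eq_norm] at hw
        rw [mem_ball, dist_zero_right]
        calc ‖w‖ = ‖(w - z) + z‖ := by ring_nf
          _ ≤ ‖w - z‖ + ‖z‖ := norm_add_le _ _
          _ < ρ + r := by linarith
      have hdc : DiffContOnCl ℂ (fun w => cplx f m a w - cplx f' m a w) (ball z r) :=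
        ((hf m a).sub (hf' m a)).diffContOnCl_ball hsub
      have hC : ∀ w ∈ sphere z r, ‖cplx f m a w - cplx f' m a w‖ ≤ 2 * δ := by
        intro w _
        have h0 : |(cplx f m a w - cplx f' m a w).re| ≤ δ := by
          have := hdisc m hm (w, 0) a ha
          simpa only [cplx, Complex.sub_re] using this
        have h1 : |(cplx f m a w - cplx f' m a w).im| ≤ δ := by
          have := hdisc m hm (w, 1) a ha
          simpa only [cplx, Complex.sub_im] using this
        calc ‖cplx f m a w - cplx f' m a w‖
            ≤ |(cplx f m a w - cplx f' m a w).re| + |(cplx f m a w - cplx f' m a w).im| :=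
              Complex.norm_le_abs_re_add_abs_im _
          _ ≤ δ + δ := add_le_add h0 h1
          _ = 2 * δ := by ring
      have hcauchy := Complex.norm_deriv_le_of_forall_mem_sphere_norm_le hr hdc hC
      calc |cpart i (deriv (fun w => cplx f m a w - cplx f' m a w) z)|
          ≤ ‖deriv (fun w => cplx f m a w - cplx f' m a w) z‖ := abs_cpart_le _ _
        _ ≤ 2 * δ / r := hcauchy
        _ = 2 / r * δ := by ring
    · simp only [cauchyGen, hz, if_false, sub_self, abs_zero]
      positivity

/-- The zero tables. [folklore] -/
def zeroTab : BTable cauchyCarriers (ℂ × Fin 2) := fun _ _ _ => 0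

/-- The sine tables of frequency `N`: the components of `z ↦ sin (N z)`. [folklore] -/
noncomputable def sinTab (N : ℕ) : BTable cauchyCarriers (ℂ × Fin 2) :=
  fun _ U _ => cpart U.2 (Complex.sin ((N : ℂ) * U.1))

/-- The rebuilt zero table is the zero function. [folklore] -/
theorem cplx_zeroTab (m : ℕ) (a : Unit) : cplx zeroTab m a = fun _ => 0 := by
  funext z
  apply Complex.ext <;> simp [cplx, zeroTab]

/-- The rebuilt sine table is `z ↦ sin (N z)`. [folklore] -/
theorem cplx_sinTab (N m : ℕ) (a : Unit) : cplx (sinTab N) m a = fun z => Complex.sin ((N : ℂ) * z) := by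
  funext z
  apply Complex.ext <;> simp [cplx, sinTab, cpart]

/-- `(d/dz) sin (N z)` at `z = 0` is `N`. [folklore] -/
theorem deriv_sin_mul_zero (N : ℕ) : deriv (fun z : ℂ => Complex.sin ((N : ℂ) * z)) 0 = N := by
  have h1 : HasDerivAt (fun z : ℂ => (N : ℂ) * z) ((N : ℂ) * 1) 0 := (hasDerivAt_id (0 : ℂ)).const_mul (N : ℂ)
  have h2 : HasDerivAt (fun z : ℂ => Complex.sin ((N : ℂ) * z)) (Complex.cos ((N : ℂ) * 0) * ((N : ℂ) * 1)) 0 :=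
    (Complex.hasDerivAt_sin ((N : ℂ) * 0)).comp (0 : ℂ) h1
  rw [h2.deriv]
  simp

/-- **Real points are insufficient** [folklore]: for every candidate kernel value `K` there are ADMISSIBLE tables (entire in
the field) agreeing to within `1` at every REAL field, whose generated pieces differ by more than `K` at the origin — the
input modulus of a derivative-reading generation map cannot be fed by a discrepancy known on the real configurations
only (witness: `0` against the components of `sin (N·)`, `N > K`). -/
theorem real_points_insufficient (ρ r : ℝ) (hρ : 0 < ρ) (K : ℝ) :
    ∃ f f' : BTable cauchyCarriers (ℂ × Fin 2),
      (∀ g e, CauchyAdm ρ r g f e) ∧ (∀ g e, CauchyAdm ρ r g f' e) ∧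
      (∀ (m : ℕ) (x : ℝ) (i : Fin 2) (a : Unit), |f m ((x : ℂ), i) a - f' m ((x : ℂ), i) a| ≤ 1) ∧
      ∀ g e a, K < |cauchyGen ρ g f e 1 ((0 : ℂ), 0) a - cauchyGen ρ g f' e 1 ((0 : ℂ), 0) a| := by
  obtain ⟨N, hN⟩ := exists_nat_gt K
  refine ⟨zeroTab, sinTab N, ?_, ?_, ?_, ?_⟩
  · intro g e m a
    rw [cplx_zeroTab]
    exact differentiableOn_const _
  · intro g e m a
    rw [cplx_sinTab]
    exact ((Complex.differentiable_sin).comp (differentiable_id.const_mul (N : ℂ))).differentiableOn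
  · intro m x i a
    have hcast : (N : ℂ) * (x : ℂ) = ((N * x : ℝ) : ℂ) := by push_cast; ring
    fin_cases i
    · show |zeroTab m ((x : ℂ), 0) a - cpart 0 (Complex.sin ((N : ℂ) * (x : ℂ)))| ≤ 1
      rw [hcast]
      simp only [zeroTab, cpart, Complex.sin_ofReal_re, zero_sub, abs_neg]
      exact Real.abs_sin_le_one _
    · show |zeroTab m ((x : ℂ), 1) a - cpart 1 (Complex.sin ((N : ℂ) * (x : ℂ)))| ≤ 1
      rw [hcast]
      simp only [zeroTab, cpart, if_neg (show (1 : Fin 2) ≠ 0 by decide), Complex.sin_ofReal_im, sub_self, abs_zero]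
      exact zero_le_one
  · intro g e a
    have hρ' : ‖(0 : ℂ)‖ < ρ := by simpa using hρ
    have hA : cauchyGen ρ g zeroTab e 1 ((0 : ℂ), 0) a = 0 := by
      show (if ‖(0 : ℂ)‖ < ρ then cpart 0 (deriv (cplx zeroTab 0 a) 0) else 0) = 0
      rw [if_pos hρ', cplx_zeroTab]
      simp [cpart]
    have hB : cauchyGen ρ g (sinTab N) e 1 ((0 : ℂ), 0) a = N := by
      show (if ‖(0 : ℂ)‖ < ρ then cpart 0 (deriv (cplx (sinTab N) 0 a) 0) else 0) = (N : ℝ)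
      rw [if_pos hρ', cplx_sinTab, deriv_sin_mul_zero]
      simp [cpart]
    rw [hA, hB]
    simpa using hN

/-! ## §9 (v1.4, additive) The printed localization gain as a damping shape of ANY power; the tilted-average toy -/

/-- **HYPOTHESIS SHAPE `ExpDamped`** (NOT PRINTED for the two-run discrepancy kernel; the printed ONE-RUN template typed
literally): the influence of the older piece localized in `Y` on the piece at `X` is damped SUPER-EXPONENTIALLY in the scale
separation, `K X Y ≤ k₀ · exp (−c · L^{scale X − scale Y}) · w X Y`.  One-run template, for SIZES: an old scale-j term feels the
step-k fluctuation field through (3.6)–(3.8) [I] with *"|δ𝐇_j| ≤ B₃ exp(−½δ₀ dist^{(ξ)}(X, □) − ½δ₀M(L^jη)^{−1}) × 2L^jη|ζ_□𝐇_k(B′)| on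
X"* (3.9), resp. *"the exponential factor exp(−δκ(L^jη)^{−1}) directly from the bound (1.18)"* (p. 272), and `(L^jη)^{−1} =
L^{k−j}` is `L^{scale separation}`: *"a small factor O((L^jη)^N) with an arbitrary power N, enough to control the sums"* (p. 271);
applied to the boundary terms by [III] p. 276.  Here `c` stands for ½δ₀M resp. δκ. [cite: Balaban1987RG1, (3.9) p.271] -/
def ExpDamped (G : Generation C) (L c k₀ : ℝ) (w : C.Dom → C.Dom → ℝ) : Prop :=
  ∀ X : C.Dom, ∀ Y ∈ G.parents X, G.K X Y ≤ k₀ * Real.exp (-(c * L ^ (C.scale X - C.scale Y))) * w X Y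

/-- ARBITRARY POWER [folklore]: `e^{−cx}·x^N ≤ (N/(ce))^N` for `x > 0`, `c > 0` (the maximum of `x^N e^{−cx}` is at `x = N/c`). -/
theorem exp_neg_mul_mul_pow_le {c x : ℝ} (hc : 0 < c) (hx : 0 < x) (N : ℕ) :
    Real.exp (-(c * x)) * x ^ N ≤ ((N : ℝ) / (c * Real.exp 1)) ^ N := by
  rcases Nat.eq_zero_or_pos N with rfl | hN
  · have h : Real.exp (-(c * x)) ≤ 1 := Real.exp_le_one_iff.mpr (by nlinarith)
    simpa using h
  · have hNr : (0 : ℝ) < N := by exact_mod_cast hN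
    have hy0 : 0 ≤ c * x / N := by positivity
    have hy : c * x / N ≤ Real.exp (c * x / N - 1) := by linarith [Real.add_one_le_exp (c * x / N - 1)]
    have hyN : (c * x / N) ^ N ≤ Real.exp (c * x / N - 1) ^ N := pow_le_pow_left₀ hy0 hy N
    have hexp : Real.exp (c * x / N - 1) ^ N = Real.exp (c * x) * Real.exp (-1) ^ N := by
      rw [← Real.exp_nat_mul, ← Real.exp_nat_mul, ← Real.exp_add]
      congr 1
      field_simp
      ring
    have hxN : x ^ N = (c * x / N) ^ N * ((N : ℝ) / c) ^ N := by
      rw [← mul_pow]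
      congr 1
      field_simp
    have htarget : ((N : ℝ) / (c * Real.exp 1)) ^ N = ((N : ℝ) / c) ^ N * Real.exp (-1) ^ N := by
      rw [← mul_pow, Real.exp_neg]
      congr 1
      field_simp
    have hNc : 0 ≤ ((N : ℝ) / c) ^ N := by positivity
    calc Real.exp (-(c * x)) * x ^ N
        = Real.exp (-(c * x)) * ((c * x / N) ^ N * ((N : ℝ) / c) ^ N) := by rw [hxN]
      _ ≤ Real.exp (-(c * x)) * (Real.exp (c * x / N - 1) ^ N * ((N : ℝ) / c) ^ N) :=
          mul_le_mul_of_nonneg_left (mul_le_mul_of_nonneg_right hyN hNc) (Real.exp_pos _).le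
      _ = (Real.exp (-(c * x)) * Real.exp (c * x)) * (((N : ℝ) / c) ^ N * Real.exp (-1) ^ N) := by rw [hexp]; ring
      _ = ((N : ℝ) / c) ^ N * Real.exp (-1) ^ N := by rw [← Real.exp_add, neg_add_cancel, Real.exp_zero, one_mul]
      _ = ((N : ℝ) / (c * Real.exp 1)) ^ N := htarget.symm

/-- THE PRINTED GAIN BEATS ANY GEOMETRIC RATE [folklore]: `ExpDamped` with nonnegative weights implies §6's `PerParentDamped` with
the damping `ω = (L^N)⁻¹` for EVERY `N : ℕ`, with the `L`-INDEPENDENT constant `k₀·(N/(ce))^N` — the typed form of *"with an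
arbitrary power N"*. -/
theorem perParentDamped_of_expDamped {G : Generation C} {L c k₀ : ℝ} {w : C.Dom → C.Dom → ℝ}
    (hL : 0 < L) (hc : 0 < c) (hk₀ : 0 ≤ k₀) (hw : ∀ X : C.Dom, ∀ Y ∈ G.parents X, 0 ≤ w X Y)
    (h : ExpDamped G L c k₀ w) (N : ℕ) :
    PerParentDamped G ((L ^ N)⁻¹) (k₀ * ((N : ℝ) / (c * Real.exp 1)) ^ N) w := by
  intro X Y hY
  have hn := h X Y hY
  have hx : 0 < L ^ (C.scale X - C.scale Y) := pow_pos hL _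
  have key : Real.exp (-(c * L ^ (C.scale X - C.scale Y))) ≤
      ((N : ℝ) / (c * Real.exp 1)) ^ N * ((L ^ N)⁻¹) ^ (C.scale X - C.scale Y) := by
    have h1 := exp_neg_mul_mul_pow_le hc hx N
    have h2 : ((L ^ N)⁻¹) ^ (C.scale X - C.scale Y) = ((L ^ (C.scale X - C.scale Y)) ^ N)⁻¹ := by
      rw [inv_pow, ← pow_mul, ← pow_mul, mul_comm]
    rw [h2, ← div_eq_mul_inv, le_div_iff₀ (pow_pos hx N)]
    exact h1
  calc G.K X Y ≤ k₀ * Real.exp (-(c * L ^ (C.scale X - C.scale Y))) * w X Y := hn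
    _ ≤ k₀ * (((N : ℝ) / (c * Real.exp 1)) ^ N * ((L ^ N)⁻¹) ^ (C.scale X - C.scale Y)) * w X Y :=
        mul_le_mul_of_nonneg_right (mul_le_mul_of_nonneg_left key hk₀) (hw X Y hY)
    _ = k₀ * ((N : ℝ) / (c * Real.exp 1)) ^ N * ((L ^ N)⁻¹) ^ (C.scale X - C.scale Y) * w X Y := by ring

/-- END-TO-END FROM THE PRINTED-SHAPE GAIN [folklore]: `GenLip` + `ExpDamped` (weights ≥ 0) + `SliceCountGrowing w Mc V` +
`EKernelContracts` + the regular inputs' rate give `NE5B` through `ne5B_of_perParent_growing` with `ω = (L^N)⁻¹` for any chosen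
power `N` — the effective-damping condition `(L^N)⁻¹·V < θ` is met by taking `N` above the volume-entropy and rate exponents
(`inv_pow_mul_pow_lt`), and the smallness by `L` large (`smallness_of_large`).  So at the level of SHAPES the located
volume-entropy growth `V^{scale X − j}` of `SliceCountGrowing` is neutralised by the printed arbitrary-power gain — CONDITIONAL on the
two-run discrepancy kernel inheriting the one-run damping, which is NOT PRINTED. -/
theorem ne5B_of_expDamped {G : Generation C} {BA : BFunctional C C.BgA} {BB : BFunctional C C.BgB}
    {EA : Functional C.toCarriers C.BgA} {EB : Functional C.toCarriers C.BgB} {W : Set (ℕ → ℝ)}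
    {κ θ L c k₀ Mc V Cop CE lamE : ℝ} {w : C.Dom → C.Dom → ℝ} (N : ℕ)
    (hGen : GenLip G BA BB EA EB W κ θ Cop) (hX : ExpDamped G L c k₀ w)
    (hw : ∀ X : C.Dom, ∀ Y ∈ G.parents X, 0 ≤ w X Y) (hS : SliceCountGrowing G κ w Mc V)
    (hKE : EKernelContracts G κ θ lamE) (hE : NE5 EA EB W κ θ CE)
    (hθ : 0 < θ) (hL : 0 < L) (hc : 0 < c) (hV : 0 ≤ V) (hωθ : (L ^ N)⁻¹ * V < θ) (hk₀ : 0 ≤ k₀) (hMc : 0 ≤ Mc)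
    (hsmall : k₀ * ((N : ℝ) / (c * Real.exp 1)) ^ N * Mc * ((L ^ N)⁻¹ * V / θ) / (1 - (L ^ N)⁻¹ * V / θ) < 1)
    (hCop : 0 ≤ Cop) (hCE : 0 ≤ CE) (hlamE : 0 ≤ lamE) :
    NE5B BA BB W κ θ
      ((Cop + lamE * CE) / (1 - k₀ * ((N : ℝ) / (c * Real.exp 1)) ^ N * Mc * ((L ^ N)⁻¹ * V / θ) / (1 - (L ^ N)⁻¹ * V / θ))) :=
  ne5B_of_perParent_growing hGen (perParentDamped_of_expDamped hL hc hk₀ hw hX N) hS hKE hE hθ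
    (inv_nonneg.mpr (pow_nonneg hL.le N)) hV hωθ (mul_nonneg hk₀ (by positivity)) hMc hsmall hCop hCE hlamE

/-- NUMBERS, I [folklore]: with the rate `θ = (L^a)⁻¹` and the volume entropy `V = L^b` per step, the effective damping beats the
rate, `(L^N)⁻¹·L^b < (L^a)⁻¹`, as soon as the power exceeds the sum of the exponents, `a + b < N` (L > 1). -/
theorem inv_pow_mul_pow_lt {L : ℝ} (hL : 1 < L) {a b N : ℕ} (h : a + b < N) :
    (L ^ N)⁻¹ * L ^ b < (L ^ a)⁻¹ := by
  have hL0 : 0 < L := lt_trans zero_lt_one hL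
  have hN : 0 < L ^ N := pow_pos hL0 N
  have ha : 0 < L ^ a := pow_pos hL0 a
  rw [inv_mul_eq_div, div_lt_iff₀ hN, ← div_eq_inv_mul, lt_div_iff₀ ha, ← pow_add, add_comm]
  exact pow_lt_pow_right₀ hL h

/-- NUMBERS, II [folklore]: the smallness of the end-to-end theorems, `K·r/(1 − r) < 1`, holds as soon as `r ≤ 1/(2(1 + K))`. -/
theorem smallness_of_le {K r : ℝ} (hK : 0 ≤ K) (hr : r ≤ 1 / (2 * (1 + K))) : K * r / (1 - r) < 1 := by
  have h1K : 0 < 1 + K := by linarith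
  have hr2 : r ≤ 1 / 2 := hr.trans (by
    rw [div_le_div_iff₀ (by positivity) (by norm_num)]
    linarith)
  have h1r : 0 < 1 - r := by linarith
  rw [div_lt_one h1r]
  have hKr : (1 + K) * r ≤ 1 / 2 := by
    calc (1 + K) * r ≤ (1 + K) * (1 / (2 * (1 + K))) := mul_le_mul_of_nonneg_left hr h1K.le
      _ = 1 / 2 := by field_simp
  linarith

/-- NUMBERS, III [folklore]: with `θ = (L^a)⁻¹`, `V = L^b`, a power `N ≥ a + b + 1` and `L ≥ 2(1 + K)` (K the product of the
constants), the ratio `r = (L^N)⁻¹·V/θ` is at most `1/L` and the smallness `K·r/(1 − r) < 1` holds: the end-to-end constant of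
`ne5B_of_expDamped` is then at most `2(Cop + lamE·CE)`. -/
theorem smallness_of_large {L K : ℝ} {a b N : ℕ} (hK : 0 ≤ K) (hN : a + b + 1 ≤ N) (hL : 2 * (1 + K) ≤ L) :
    K * ((L ^ N)⁻¹ * L ^ b / (L ^ a)⁻¹) / (1 - (L ^ N)⁻¹ * L ^ b / (L ^ a)⁻¹) < 1 := by
  have hL1 : 1 ≤ L := by linarith
  have hL0 : 0 < L := by linarith
  have hr : (L ^ N)⁻¹ * L ^ b / (L ^ a)⁻¹ = L ^ (a + b) / L ^ N := by
    rw [div_inv_eq_mul, pow_add]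
    ring
  have hrle : L ^ (a + b) / L ^ N ≤ 1 / L := by
    rw [div_le_div_iff₀ (pow_pos hL0 N) hL0, one_mul, ← pow_succ]
    exact pow_le_pow_right₀ hL1 hN
  have hLinv : 1 / L ≤ 1 / (2 * (1 + K)) := one_div_le_one_div_of_le (by positivity) hL
  rw [hr]
  exact smallness_of_le hK (hrle.trans hLinv)

/-- NON-DEGENERACY of `ExpDamped` on the chain instance of §4 (the single parent is exactly one step older): it holds with unit
weights and the constant `k₀·e^{cL}`, with EQUALITY at every parent. [folklore] -/
theorem chain_expDamped {k₀ : ℝ} (hk : 0 ≤ k₀) (L c : ℝ) :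
    ExpDamped (chainGeneration k₀ hk) L c (k₀ * Real.exp (c * L)) (fun _ _ => 1) := by
  intro n m hm
  cases n with
  | zero =>
    rw [chain_parents_zero] at hm
    simp at hm
  | succ n =>
    rw [chain_parents_succ, mem_singleton] at hm
    subst hm
    have h1 : chainCarriers.scale (m + 1) - chainCarriers.scale m = 1 := Nat.add_sub_cancel_left m 1
    rw [h1, pow_one, mul_one, mul_assoc, ← Real.exp_add, add_neg_cancel, Real.exp_zero, mul_one]
    exact le_rfl

/-! ### §9b The tilted-average toy: a measure-borne nonlinearity realises `InputLipB` but is MASS-PRESERVING -/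

/-- Elementary [folklore]: `|e^s − e^t| ≤ e^M·|s − t|` for `|s|, |t| ≤ M`. -/
theorem abs_exp_sub_exp_le_of_abs_le {s t M : ℝ} (hs : |s| ≤ M) (ht : |t| ≤ M) :
    |Real.exp s - Real.exp t| ≤ Real.exp M * |s - t| := by
  have hsM : Real.exp s ≤ Real.exp M := Real.exp_le_exp.mpr (abs_le.mp hs).2
  have htM : Real.exp t ≤ Real.exp M := Real.exp_le_exp.mpr (abs_le.mp ht).2
  -- one-sided bounds from `u + 1 ≤ e^u`
  have h1 : Real.exp s - Real.exp t ≤ Real.exp s * (s - t) := by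
    have h := Real.add_one_le_exp (t - s)
    have heq : Real.exp t = Real.exp s * Real.exp (t - s) := by rw [← Real.exp_add]; ring_nf
    rw [heq]
    nlinarith [Real.exp_pos s]
  have h2 : Real.exp t - Real.exp s ≤ Real.exp t * (t - s) := by
    have h := Real.add_one_le_exp (s - t)
    have heq : Real.exp s = Real.exp t * Real.exp (s - t) := by rw [← Real.exp_add]; ring_nf
    rw [heq]
    nlinarith [Real.exp_pos t]
  rw [abs_le]
  constructor
  · -- -(e^M |s-t|) ≤ e^s - e^t  ⟸  e^t - e^s ≤ e^t (t - s) ≤ e^M |s - t|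
    have : Real.exp t * (t - s) ≤ Real.exp M * |s - t| := by
      calc Real.exp t * (t - s) ≤ Real.exp t * |s - t| := by
            apply mul_le_mul_of_nonneg_left _ (Real.exp_pos t).le
            rw [abs_sub_comm]; exact le_abs_self _
        _ ≤ Real.exp M * |s - t| := mul_le_mul_of_nonneg_right htM (abs_nonneg _)
    linarith
  · have : Real.exp s * (s - t) ≤ Real.exp M * |s - t| := by
      calc Real.exp s * (s - t) ≤ Real.exp s * |s - t| :=
            mul_le_mul_of_nonneg_left (le_abs_self _) (Real.exp_pos s).le
        _ ≤ Real.exp M * |s - t| := mul_le_mul_of_nonneg_right hsM (abs_nonneg _)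
    linarith

/-- Elementary [folklore]: `log A − log B ≤ (A − B)/B` for `A, B > 0`. -/
theorem log_sub_log_le_div {A B : ℝ} (hA : 0 < A) (hB : 0 < B) : Real.log A - Real.log B ≤ (A - B) / B := by
  have h := Real.log_le_sub_one_of_pos (div_pos hA hB)
  rw [Real.log_div hA.ne' hB.ne'] at h
  have heq : A / B - 1 = (A - B) / B := by field_simp
  linarith [heq]

/-- THE TILTED-AVERAGE MODULUS [folklore]: for two families `x, y` of `P ≥ 1` reals bounded by `M` in absolute value,
`|log Σ_{i<P} e^{x_i} − log Σ_{i<P} e^{y_i}| ≤ (e^{2M}/P)·Σ_{i<P} δ_i` whenever `|x_i − y_i| ≤ δ_i` — the logarithm of an exponential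
average is Lipschitz in its arguments with the kernel `e^{2M}/P` per argument (mean value through the tilted weights, here
by `log u ≤ u − 1` and `|e^s − e^t| ≤ e^M|s − t|`). -/
theorem abs_log_sum_exp_sub_le {P : ℕ} (hP : 0 < P) {x y δ : ℕ → ℝ} {M : ℝ}
    (hx : ∀ i ∈ range P, |x i| ≤ M) (hy : ∀ i ∈ range P, |y i| ≤ M) (hδ : ∀ i ∈ range P, |x i - y i| ≤ δ i) :
    |Real.log (∑ i ∈ range P, Real.exp (x i)) - Real.log (∑ i ∈ range P, Real.exp (y i))| ≤
      Real.exp (2 * M) / P * ∑ i ∈ range P, δ i := by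
  set A := ∑ i ∈ range P, Real.exp (x i) with hAdef
  set B := ∑ i ∈ range P, Real.exp (y i) with hBdef
  set S := ∑ i ∈ range P, δ i with hSdef
  have hPr : (0 : ℝ) < P := by exact_mod_cast hP
  have hlow : ∀ {z : ℕ → ℝ}, (∀ i ∈ range P, |z i| ≤ M) → (P : ℝ) * Real.exp (-M) ≤ ∑ i ∈ range P, Real.exp (z i) := by
    intro z hz
    have h : ∑ i ∈ range P, Real.exp (-M) ≤ ∑ i ∈ range P, Real.exp (z i) :=
      sum_le_sum fun i hi => Real.exp_le_exp.mpr (abs_le.mp (hz i hi)).1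
    rwa [sum_const, card_range, nsmul_eq_mul] at h
  have hPM : 0 < (P : ℝ) * Real.exp (-M) := mul_pos hPr (Real.exp_pos _)
  have hAlow : (P : ℝ) * Real.exp (-M) ≤ A := hlow hx
  have hBlow : (P : ℝ) * Real.exp (-M) ≤ B := hlow hy
  have hApos : 0 < A := lt_of_lt_of_le hPM hAlow
  have hBpos : 0 < B := lt_of_lt_of_le hPM hBlow
  have hAB : |A - B| ≤ Real.exp M * S := by
    rw [hAdef, hBdef, ← sum_sub_distrib]
    refine (abs_sum_le_sum_abs _ _).trans ?_
    rw [hSdef, mul_sum]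
    refine sum_le_sum fun i hi => ?_
    exact (abs_exp_sub_exp_le_of_abs_le (hx i hi) (hy i hi)).trans
      (mul_le_mul_of_nonneg_left (hδ i hi) (Real.exp_pos M).le)
  have hS0 : 0 ≤ Real.exp M * S := (abs_nonneg _).trans hAB
  have hquot : Real.exp M * S / ((P : ℝ) * Real.exp (-M)) = Real.exp (2 * M) / P * S := by
    rw [two_mul, Real.exp_add, Real.exp_neg]
    field_simp
  -- one side
  have hside : ∀ {A' B' : ℝ}, 0 < A' → (P : ℝ) * Real.exp (-M) ≤ B' → |A' - B'| ≤ Real.exp M * S →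
      Real.log A' - Real.log B' ≤ Real.exp (2 * M) / P * S := by
    intro A' B' hA' hB' hAB'
    have hB'pos : 0 < B' := lt_of_lt_of_le hPM hB'
    calc Real.log A' - Real.log B' ≤ (A' - B') / B' := log_sub_log_le_div hA' hB'pos
      _ ≤ (Real.exp M * S) / B' := div_le_div_of_nonneg_right ((le_abs_self _).trans hAB') hB'pos.le
      _ ≤ (Real.exp M * S) / ((P : ℝ) * Real.exp (-M)) := div_le_div_of_nonneg_left hS0 hPM hB'
      _ = Real.exp (2 * M) / P * S := hquot
  rw [abs_le]
  constructor
  · have h := hside hBpos hAlow (by rw [abs_sub_comm]; exact hAB)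
    linarith
  · exact hside hApos hBlow hAB

/-- The tilted-average generation datum on the chain carriers of §4 with table bound `M`: the piece `n` has ALL older pieces
`0, …, n − 1` as parents, with the uniform kernel `e^{2M}/n`; no regular inputs. [folklore] -/
noncomputable def lseGeneration (M : ℝ) : Generation chainCarriers where
  parents := fun n : ℕ => range n
  parents_lt := fun n m hm => by simpa using hm
  eparents := fun _ => ∅
  eparents_lt := fun _ _ h => by simp at h
  K := fun (n : ℕ) _ => Real.exp (2 * M) / n
  K_nonneg := fun n _ => div_nonneg (Real.exp_pos _).le (Nat.cast_nonneg n)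
  KE := fun _ _ => 0
  KE_nonneg := fun _ _ => le_rfl

/-- The TILTED-AVERAGE generation map (the shape of the t-expectation of (3.27), whose measure carries the older tables): the
piece `m + 1` is the logarithm of the uniform exponential average of the tables of ALL its parents `0, …, m` read at the same
arguments; the piece `0` is generated from nothing. [folklore] -/
noncomputable def lseGen : GenMap chainCarriers chainCarriers.BgB := fun _ f _ (n : ℕ) U a =>
  match n with
  | 0 => 0
  | m + 1 => Real.log ((∑ i ∈ range (m + 1), Real.exp (f i U a)) / (m + 1))

/-- The admissible class of the tilted-average toy: tables bounded by `M` in absolute value. [folklore] -/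
def LseAdm (M : ℝ) : (ℕ → ℝ) → BTable chainCarriers chainCarriers.BgB → ETable chainCarriers chainCarriers.BgB → Prop :=
  fun _ f _ => ∀ (m : ℕ) (U a : Unit), |f m U a| ≤ M

/-- On `m + 1` the tilted-average map is the log of the sum minus `log (m + 1)`. [folklore] -/
theorem lseGen_succ (g : ℕ → ℝ) (f : BTable chainCarriers chainCarriers.BgB) (e : ETable chainCarriers chainCarriers.BgB)
    (m : ℕ) (U a : Unit) :
    lseGen g f e (m + 1) U a = Real.log (∑ i ∈ range (m + 1), Real.exp (f i U a)) - Real.log ((m : ℝ) + 1) := by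
  have hpos : 0 < ∑ i ∈ range (m + 1), Real.exp (f i U a) :=
    sum_pos (fun i _ => Real.exp_pos _) ⟨0, by simp⟩
  have hm : (0 : ℝ) < (m : ℝ) + 1 := by positivity
  show Real.log ((∑ i ∈ range (m + 1), Real.exp (f i U a)) / (m + 1)) = _
  rw [Real.log_div hpos.ne' hm.ne']

/-- **The tilted average realises `InputLipB`** with the kernel `e^{2M}/#parents` on the class of tables bounded by `M`.
[folklore] -/
theorem lse_inputLipB (M : ℝ) (W : Set (ℕ → ℝ)) (κ : ℝ) :
    InputLipB (lseGeneration M) lseGen W κ (LseAdm M) := by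
  intro g _ f f' e e' hf hf' X D DE hD _ hdisc _ U a _
  cases X with
  | zero =>
    simp [lseGen, lseGeneration]
  | succ m =>
    simp only [Nat.succ_eq_add_one] at *
    have hKE : ∑ Y ∈ (lseGeneration M).eparents (m + 1),
        (lseGeneration M).KE (m + 1) Y * (DE Y * Real.exp (-(κ * chainCarriers.d Y))) = 0 := by
      simp [lseGeneration]
    rw [hKE, add_zero, lseGen_succ, lseGen_succ]
    simp only [lseGeneration, chainCarriers, mul_zero, neg_zero, Real.exp_zero, mul_one] at hdisc ⊢
    push_cast
    rw [← mul_sum]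
    have h := abs_log_sum_exp_sub_le (Nat.succ_pos m) (x := fun i => f i U a) (y := fun i => f' i U a) (δ := D)
      (M := M) (fun i _ => hf i U a) (fun i _ => hf' i U a) (fun i hi => hdisc i hi U a trivial)
    push_cast at h
    calc |Real.log (∑ i ∈ range (m + 1), Real.exp (f i U a)) - Real.log ((m : ℝ) + 1) -
          (Real.log (∑ i ∈ range (m + 1), Real.exp (f' i U a)) - Real.log ((m : ℝ) + 1))|
        = |Real.log (∑ i ∈ range (m + 1), Real.exp (f i U a)) -
            Real.log (∑ i ∈ range (m + 1), Real.exp (f' i U a))| := by congr 1; ring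
      _ ≤ Real.exp (2 * M) / ((m : ℝ) + 1) * ∑ i ∈ range (m + 1), D i := h

/-- A COMMON SHIFT OF ALL INPUTS PASSES THROUGH EXACTLY [folklore]: the tilted average of tables shifted by `δ` is the tilted
average shifted by `δ` — a discrepancy shared by all parents is transported with the factor 1, undamped. -/
theorem lse_shift (g : ℕ → ℝ) (f : BTable chainCarriers chainCarriers.BgB) (e : ETable chainCarriers chainCarriers.BgB)
    (δ : ℝ) (m : ℕ) (U a : Unit) :
    lseGen g (fun Y V b => f Y V b + δ) e (m + 1) U a = lseGen g f e (m + 1) U a + δ := by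
  rw [lseGen_succ, lseGen_succ]
  have hpos : 0 < ∑ i ∈ range (m + 1), Real.exp (f i U a) :=
    sum_pos (fun i _ => Real.exp_pos _) ⟨0, by simp⟩
  have hsum : ∑ i ∈ range (m + 1), Real.exp (f i U a + δ) = Real.exp δ * ∑ i ∈ range (m + 1), Real.exp (f i U a) := by
    rw [mul_sum]
    refine sum_congr rfl fun i _ => ?_
    rw [Real.exp_add, mul_comm]
  rw [hsum, Real.log_mul (Real.exp_pos δ).ne' hpos.ne', Real.log_exp]
  ring

/-- **LOCATED: the measure-borne nonlinearity admits NO contracting input kernel** [folklore]: whatever generation datum `G` on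
the chain carriers validates `InputLipB` for the tilted-average map on the class of tables bounded by `M > 0` (window
nonempty), the kernel row of every generated piece has mass at least 1, `1 ≤ Σ_{Y ∈ parents (m+1)} K (m+1) Y` — witness: the
zero tables against the constant tables `M`.  So the contraction that §3 needs cannot come from the expectation-type
nonlinearity of (3.27) itself; it can only come from the localization gain acting on the DIFFERENCE the t-integrand carries
(`ExpDamped`, §9a). -/
theorem lse_noContraction {G : Generation chainCarriers} {W : Set (ℕ → ℝ)} {κ M : ℝ}
    (h : InputLipB G lseGen W κ (LseAdm M)) (hW : ∃ g, g ∈ W) (hM : 0 < M) (m : ℕ) :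
    1 ≤ ∑ Y ∈ G.parents (m + 1), G.K (m + 1) Y := by
  obtain ⟨g, hg⟩ := hW
  have hadm0 : LseAdm M g (fun _ _ _ => 0) (fun _ _ => 0) := fun _ _ _ => by simpa using hM.le
  have hadmM : LseAdm M g (fun _ _ _ => M) (fun _ _ => 0) := fun _ _ _ => by rw [abs_of_pos hM]
  have key := h g hg (fun _ _ _ => 0) (fun _ _ _ => M) (fun _ _ => 0) (fun _ _ => 0) hadm0 hadmM (m + 1)
    (fun _ => M) (fun _ => 0) (fun _ _ => hM.le) (fun _ _ => le_rfl)
    (fun Y _ U a _ => by simp [abs_of_pos hM])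
    (fun Y _ U => by simp) () () (Set.mem_univ _)
  have h0 : lseGen g (fun _ _ _ => 0) (fun _ _ => 0) (m + 1) () () = 0 := by
    rw [lseGen_succ]
    simp
  have h1 : lseGen g (fun _ _ _ => M) (fun _ _ => 0) (m + 1) () () = M := by
    have := lse_shift g (fun _ _ _ => 0) (fun _ _ => 0) M m () ()
    simp only [zero_add] at this
    rw [this, h0, zero_add]
  rw [h0, h1] at key
  simp only [chainCarriers, mul_zero, neg_zero, Real.exp_zero, mul_one, zero_sub, abs_neg, abs_of_pos hM,
    sum_const_zero, add_zero] at key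
  rw [← sum_mul] at key
  nlinarith [key]

/-! ## §10 (v1.5, additive) `InputLipB` one level down: the fluctuation-difference factorisation; the displacement toy -/

/-- THE FLUCTUATION-CHART DATUM over run B's background carrier, with fluctuation configurations of type `A` (printed, ONE
run, as structure: by (3.15) p. 268 and (3.27) p. 271 the older pieces enter the last fluctuation-field integral ONLY through
the difference of their values at the displaced background `U_k(exp i[g_kC𝐀_k − hD̃(g_kC𝐀_k)]V^{(k)})` and at `U_{k+1}` — in the
t-integrand *"{𝐁_k(U_k(....)) − 𝐁_k(U_{k+1}) + …}"* AND in the measure's *"{....}_{s,t}"*; the admissible fluctuation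
configurations are the second factor of the printed space (3.43) p. 276, *"{A : supp A ⊂ Y∩Λ^{(k)*}_{k+1}, |A| < C₁p₁(g_k)}"*).
Abstractly, per output domain `X`: the admissible set `supp X`, the CORE `core X` of run-B backgrounds at which the output is
read (the output's own, smaller space: p. 277 *"The analyticity domains become smaller after each step"*), and the chart
`U ↦ chart X U 𝒜` = the displaced background, `zero` = no displacement.  Nothing of the minimizers, of 𝐇_k or of (3.43) is
modelled. [cite: Balaban1988Convergent, (3.27) p.271] -/
structure FluctChart (C : T4BoundaryCarrier.Carriers) (A : Type) where
  /-- admissible fluctuation configurations for the generation of the piece `X` -/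
  supp : C.Dom → Set A
  /-- the backgrounds at which the piece `X` is read (its own space) -/
  core : C.Dom → Set C.BgB
  /-- the displaced background -/
  chart : C.Dom → C.BgB → A → C.BgB
  /-- no displacement -/
  zero : A
  /-- the chart at no displacement is the identity -/
  chart_zero : ∀ X U, chart X U zero = U

/-- THE INSERTED FLUCTUATION DIFFERENCE of the older table `f` at the parent `Y`, for the generation of `X`, at the background
`U`, the fluctuation configuration `𝒜` and the pending field `a`: `f Y (chart X U 𝒜) a − f Y U a` — the typed form of
*"𝐁_k(U_k(....)) − 𝐁_k(U_{k+1})"* of (3.27), term by term. [cite: Balaban1988Convergent, (3.27) p.271] -/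
def fluct {A : Type} (ch : FluctChart C A) (f : BTable C C.BgB) (X Y : C.Dom) (U : C.BgB) (𝒜 : A) (a : C.Fl) : ℝ :=
  f Y (ch.chart X U 𝒜) a - f Y U a

/-- No displacement, no difference. [folklore] -/
theorem fluct_zero {A : Type} (ch : FluctChart C A) (f : BTable C C.BgB) (X Y : C.Dom) (U : C.BgB) (a : C.Fl) :
    fluct ch f X Y U ch.zero a = 0 := by
  simp [fluct, ch.chart_zero]

/-- The inserted difference is LINEAR in the table: the difference of two tables' inserted differences is the inserted
difference of the discrepancy table. [folklore] -/
theorem fluct_sub {A : Type} (ch : FluctChart C A) (f f' : BTable C C.BgB) (X Y : C.Dom) (U : C.BgB) (𝒜 : A)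
    (a : C.Fl) : fluct ch (f - f') X Y U 𝒜 a = fluct ch f X Y U 𝒜 a - fluct ch f' X Y U 𝒜 a := by
  simp only [fluct, Pi.sub_apply]
  ring

/-- **HYPOTHESIS SHAPE `TiltLip`** (NOT PRINTED as a modulus; ONE run): run B's generation map depends on its older BOUNDARY
tables ONLY THROUGH THEIR INSERTED FLUCTUATION DIFFERENCES at the backgrounds of the output's core and the admissible
fluctuation configurations, and is LIPSCHITZ in them with kernel `KT` (plus the regular inputs' channel of §7, unchanged):
whatever nonnegative `Δ Y` bounds the discrepancy of the inserted differences of two admissible families on `parents X`, the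
outputs differ by at most `Σ KT X Y·Δ Y + Σ KE·(regular bounds)`.  Printed one-run structure: the t-integral of (3.27) p. 271
(the difference sits linearly in the integrand and, multiplied by t, in the exponent of the measure ⟨·⟩_{s,t}); its SIZE is
bounded through the exponentiated cluster expansion (3.44) p. 277, *"estimated as in (2.42), but with the additional factor
O(ε_k)"*; no modulus is printed.  An expectation-type dependence has such a modulus with mass ≥ 1 and no better (§9b,
`lse_noContraction`) — harmless here, since the contraction is carried by the second factor `FluctDamped`.  Whether and how
the older boundary tables enter the R-operation's new boundary terms 𝐁′^{(k)} ((1.98)–(1.101) p. 390 of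
[Balaban1989LargeFieldII]) other than through such differences is not displayed either. [cite: Balaban1988Convergent, (3.27) p.271] -/
def TiltLip {A : Type} (G : Generation C) (ch : FluctChart C A) (Φ : GenMap C C.BgB) (W : Set (ℕ → ℝ)) (κ : ℝ)
    (Adm : (ℕ → ℝ) → BTable C C.BgB → ETable C C.BgB → Prop) (KT : C.Dom → C.Dom → ℝ) : Prop :=
  ∀ g ∈ W, ∀ (f f' : BTable C C.BgB) (e e' : ETable C C.BgB), Adm g f e → Adm g f' e' →
    ∀ (X : C.Dom) (Δ DE : C.Dom → ℝ),
      (∀ Y ∈ G.parents X, 0 ≤ Δ Y) → (∀ Y ∈ G.eparents X, 0 ≤ DE Y) →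
      (∀ Y ∈ G.parents X, ∀ U ∈ ch.core X, ∀ 𝒜 ∈ ch.supp X, ∀ a ∈ C.admFl,
          |fluct ch f X Y U 𝒜 a - fluct ch f' X Y U 𝒜 a| ≤ Δ Y) →
      (∀ Y ∈ G.eparents X, ∀ (U : C.BgB), |e Y U - e' Y U| ≤ DE Y * Real.exp (-(κ * C.d Y))) →
      ∀ (U : C.BgB), ∀ a ∈ C.admFl,
        |Φ g f e X U a - Φ g f' e' X U a| ≤
          ∑ Y ∈ G.parents X, KT X Y * Δ Y + ∑ Y ∈ G.eparents X, G.KE X Y * (DE Y * Real.exp (-(κ * C.d Y)))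

/-- **PRINTED-MECHANISM SHAPE `FluctDampedOne`** (ONE run, ONE table; the statement printed for Bałaban's own terms is typed
here ABSTRACTLY, nothing of it is asserted for them): a sup bound `D·e^{−κd(Y)}` of a single admissible table `h` at ALL
backgrounds of run B's carrier (the complex printed space, by convention (e)) controls its inserted fluctuation differences on
the output's core by the factor `σ X Y` — DISPLACEMENT OVER MARGIN.  Printed template, [Balaban1987RG1] p. 273: the old term's
variation is *"the Cauchy integral (1/2πi)∫_{|t_□|=r} dt_□ (1/t_□²)𝐄^{(j)}(X,…,…), (3.15) with the radius r given by the
equality r max{|δ𝐇_j|_X, |P₁δ𝐇_j|_X, |∇^ξ_𝐔δ𝐇_j|_X, |Δ^ξ_𝐔δ𝐇_j|_X} = ⅓α₂"*, whence *"|(3.15)| ≤ (1/r)E₀exp(−κd_j(X)) ≤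
E₀exp(−κd_j(X))6α₂^{−1}L^jηB₀B₃ × exp(−½δ₀dist^{(ξ)}(X,□) − ½δ₀M(L^jη)^{−1})|ζ_□𝐇_k(B′)|, (3.17)"* and *"Let us stress that it
follows only from the fact that 𝐇_j(B(t)) satisfies (3.14) with 1/3α₂, and δ𝐇_j satisfies (3.9)"* — LINEAR in the term
through its one-run sup bound (1.18); applied to the boundary terms by [Balaban1988Convergent] p. 276 (*"To its terms we
apply the formulas (3.6), (3.7) [I]"*) and p. 277 (*"we have to use a part of the analyticity domains of terms in 𝐁_k for the
function 𝐇_k"*).  The PROFILE of `σ X Y` in the scale separation is a separate matter (below). [cite: Balaban1987RG1, (3.17) p.273] -/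
def FluctDampedOne {A : Type} (G : Generation C) (ch : FluctChart C A) (W : Set (ℕ → ℝ)) (κ : ℝ)
    (AdmT : (ℕ → ℝ) → BTable C C.BgB → Prop) (σ : C.Dom → C.Dom → ℝ) : Prop :=
  ∀ g ∈ W, ∀ (h : BTable C C.BgB), AdmT g h →
    ∀ (X : C.Dom), ∀ Y ∈ G.parents X, ∀ (D : ℝ), 0 ≤ D →
      (∀ (U : C.BgB), ∀ a ∈ C.admFl, |h Y U a| ≤ D * Real.exp (-(κ * C.d Y))) →
      ∀ U ∈ ch.core X, ∀ 𝒜 ∈ ch.supp X, ∀ a ∈ C.admFl,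
        |fluct ch h X Y U 𝒜 a| ≤ σ X Y * (D * Real.exp (-(κ * C.d Y)))

/-- **HYPOTHESIS SHAPE `FluctDamped`** (the two-table form used by the factorisation; NOT PRINTED as such): within the
admissible class, a discrepancy bound `D·e^{−κd(Y)}` of two older tables at ALL backgrounds controls the discrepancy of their
inserted fluctuation differences on the output's core by the factor `σ X Y`.  It FOLLOWS from the one-table printed-mechanism
shape by linearity as soon as the admissible class is closed under differences (`fluctDamped_of_one`). [cite: Balaban1987RG1, (3.17) p.273] -/
def FluctDamped {A : Type} (G : Generation C) (ch : FluctChart C A) (W : Set (ℕ → ℝ)) (κ : ℝ)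
    (Adm : (ℕ → ℝ) → BTable C C.BgB → ETable C C.BgB → Prop) (σ : C.Dom → C.Dom → ℝ) : Prop :=
  ∀ g ∈ W, ∀ (f f' : BTable C C.BgB) (e e' : ETable C C.BgB), Adm g f e → Adm g f' e' →
    ∀ (X : C.Dom), ∀ Y ∈ G.parents X, ∀ (D : ℝ), 0 ≤ D →
      (∀ (U : C.BgB), ∀ a ∈ C.admFl, |f Y U a - f' Y U a| ≤ D * Real.exp (-(κ * C.d Y))) →
      ∀ U ∈ ch.core X, ∀ 𝒜 ∈ ch.supp X, ∀ a ∈ C.admFl,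
        |fluct ch f X Y U 𝒜 a - fluct ch f' X Y U 𝒜 a| ≤ σ X Y * (D * Real.exp (-(κ * C.d Y)))

/-- **LINEARITY** [folklore]: if the admissible class of pairs (table, regular table) has its table-differences inside a
one-table class `AdmT` on which the printed-mechanism shape `FluctDampedOne` holds, then `FluctDamped` holds with the SAME
factor.  So the damping of the two-run discrepancy kernel has NO two-run content beyond MEMBERSHIP of both runs' tables in one
linear admissible class — for run A's transported tables this is hypothesis `hadmA` of `genLip_of_split` (§7), i.e. the cell's
hazard H-ne5p3g2-2 (the transport maps run B's printed space into run A's), and nothing else. -/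
theorem fluctDamped_of_one {A : Type} {G : Generation C} {ch : FluctChart C A} {W : Set (ℕ → ℝ)} {κ : ℝ}
    {Adm : (ℕ → ℝ) → BTable C C.BgB → ETable C C.BgB → Prop} {AdmT : (ℕ → ℝ) → BTable C C.BgB → Prop}
    {σ : C.Dom → C.Dom → ℝ}
    (hcl : ∀ g ∈ W, ∀ (f f' : BTable C C.BgB) (e e' : ETable C C.BgB), Adm g f e → Adm g f' e' → AdmT g (f - f'))
    (h : FluctDampedOne G ch W κ AdmT σ) : FluctDamped G ch W κ Adm σ := by
  intro g hg f f' e e' hf hf' X Y hY D hD hdisc U hU 𝒜 h𝒜 a ha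
  have key := h g hg (f - f') (hcl g hg f f' e e' hf hf') X Y hY D hD
    (fun U' a' ha' => by simpa only [Pi.sub_apply] using hdisc U' a' ha') U hU 𝒜 h𝒜 a ha
  simpa only [fluct_sub] using key

/-- The generation datum with the boundary influence kernel REPLACED (parents, regular inputs and their kernel kept). [folklore] -/
def Generation.withK (G : Generation C) (K : C.Dom → C.Dom → ℝ) (hK : ∀ X Y, 0 ≤ K X Y) : Generation C where
  parents := G.parents
  parents_lt := G.parents_lt
  eparents := G.eparents
  eparents_lt := G.eparents_lt
  K := K
  K_nonneg := hK
  KE := G.KE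
  KE_nonneg := G.KE_nonneg

/-- THE FACTORISED DATUM: boundary influence kernel `K X Y := KT X Y · σ X Y` — tilt modulus times displacement-over-margin. [folklore] -/
def fluctGeneration (G : Generation C) (KT σ : C.Dom → C.Dom → ℝ) (hKT : ∀ X Y, 0 ≤ KT X Y)
    (hσ : ∀ X Y, 0 ≤ σ X Y) : Generation C :=
  G.withK (fun X Y => KT X Y * σ X Y) (fun X Y => mul_nonneg (hKT X Y) (hσ X Y))

/-- The factorised datum has the same parents. [folklore] -/
@[simp] theorem fluctGeneration_parents (G : Generation C) (KT σ : C.Dom → C.Dom → ℝ) (hKT : ∀ X Y, 0 ≤ KT X Y)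
    (hσ : ∀ X Y, 0 ≤ σ X Y) : (fluctGeneration G KT σ hKT hσ).parents = G.parents := rfl

/-- The factorised datum has the same regular inputs. [folklore] -/
@[simp] theorem fluctGeneration_eparents (G : Generation C) (KT σ : C.Dom → C.Dom → ℝ) (hKT : ∀ X Y, 0 ≤ KT X Y)
    (hσ : ∀ X Y, 0 ≤ σ X Y) : (fluctGeneration G KT σ hKT hσ).eparents = G.eparents := rfl

/-- The factorised datum's boundary kernel. [folklore] -/
@[simp] theorem fluctGeneration_K (G : Generation C) (KT σ : C.Dom → C.Dom → ℝ) (hKT : ∀ X Y, 0 ≤ KT X Y)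
    (hσ : ∀ X Y, 0 ≤ σ X Y) (X Y : C.Dom) : (fluctGeneration G KT σ hKT hσ).K X Y = KT X Y * σ X Y := rfl

/-- The factorised datum's regular kernel is unchanged. [folklore] -/
@[simp] theorem fluctGeneration_KE (G : Generation C) (KT σ : C.Dom → C.Dom → ℝ) (hKT : ∀ X Y, 0 ≤ KT X Y)
    (hσ : ∀ X Y, 0 ≤ σ X Y) : (fluctGeneration G KT σ hKT hσ).KE = G.KE := rfl

/-- **THE FACTORISATION OF `InputLipB`** [folklore]: a tilt modulus `KT` in the inserted fluctuation differences and a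
displacement-over-margin factor `σ` for those differences give §7's `InputLipB` BY NAME for the factorised datum, kernel
`KT·σ`: feed `TiltLip` with `Δ Y := σ X Y·(D Y·e^{−κd(Y)})` supplied by `FluctDamped`.  Consequently the whole contraction that §3 needs
from the boundary influence kernel must come from `σ` (the tilt modulus being mass-type). -/
theorem inputLipB_of_fluct {A : Type} {G : Generation C} {ch : FluctChart C A} {Φ : GenMap C C.BgB} {W : Set (ℕ → ℝ)}
    {κ : ℝ} {Adm : (ℕ → ℝ) → BTable C C.BgB → ETable C C.BgB → Prop} {KT σ : C.Dom → C.Dom → ℝ}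
    (hT : TiltLip G ch Φ W κ Adm KT) (hF : FluctDamped G ch W κ Adm σ)
    (hKT : ∀ X Y, 0 ≤ KT X Y) (hσ : ∀ X Y, 0 ≤ σ X Y) :
    InputLipB (fluctGeneration G KT σ hKT hσ) Φ W κ Adm := by
  intro g hg f f' e e' hf hf' X D DE hD hDE hdisc hedisc U a ha
  have key := hT g hg f f' e e' hf hf' X (fun Y => σ X Y * (D Y * Real.exp (-(κ * C.d Y)))) DE
    (fun Y hY => mul_nonneg (hσ X Y) (mul_nonneg (hD Y hY) (Real.exp_pos _).le)) hDE
    (fun Y hY U' hU' 𝒜 h𝒜 a' ha' => hF g hg f f' e e' hf hf' X Y hY (D Y) (hD Y hY) (hdisc Y hY) U' hU' 𝒜 h𝒜 a' ha')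
    hedisc U a ha
  have hre : ∑ Y ∈ G.parents X, KT X Y * (σ X Y * (D Y * Real.exp (-(κ * C.d Y)))) =
      ∑ Y ∈ (fluctGeneration G KT σ hKT hσ).parents X,
        (fluctGeneration G KT σ hKT hσ).K X Y * (D Y * Real.exp (-(κ * C.d Y))) := by
    rw [fluctGeneration_parents]
    refine sum_congr rfl (fun Y _ => ?_)
    rw [fluctGeneration_K, mul_assoc]
  rw [hre] at key
  exact key

/-- THE GEOMETRIC PROFILE [folklore]: a bounded tilt modulus (`KT ≤ kT` on parents) and a displacement-over-margin factor damped
GEOMETRICALLY in the scale separation, `σ X Y ≤ s₀·ω^{scale X − scale Y}·w X Y`, give §6's `PerParentDamped` for the factorised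
datum with constant `kT·s₀`.  Reading [analysis, this cell — print displays no profile for boundary pieces]: p. 277's margin
shrinkage *"exponentially decreasing in the number of steps"* against the decay of 𝐇_k(B′) from Ω_{k+1} across the layers
Ω_j∖Ω_{j+1} of the multi-scale cover of p. 275 (*"the exponential decay of propagators and minimizing functions yields additional
small factors"*, p. 276) is a ratio of two geometric sequences. -/
theorem perParentDamped_of_fluct {G : Generation C} {KT σ w : C.Dom → C.Dom → ℝ} {ω kT s₀ : ℝ}
    (hKT0 : ∀ X Y, 0 ≤ KT X Y) (hσ0 : ∀ X Y, 0 ≤ σ X Y)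
    (hKT : ∀ X : C.Dom, ∀ Y ∈ G.parents X, KT X Y ≤ kT)
    (hσ : ∀ X : C.Dom, ∀ Y ∈ G.parents X, σ X Y ≤ s₀ * ω ^ (C.scale X - C.scale Y) * w X Y) :
    PerParentDamped (fluctGeneration G KT σ hKT0 hσ0) ω (kT * s₀) w := by
  intro X Y hY
  rw [fluctGeneration_parents] at hY
  rw [fluctGeneration_K]
  have hkT : 0 ≤ kT := le_trans (hKT0 X Y) (hKT X Y hY)
  calc KT X Y * σ X Y ≤ kT * (s₀ * ω ^ (C.scale X - C.scale Y) * w X Y) :=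
        mul_le_mul (hKT X Y hY) (hσ X Y hY) (hσ0 X Y) hkT
    _ = kT * s₀ * ω ^ (C.scale X - C.scale Y) * w X Y := by ring

/-- THE SUPER-EXPONENTIAL PROFILE [folklore]: `σ X Y ≤ s₀·exp(−c·L^{scale X − scale Y})·w X Y` gives §9's `ExpDamped` for the
factorised datum with constant `kT·s₀` — the FAR-SECTOR factor of the printed template (3.17), `exp(−½δ₀M(L^jη)^{−1})`, valid
*"In the case when dist^{(ξ)}(X,□) ≥ M(L^jη)^{−1}"* ((3.9) p. 271); for near old domains [I] p. 273 says *"This case includes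
all localization domains of small sizes, and with small distances to □, hence without obvious small factors. The real
renormalization problem is connected exactly with this case"*. -/
theorem expDamped_of_fluct {G : Generation C} {KT σ w : C.Dom → C.Dom → ℝ} {L c kT s₀ : ℝ}
    (hKT0 : ∀ X Y, 0 ≤ KT X Y) (hσ0 : ∀ X Y, 0 ≤ σ X Y)
    (hKT : ∀ X : C.Dom, ∀ Y ∈ G.parents X, KT X Y ≤ kT)
    (hσ : ∀ X : C.Dom, ∀ Y ∈ G.parents X, σ X Y ≤ s₀ * Real.exp (-(c * L ^ (C.scale X - C.scale Y))) * w X Y) :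
    ExpDamped (fluctGeneration G KT σ hKT0 hσ0) L c (kT * s₀) w := by
  intro X Y hY
  rw [fluctGeneration_parents] at hY
  rw [fluctGeneration_K]
  have hkT : 0 ≤ kT := le_trans (hKT0 X Y) (hKT X Y hY)
  calc KT X Y * σ X Y ≤ kT * (s₀ * Real.exp (-(c * L ^ (C.scale X - C.scale Y))) * w X Y) :=
        mul_le_mul (hKT X Y hY) (hσ X Y hY) (hσ0 X Y) hkT
    _ = kT * s₀ * Real.exp (-(c * L ^ (C.scale X - C.scale Y))) * w X Y := by ring

/-- The slice count is a statement about parents and weights only: it transfers to the factorised datum. [folklore] -/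
theorem sliceCountGrowing_fluct {G : Generation C} {KT σ w : C.Dom → C.Dom → ℝ} {hKT : ∀ X Y, 0 ≤ KT X Y}
    {hσ : ∀ X Y, 0 ≤ σ X Y} {κ Mc V : ℝ} (h : SliceCountGrowing G κ w Mc V) :
    SliceCountGrowing (fluctGeneration G KT σ hKT hσ) κ w Mc V :=
  fun X j hj => h X j hj

/-- The regular inputs' kernel contraction transfers to the factorised datum (same regular inputs, same kernel). [folklore] -/
theorem eKernelContracts_fluct {G : Generation C} {KT σ : C.Dom → C.Dom → ℝ} {hKT : ∀ X Y, 0 ≤ KT X Y}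
    {hσ : ∀ X Y, 0 ≤ σ X Y} {κ θ lamE : ℝ} (h : EKernelContracts G κ θ lamE) :
    EKernelContracts (fluctGeneration G KT σ hKT hσ) κ θ lamE :=
  fun X => h X

/-- **END-TO-END FROM THE FACTORISED LEAVES, GEOMETRIC PROFILE** [folklore]: `RepresentsA/B` + `TiltLip KT` + `FluctDamped σ` +
`OpDisc` + admissibility of both runs' tables + the geometric profile of `σ` + `SliceCountGrowing` + `EKernelContracts` + the
regular inputs' rate give `NE5B` through `ne5B_of_split` BY NAME, with the constant
`(Cop + lamE·CE)/(1 − kT·s₀·Mc·(ωV/θ)/(1 − ωV/θ))`.  The finest reduction of the module: the two-run content is `OpDisc` and the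
class membership `hadmA`; `TiltLip` (mass-type) and the profile of `σ` are ONE-RUN statements about run B's construction, the
latter's printed mechanism being (3.15)–(3.17) [I]. -/
theorem ne5B_of_fluct {A : Type} {G : Generation C} {ch : FluctChart C A} {ΦA : GenMap C C.BgA} {Φ : GenMap C C.BgB}
    {BA : BFunctional C C.BgA} {BB : BFunctional C C.BgB}
    {EA : Functional C.toCarriers C.BgA} {EB : Functional C.toCarriers C.BgB} {W : Set (ℕ → ℝ)}
    {Adm : (ℕ → ℝ) → BTable C C.BgB → ETable C C.BgB → Prop}
    {κ θ ω kT s₀ Mc V Cop CE lamE : ℝ} {KT σ w : C.Dom → C.Dom → ℝ}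
    (hRA : RepresentsA ΦA BA EA W) (hRB : RepresentsB Φ BB EB W)
    (hT : TiltLip G ch Φ W κ Adm KT) (hF : FluctDamped G ch W κ Adm σ)
    (hKT0 : ∀ X Y, 0 ≤ KT X Y) (hσ0 : ∀ X Y, 0 ≤ σ X Y)
    (hKT : ∀ X : C.Dom, ∀ Y ∈ G.parents X, KT X Y ≤ kT)
    (hσ : ∀ X : C.Dom, ∀ Y ∈ G.parents X, σ X Y ≤ s₀ * ω ^ (C.scale X - C.scale Y) * w X Y)
    (hOD : OpDisc ΦA Φ BA EA W κ θ Cop)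
    (hadmA : ∀ g ∈ W, Adm g (pullB BA g) (epullB EA g)) (hadmB : ∀ g ∈ W, Adm g (tabB BB g) (etabB EB g))
    (hS : SliceCountGrowing G κ w Mc V)
    (hKE : EKernelContracts G κ θ lamE) (hE : NE5 EA EB W κ θ CE)
    (hθ : 0 < θ) (hω : 0 ≤ ω) (hV : 0 ≤ V) (hωθ : ω * V < θ) (hkT : 0 ≤ kT) (hs₀ : 0 ≤ s₀) (hMc : 0 ≤ Mc)
    (hsmall : kT * s₀ * Mc * (ω * V / θ) / (1 - ω * V / θ) < 1) (hCop : 0 ≤ Cop) (hCE : 0 ≤ CE) (hlamE : 0 ≤ lamE) :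
    NE5B BA BB W κ θ ((Cop + lamE * CE) / (1 - kT * s₀ * Mc * (ω * V / θ) / (1 - ω * V / θ))) :=
  ne5B_of_split (G := fluctGeneration G KT σ hKT0 hσ0) hRA hRB (inputLipB_of_fluct hT hF hKT0 hσ0) hOD hadmA hadmB
    (perParentDamped_of_fluct hKT0 hσ0 hKT hσ) (sliceCountGrowing_fluct hS) (eKernelContracts_fluct hKE) hE
    hθ hω hV hωθ (mul_nonneg hkT hs₀) hMc hsmall hCop hCE hlamE


/-- **END-TO-END FROM THE FACTORISED LEAVES, SUPER-EXPONENTIAL PROFILE** [folklore]: the same with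
`σ X Y ≤ s₀·exp(−c·L^{scale X − scale Y})·w X Y` (far sector of (3.17)), through `genLip_of_split` and `ne5B_of_expDamped` BY NAME,
with §9's arbitrary-power bookkeeping (damping ratio `ω = (L^N)⁻¹`, constant `(N/(ce))^N`). -/
theorem ne5B_of_fluct_exp {A : Type} {G : Generation C} {ch : FluctChart C A} {ΦA : GenMap C C.BgA} {Φ : GenMap C C.BgB}
    {BA : BFunctional C C.BgA} {BB : BFunctional C C.BgB}
    {EA : Functional C.toCarriers C.BgA} {EB : Functional C.toCarriers C.BgB} {W : Set (ℕ → ℝ)}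
    {Adm : (ℕ → ℝ) → BTable C C.BgB → ETable C C.BgB → Prop}
    {κ θ L c kT s₀ Mc V Cop CE lamE : ℝ} {KT σ w : C.Dom → C.Dom → ℝ} (N : ℕ)
    (hRA : RepresentsA ΦA BA EA W) (hRB : RepresentsB Φ BB EB W)
    (hT : TiltLip G ch Φ W κ Adm KT) (hF : FluctDamped G ch W κ Adm σ)
    (hKT0 : ∀ X Y, 0 ≤ KT X Y) (hσ0 : ∀ X Y, 0 ≤ σ X Y)
    (hKT : ∀ X : C.Dom, ∀ Y ∈ G.parents X, KT X Y ≤ kT)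
    (hσ : ∀ X : C.Dom, ∀ Y ∈ G.parents X, σ X Y ≤ s₀ * Real.exp (-(c * L ^ (C.scale X - C.scale Y))) * w X Y)
    (hOD : OpDisc ΦA Φ BA EA W κ θ Cop)
    (hadmA : ∀ g ∈ W, Adm g (pullB BA g) (epullB EA g)) (hadmB : ∀ g ∈ W, Adm g (tabB BB g) (etabB EB g))
    (hw : ∀ X : C.Dom, ∀ Y ∈ G.parents X, 0 ≤ w X Y) (hS : SliceCountGrowing G κ w Mc V)
    (hKE : EKernelContracts G κ θ lamE) (hE : NE5 EA EB W κ θ CE)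
    (hθ : 0 < θ) (hL : 0 < L) (hc : 0 < c) (hV : 0 ≤ V) (hωθ : (L ^ N)⁻¹ * V < θ) (hkT : 0 ≤ kT) (hs₀ : 0 ≤ s₀)
    (hMc : 0 ≤ Mc)
    (hsmall : kT * s₀ * ((N : ℝ) / (c * Real.exp 1)) ^ N * Mc * ((L ^ N)⁻¹ * V / θ) / (1 - (L ^ N)⁻¹ * V / θ) < 1)
    (hCop : 0 ≤ Cop) (hCE : 0 ≤ CE) (hlamE : 0 ≤ lamE) :
    NE5B BA BB W κ θ ((Cop + lamE * CE) /
      (1 - kT * s₀ * ((N : ℝ) / (c * Real.exp 1)) ^ N * Mc * ((L ^ N)⁻¹ * V / θ) / (1 - (L ^ N)⁻¹ * V / θ))) :=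
  ne5B_of_expDamped (G := fluctGeneration G KT σ hKT0 hσ0) N
    (genLip_of_split hRA hRB (inputLipB_of_fluct hT hF hKT0 hσ0) hOD hadmA hadmB)
    (expDamped_of_fluct hKT0 hσ0 hKT hσ) hw (sliceCountGrowing_fluct hS) (eKernelContracts_fluct hKE) hE
    hθ hL hc hV hωθ (mul_nonneg hkT hs₀) hMc hsmall hCop hCE hlamE

/-! ### §10b The displacement toy on the Cauchy carriers of §8: `FluctDampedOne` with σ = displacement / margin -/

/-- The SHIFT chart on the Cauchy-toy carriers: fluctuation configurations are complex displacements `𝒜` of size `≤ s`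
(admissible set = the closed disc of radius `s`, for every output), the displaced background of `(z, i)` is `(z + 𝒜, i)`,
and the output's core is the SMALLER real-radius region `‖z‖ < ρ` (print p. 277: *"The analyticity domains become smaller
after each step"*). [folklore] -/
def shiftChart (ρ s : ℝ) : FluctChart cauchyCarriers ℂ where
  supp := fun _ => closedBall (0 : ℂ) s
  core := fun _ => {U | ‖U.1‖ < ρ}
  chart := fun _ U 𝒜 => (U.1 + 𝒜, U.2)
  zero := 0
  chart_zero := fun _ U => by simp

/-- The one-table admissible class of the displacement toy: complexification differentiable on the disc of radius `ρ + r`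
(the same printed-space convention as `CauchyAdm`, without the regular table). [folklore] -/
def CauchyAdmT (ρ r : ℝ) : (ℕ → ℝ) → BTable cauchyCarriers (ℂ × Fin 2) → Prop :=
  fun _ h => ∀ (m : ℕ) (a : Unit), DifferentiableOn ℂ (cplx h m a) (ball 0 (ρ + r))

/-- Complexification is linear. [folklore] -/
theorem cplx_sub (f f' : BTable cauchyCarriers (ℂ × Fin 2)) (m : ℕ) (a : Unit) :
    cplx (f - f') m a = cplx f m a - cplx f' m a := by
  funext z
  apply Complex.ext <;> simp [cplx]

/-- `CauchyAdm` is closed under differences into `CauchyAdmT`. [folklore] -/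
theorem cauchyAdm_sub (ρ r : ℝ) (g : ℕ → ℝ) (f f' : BTable cauchyCarriers (ℂ × Fin 2))
    (e e' : ETable cauchyCarriers (ℂ × Fin 2)) (hf : CauchyAdm ρ r g f e) (hf' : CauchyAdm ρ r g f' e') :
    CauchyAdmT ρ r g (f - f') := by
  intro m a
  rw [cplx_sub]
  exact (hf m a).sub (hf' m a)

/-- The component read-out inverts the complexification. [folklore] -/
theorem cpart_cplx (f : BTable cauchyCarriers (ℂ × Fin 2)) (m : ℕ) (a : Unit) (w : ℂ) (i : Fin 2) :
    cpart i (cplx f m a w) = f m (w, i) a := by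
  fin_cases i <;> simp [cpart, cplx]

/-- **THE DISPLACEMENT TOY: `FluctDampedOne` BY CAUCHY'S ESTIMATE AND THE MEAN VALUE INEQUALITY** [folklore] — the typed form of
the printed template (3.15)–(3.17) [I]: a table whose complexification is differentiable on the disc of radius `ρ + r` (margin
`r` beyond the core radius `ρ`) and bounded by `D·e^{−κd}` componentwise EVERYWHERE has derivative `≤ 4D·e^{−κd}/r` on the disc
of radius `ρ + r/2` (Cauchy on circles of radius `r/2`), hence its inserted fluctuation difference at a core point under a
displacement of size `≤ s ≤ r/2` is at most `(4s/r)·D·e^{−κd}`: `σ = 4s/r` = DISPLACEMENT OVER MARGIN, the typed `1/r` of (3.17)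
with print's `r` = margin/displacement. -/
theorem cauchy_fluctDampedOne (ρ r s : ℝ) (hr : 0 < r) (hsr : s ≤ r / 2) (W : Set (ℕ → ℝ)) (κ : ℝ) :
    FluctDampedOne (cauchyGeneration r hr) (shiftChart ρ s) W κ (CauchyAdmT ρ r) (fun _ _ => 4 * s / r) := by
  intro g _ h hh X Y _ D hD hsup U hU 𝒜 h𝒜 a ha
  obtain ⟨z, i⟩ := U
  have hz : ‖z‖ < ρ := hU
  have h𝒜' : ‖𝒜‖ ≤ s := by simpa [shiftChart] using h𝒜
  set δ : ℝ := D * Real.exp (-(κ * cauchyCarriers.d Y)) with hδ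
  have hδ0 : 0 ≤ δ := mul_nonneg hD (Real.exp_pos _).le
  -- the complexified table and its sup bound everywhere
  set F : ℂ → ℂ := cplx h Y a with hF
  have hFsup : ∀ w : ℂ, ‖F w‖ ≤ 2 * δ := by
    intro w
    have h0 := hsup (w, 0) a ha
    have h1 := hsup (w, 1) a ha
    have hre : |(F w).re| ≤ δ := by simpa [hF, cplx] using h0
    have him : |(F w).im| ≤ δ := by simpa [hF, cplx] using h1
    calc ‖F w‖ ≤ |(F w).re| + |(F w).im| := Complex.norm_le_abs_re_add_abs_im _
      _ ≤ δ + δ := add_le_add hre him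
      _ = 2 * δ := by ring
  -- derivative bound on the disc of radius ρ + r/2, by Cauchy on circles of radius r/2
  have hderiv : ∀ y ∈ ball (0 : ℂ) (ρ + r / 2), ‖deriv F y‖ ≤ 4 * δ / r := by
    intro y hy
    rw [mem_ball, dist_zero_right] at hy
    have hsub : closedBall y (r / 2) ⊆ ball (0 : ℂ) (ρ + r) := by
      intro u hu
      rw [mem_closedBall] at hu
      rw [mem_ball, dist_zero_right]
      calc ‖u‖ = ‖(u - y) + y‖ := by ring_nf
        _ ≤ ‖u - y‖ + ‖y‖ := norm_add_le _ _
        _ = dist u y + ‖y‖ := by rw [dist_eq_norm]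
        _ < ρ + r := by linarith
    have hdc : DiffContOnCl ℂ F (ball y (r / 2)) := (hh Y a).diffContOnCl_ball hsub
    have hc := Complex.norm_deriv_le_of_forall_mem_sphere_norm_le (by positivity : 0 < r / 2) hdc
      (fun w _ => hFsup w)
    calc ‖deriv F y‖ ≤ 2 * δ / (r / 2) := hc
      _ = 4 * δ / r := by field_simp; ring
  have hdiff : ∀ y ∈ ball (0 : ℂ) (ρ + r / 2), DifferentiableAt ℂ F y := by
    intro y hy
    rw [mem_ball, dist_zero_right] at hy
    exact (hh Y a).differentiableAt (isOpen_ball.mem_nhds (by rw [mem_ball, dist_zero_right]; linarith))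
  have hzin : z ∈ ball (0 : ℂ) (ρ + r / 2) := by
    rw [mem_ball, dist_zero_right]; linarith
  have hz𝒜in : z + 𝒜 ∈ ball (0 : ℂ) (ρ + r / 2) := by
    rw [mem_ball, dist_zero_right]
    calc ‖z + 𝒜‖ ≤ ‖z‖ + ‖𝒜‖ := norm_add_le _ _
      _ < ρ + r / 2 := by linarith
  have hmv := (convex_ball (0 : ℂ) (ρ + r / 2)).norm_image_sub_le_of_norm_deriv_le hdiff hderiv hzin hz𝒜in
  -- ‖F (z + 𝒜) − F z‖ ≤ (4δ/r)·‖𝒜‖ ≤ (4s/r)·δ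
  have hbound : ‖F (z + 𝒜) - F z‖ ≤ 4 * s / r * δ := by
    calc ‖F (z + 𝒜) - F z‖ ≤ 4 * δ / r * ‖z + 𝒜 - z‖ := hmv
      _ = 4 * δ / r * ‖𝒜‖ := by rw [add_sub_cancel_left]
      _ ≤ 4 * δ / r * s := mul_le_mul_of_nonneg_left h𝒜' (by positivity)
      _ = 4 * s / r * δ := by ring
  -- read the component
  show |h Y ((z, i).1 + 𝒜, (z, i).2) a - h Y (z, i) a| ≤ 4 * s / r * (D * Real.exp (-(κ * cauchyCarriers.d Y)))
  simp only
  rw [← hδ, ← cpart_cplx h Y a (z + 𝒜) i, ← cpart_cplx h Y a z i, cpart_sub]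
  exact le_trans (abs_cpart_le i _) hbound

/-- The two-table form for the toy, by linearity (`fluctDamped_of_one` with `cauchyAdm_sub`). [folklore] -/
theorem cauchy_fluctDamped (ρ r s : ℝ) (hr : 0 < r) (hsr : s ≤ r / 2) (W : Set (ℕ → ℝ)) (κ : ℝ) :
    FluctDamped (cauchyGeneration r hr) (shiftChart ρ s) W κ (CauchyAdm ρ r) (fun _ _ => 4 * s / r) :=
  fluctDamped_of_one (fun g _ f f' e e' hf hf' => cauchyAdm_sub ρ r g f f' e e' hf hf')
    (cauchy_fluctDampedOne ρ r s hr hsr W κ)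

/-- The FINITE-DISPLACEMENT generation map of the toy (instance of `TiltLip` with modulus 1): the piece `m + 1` at a core
background is the inserted fluctuation difference of its parent `m` under the fixed admissible displacement `𝒜₀ = s`; zero
off the core and for the piece `0`. [folklore] -/
noncomputable def fdGen (ρ s : ℝ) : GenMap cauchyCarriers (ℂ × Fin 2) := fun _ f _ (n : ℕ) U a =>
  match n with
  | 0 => 0
  | m + 1 => if ‖U.1‖ < ρ then fluct (shiftChart ρ s) f (m + 1) m U (s : ℂ) a else 0

/-- The finite-displacement map is `TiltLip` with modulus `KT = 1`. [folklore] -/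
theorem fd_tiltLip (ρ r s : ℝ) (hr : 0 < r) (hs : 0 ≤ s) (W : Set (ℕ → ℝ)) (κ : ℝ) :
    TiltLip (cauchyGeneration r hr) (shiftChart ρ s) (fdGen ρ s) W κ (CauchyAdm ρ r) (fun _ _ => 1) := by
  intro g _ f f' e e' _ _ X Δ DE hΔ _ hfl _ U a ha
  have hKE : ∀ n : ℕ, (cauchyGeneration r hr).eparents n = ∅ := fun _ => rfl
  cases X with
  | zero =>
    rw [cauchy_parents_zero, hKE, sum_empty, sum_empty, add_zero]
    simp [fdGen]
  | succ m =>
    rw [cauchy_parents_succ, hKE, sum_singleton, sum_empty, add_zero, one_mul]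
    have hm : m ∈ (cauchyGeneration r hr).parents (m + 1) := by
      rw [cauchy_parents_succ]; exact mem_singleton_self m
    by_cases hz : ‖U.1‖ < ρ
    · have hA : ((s : ℝ) : ℂ) ∈ (shiftChart ρ s).supp (m + 1) := by
        show ((s : ℝ) : ℂ) ∈ closedBall (0 : ℂ) s
        rw [mem_closedBall, dist_zero_right, Complex.norm_real, Real.norm_eq_abs, abs_of_nonneg hs]
      simpa [fdGen, hz] using hfl m hm U hz (s : ℂ) hA a ha
    · simpa [fdGen, hz] using hΔ m hm

/-- **THE FACTORISED TOY** [folklore]: the finite-displacement map satisfies §7's `InputLipB` for the factorised datum with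
kernel `1 · (4s/r)` — the FINITE DISPLACEMENT over the margin, against §8's DERIVATIVE kernel `2/r` of `cauchyGen`: the small
displacement is the small factor, exactly as in (3.17). -/
theorem fd_inputLipB (ρ r s : ℝ) (hr : 0 < r) (hs : 0 ≤ s) (hsr : s ≤ r / 2) (W : Set (ℕ → ℝ)) (κ : ℝ) :
    InputLipB (fluctGeneration (cauchyGeneration r hr) (fun _ _ => 1) (fun _ _ => 4 * s / r) (fun _ _ => zero_le_one)
      (fun _ _ => by positivity)) (fdGen ρ s) W κ (CauchyAdm ρ r) :=
  inputLipB_of_fluct (fd_tiltLip ρ r s hr hs W κ) (cauchy_fluctDamped ρ r s hr hsr W κ) _ _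

/-- The identity table of the toy (value = the read component of the background). [folklore] -/
def idTab : BTable cauchyCarriers (ℂ × Fin 2) := fun _ U _ => cpart U.2 U.1

/-- SHARPNESS OF THE ORDER [folklore]: for the identity table the inserted difference under the displacement `s` IS `s` — the
factor `σ` cannot be `o(displacement)`. -/
theorem fluct_idTab (ρ s : ℝ) (X Y : ℕ) (z : ℂ) (a : Unit) :
    fluct (shiftChart ρ s) idTab X Y (z, 0) (s : ℂ) a = s := by
  simp [fluct, shiftChart, idTab, cpart]

/-! ### §10c The constant made explicit (records reviewer advisory pv03 A1 on v1.4) -/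

/-- `NE5B` is monotone in the constant (for a nonnegative rate). [folklore] -/
theorem ne5B_mono {BA : BFunctional C C.BgA} {BB : BFunctional C C.BgB} {W : Set (ℕ → ℝ)} {κ θ C₅ C₅' : ℝ}
    (hθ : 0 ≤ θ) (hC : C₅ ≤ C₅') (h : NE5B BA BB W κ θ C₅) : NE5B BA BB W κ θ C₅' := by
  intro a ha g hg U X
  have hfac : 0 ≤ θ ^ C.scale X * Real.exp (-(κ * C.d X)) := mul_nonneg (pow_nonneg hθ _) (Real.exp_pos _).le
  have h1 := h a ha g hg U X
  have h2 : C₅ * θ ^ C.scale X * Real.exp (-(κ * C.d X)) ≤ C₅' * θ ^ C.scale X * Real.exp (-(κ * C.d X)) := by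
    rw [mul_assoc, mul_assoc]
    exact mul_le_mul_of_nonneg_right hC hfac
  exact le_trans h1 h2

/-- ARITHMETIC [folklore]: `A/(1 − λ) ≤ 2A` for `A ≥ 0`, `λ ≤ 1/2`. -/
theorem div_le_two_mul {A lam : ℝ} (hA : 0 ≤ A) (hlam : lam ≤ 1 / 2) : A / (1 - lam) ≤ 2 * A := by
  have h : 1 / 2 ≤ 1 - lam := by linarith
  calc A / (1 - lam) ≤ A / (1 / 2) := div_le_div_of_nonneg_left hA (by norm_num) h
    _ = 2 * A := by ring

/-- ARITHMETIC [folklore]: `K·r/(1 − r) ≤ 1/2` as soon as `0 ≤ r ≤ 1/(2(1 + K))`, `K ≥ 0` (the non-strict companion of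
`smallness_of_le`). -/
theorem smallness_half_of_le {K r : ℝ} (hK : 0 ≤ K) (hr0 : 0 ≤ r) (hr : r ≤ 1 / (2 * (1 + K))) :
    K * r / (1 - r) ≤ 1 / 2 := by
  have h1K : 0 < 1 + K := by linarith
  have hKr : (1 + K) * r ≤ 1 / 2 := by
    calc (1 + K) * r ≤ (1 + K) * (1 / (2 * (1 + K))) := mul_le_mul_of_nonneg_left hr h1K.le
      _ = 1 / 2 := by field_simp
  have hKr' : r + K * r ≤ 1 / 2 := by linarith [hKr, show (1 + K) * r = r + K * r by ring]
  have hKr0 : 0 ≤ K * r := mul_nonneg hK hr0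
  have h1r : 0 < 1 - r := by linarith
  rw [div_le_iff₀ h1r]
  linarith

/-- NUMBERS, III [folklore]: in the regime of `smallness_of_large` (`θ = (L^a)⁻¹`, `V = L^b`, `ω = (L^N)⁻¹`, `a + b + 1 ≤ N`,
`L ≥ 2(1 + K)`) the fixed-point constant is AT MOST TWICE the numerator: `A/(1 − K·(ωV/θ)/(1 − ωV/θ)) ≤ 2A`. -/
theorem constant_le_two_of_large {L K A : ℝ} {a b N : ℕ} (hK : 0 ≤ K) (hA : 0 ≤ A) (hN : a + b + 1 ≤ N)
    (hL : 2 * (1 + K) ≤ L) :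
    A / (1 - K * ((L ^ N)⁻¹ * L ^ b / (L ^ a)⁻¹) / (1 - (L ^ N)⁻¹ * L ^ b / (L ^ a)⁻¹)) ≤ 2 * A := by
  have hL1 : 1 < L := by linarith
  have hL0 : 0 < L := by linarith
  have hr0 : 0 ≤ (L ^ N)⁻¹ * L ^ b / (L ^ a)⁻¹ := by positivity
  have hre : (L ^ N)⁻¹ * L ^ b / (L ^ a)⁻¹ = L ^ (a + b) / L ^ N := by
    rw [div_inv_eq_mul, pow_add]; ring
  have hr1 : (L ^ N)⁻¹ * L ^ b / (L ^ a)⁻¹ ≤ 1 / (2 * (1 + K)) := by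
    rw [hre]
    have hab : L ^ (a + b) * L ≤ L ^ N := by
      calc L ^ (a + b) * L = L ^ (a + b + 1) := by rw [pow_succ]
        _ ≤ L ^ N := pow_le_pow_right₀ hL1.le hN
    have hLN : 0 < L ^ N := pow_pos hL0 N
    rw [div_le_div_iff₀ hLN (by positivity)]
    calc L ^ (a + b) * (2 * (1 + K)) ≤ L ^ (a + b) * L := mul_le_mul_of_nonneg_left hL (pow_nonneg hL0.le _)
      _ ≤ L ^ N := hab
      _ = 1 * L ^ N := by ring
  exact div_le_two_mul hA (smallness_half_of_le hK hr0 hr1)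

/-- **THE EXPLICIT CONSTANT** [folklore] (records a cross-reader's advisory on v1.4 — *"C₅ ≤ 2(Cop + lamE·CE)"*, true but then
untyped): in the regime of `ne5B_of_expDamped` with the rate `θ = (L^a)⁻¹`, the volume entropy `V = L^b`, the damping ratio
`ω = (L^N)⁻¹`, `a + b + 1 ≤ N` and the blocking factor `L ≥ 2(1 + k₀·(N/(ce))^N·Mc)`, `NE5B` holds with the constant
`2·(Cop + lamE·CE)` — twice (the operation discrepancy constant plus the regular inputs' constant weighted by their kernel). -/
theorem ne5B_of_expDamped_two {G : Generation C} {BA : BFunctional C C.BgA} {BB : BFunctional C C.BgB}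
    {EA : Functional C.toCarriers C.BgA} {EB : Functional C.toCarriers C.BgB} {W : Set (ℕ → ℝ)}
    {κ L c k₀ Mc Cop CE lamE : ℝ} {w : C.Dom → C.Dom → ℝ} (N a b : ℕ)
    (hGen : GenLip G BA BB EA EB W κ ((L ^ a)⁻¹) Cop) (hX : ExpDamped G L c k₀ w)
    (hw : ∀ X : C.Dom, ∀ Y ∈ G.parents X, 0 ≤ w X Y) (hS : SliceCountGrowing G κ w Mc (L ^ b))
    (hKE : EKernelContracts G κ ((L ^ a)⁻¹) lamE) (hE : NE5 EA EB W κ ((L ^ a)⁻¹) CE)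
    (hc : 0 < c) (hk₀ : 0 ≤ k₀) (hMc : 0 ≤ Mc) (hN : a + b + 1 ≤ N)
    (hL : 2 * (1 + k₀ * ((N : ℝ) / (c * Real.exp 1)) ^ N * Mc) ≤ L)
    (hCop : 0 ≤ Cop) (hCE : 0 ≤ CE) (hlamE : 0 ≤ lamE) :
    NE5B BA BB W κ ((L ^ a)⁻¹) (2 * (Cop + lamE * CE)) := by
  have hK : 0 ≤ k₀ * ((N : ℝ) / (c * Real.exp 1)) ^ N * Mc := by positivity
  have hL1 : 1 < L := by nlinarith
  have hL0 : 0 < L := by linarith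
  have hθ : 0 < (L ^ a)⁻¹ := inv_pos.mpr (pow_pos hL0 a)
  have hωθ : (L ^ N)⁻¹ * L ^ b < (L ^ a)⁻¹ := inv_pow_mul_pow_lt hL1 (by omega)
  have hsmall := smallness_of_large (a := a) (b := b) (N := N) hK hN hL
  have h := ne5B_of_expDamped N hGen hX hw hS hKE hE hθ hL0 hc (pow_nonneg hL0.le b) hωθ hk₀ hMc hsmall hCop hCE hlamE
  exact ne5B_mono (inv_nonneg.mpr (pow_nonneg hL0.le a))
    (constant_le_two_of_large (a := a) (b := b) (N := N) hK (by positivity) hN hL) h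

/-! ## §11 (v1.6, additive) The profile of `σ` for BOUNDARY parents: the layered form over the multi-scale cover —
decay across the collars over the k-uniform gaps of the printed spaces; geometric, not super-exponential; the regime -/

/-- **HYPOTHESIS SHAPE `LayeredDamped`** (NOT PRINTED as a display; the LOCATED READING of [Balaban1988Convergent]
pp. 261, 276–277 by this cell, typed ABSTRACTLY — nothing of it is asserted for Bałaban's terms): the
displacement-over-margin factor of the older boundary parent `Y` (creation step `scale Y = j`) for the output `X` is
bounded by a SUM OVER THE LAYERS ON WHICH THE PARENT'S PRINTED SPACE CONSTRAINS THE BACKGROUND — its own, `i = 0`, and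
the OLDER ones `n = j − i`, `i = 1, …, j` — of (displacement bound on the layer)/(gap on the layer):
`σ X Y ≤ s₀ · Σ_{i ≤ scale Y} δ^{(scale X − scale Y) + i} · ρ^i · w X Y`.  Printed loci (one run, verbatim): the spaces
(2.34)–(2.39) p. 261 are conditions *"on X∩(Ω_n∖Ω_{n+1}) for n = 1, …, j − 1, or on X∩Ω_j for n = j"* with radii
`(1 − β(1 − 2^{−(j−n)}))α_{0,n}` ((2.34)), `(1 − β(1 − 2^{−(j−n)}))α_{1,n}` ((2.39)), β = 1/4; p. 277: *"on the other hand we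
have to use a part of the analyticity domains of terms in 𝐁_k for the function 𝐇_k. This is the reason for putting the
powers of 1/2 in the conditions (2.36)–(2.39). The analyticity domains become smaller after each step, but the difference
is very small and exponentially decreasing in the number of steps. The localization of the fluctuation field, and the
exponential decay of the minimizing function 𝐇_k imply that this difference is still much greater than bounds on this
function."*; p. 276: *"In fact we have better bounds, because the fluctuation field is localized in Ω_{k+1}, and the
exponential decay of propagators and minimizing functions yields additional small factors. They contribute to the bound
(2.38), because such terms will be included into boundary terms."*, the random walk expansions *"are constructed for the
sequence {Ω_j}, so we apply Theorems 3.7–3.10 [13] in their full generality. The expansions (6.9) [I] are constructed for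
families σ₀ = {Δ} of cubes in proper scales, i.e. if Δ ⊂ Ω_j∖Ω_{j+1}, then the size of Δ is equal to ML^jη"*, and for the terms
of 𝐁_k *"The localized expansion is over domains Y₀ ∈ 𝐃_k having nonempty intersections with Λ_{k+1}"*; p. 256: the domains
Ω_j, Λ_j *"satisfy also other conditions, e.g., the distance between their boundaries is at least equal to 2MR_j"*; (2.5)
p. 255: *"R_j is the smallest number of the form L^r such, that R_j ≥ (log g_j^{−2})^r"*.  READING [analysis, this cell —
nothing of it is displayed in print for the two-run kernel]: (a) GAP — on the layer `n ≤ j` the index-(k+1) space sits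
inside the scale-j parent's space with the gap `β(2^{−(j−n)} − 2^{−(k+1−n)})α_{·,n} ≥ ½β·2^{−(j−n)}α_{·,n}`: UNIFORM IN k and
halving per OLDER layer of the parent; the printed *"exponentially decreasing"* difference `β2^{−(k+1−n)}α_{·,n}` is the
per-STEP shrink of the CURRENT space, not the parent's gap; (b) DISPLACEMENT — sourced in the fluctuation region (Ω_{k+1},
Λ_{k+1}) and reaching the parent across the collars of the scales in between, each at least `2MR` wide in its own scale and
walked by random walks over cubes of the proper scales, whence a scale-free factor per collar: the per-collar ratio `δ`
(HYPOTHESIS; print displays no per-collar constant; its sentence of p. 277 holds at every number of steps as soon as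
`δ ≤ 1/2`, `displacement_le_domainDifference`), i.e. `δ^{(scale X − scale Y) + i}` on the parent's layer `j − i` up to the
normalisation of one collar (absorbed in `s₀`); (c) `ρ ≥ 0` absorbs, per older layer, the halving of the gap and the
conversion between the units in which the layer's printed radii are stated ((2.34): `α_{0,n}ξ²(L^nξ)^{−2}`; (2.39):
`L^nξ|A′| < …α_{1,n}`) and those of the displacement — no such constant is displayed; the binder only asks `δρ < 1`
downstream; (d) parents reaching LATER layers `n > j`, nearer the fluctuation region, pay their own localization decay across
collars of width `2MR·L^{n−j}` in their scale — booked in the WEIGHT `w X Y` (and then in `SliceCountGrowing`), not in the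
profile.  NO power-of-`L` gain enters for a boundary parent on its own layer (p. 276's *"replace η = L^{−k} by L^{−n}"* gives
the factor `L^jL^{−n}`, = 1 at `n = j`; [I] p. 273 *"without obvious small factors"*): the whole damping in the scale separation is
`δ^{scale X − scale Y}` — GEOMETRIC, with the ratio of the per-collar decay.  Nearest PUBLISHED shape of (b) and of the Cauchy
step (v1.6.1; one run, scalar φ⁴₃, prior art only, quoted in the module header §11): [Dimock2013BalabanIII, §2.7] *"random walk
expansions differing only in Ω^{2♮}_{𝖭+1} which is at least [r_𝖭] layers of M-cubes away"* ⇒ displacement `e^{−r_𝖭/2}`, contour of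
radius `e^{+r_𝖭/2}`·(displacement); [Dimock2013BalabanII, §3.9] *"separated by [r_{k+1}] layers of LM cubes … extract a factor
e^{−r_{k+1}}"*.  ONE-RUN DISPLAYED TEMPLATE in the series itself (v1.6.2; the PROPAGATORS of the sequence {Ω_j}, CONTEXT only,
quoted in the module header §11): [III] p. 276's *"[13]"* = [Balaban1985BackgroundPropagators]: (3.89) *"O(M^{−1})e^{−δ₀(L^jη)^{−1}|y−y′|}"*
per step of the random walk (3.90) over the cubes of 𝒟 in their own scales, Corollary 3.8 (3.94) *"e^{−(1/2)δ₀d(ω,y,y′)}"*, p. 412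
differences of propagators defined on two domains *"multiplied by e^{−2δ₀M}"* at distance *"at least M (on L^{−j}-scale)"*; the
transfer to 𝐇_k and to the terms of 𝐁_k is by reference only, so (b)'s «no per-collar constant» means: none displayed for 𝐇_k, for
the boundary terms, or for two runs. [cite: Balaban1988Convergent, (2.34)–(2.39) p.261; Balaban1985BackgroundPropagators, (3.89)–(3.94) pp.409–410, p.412] -/
def LayeredDamped (G : Generation C) (σ : C.Dom → C.Dom → ℝ) (s₀ δ ρ : ℝ) (w : C.Dom → C.Dom → ℝ) : Prop :=
  ∀ X : C.Dom, ∀ Y ∈ G.parents X,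
    σ X Y ≤ s₀ * (∑ i ∈ range (C.scale Y + 1), δ ^ (C.scale X - C.scale Y + i) * ρ ^ i) * w X Y

/-- THE LAYER SUM IS GEOMETRIC [folklore]: `Σ_{i<n} δ^{m+i}·ρ^i ≤ δ^m/(1 − δρ)` for `δ, ρ ≥ 0`, `δρ < 1` — the older layers'
halving gaps and conversion factors are absorbed as soon as the per-collar decay beats them (`δρ < 1`). -/
theorem layerSum_le {δ ρ : ℝ} (hδ : 0 ≤ δ) (hρ : 0 ≤ ρ) (hδρ : δ * ρ < 1) (m n : ℕ) :
    ∑ i ∈ range n, δ ^ (m + i) * ρ ^ i ≤ δ ^ m / (1 - δ * ρ) := by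
  have hq0 : 0 ≤ δ * ρ := mul_nonneg hδ hρ
  have h1q : 0 < 1 - δ * ρ := by linarith
  -- the geometric sum `Σ_{i<n} q^i ≤ 1/(1 − q)`, `q = δρ ∈ [0, 1)`, by induction
  have hgeom : ∀ n : ℕ, ∑ i ∈ range n, (δ * ρ) ^ i ≤ 1 / (1 - δ * ρ) := by
    intro n
    induction n with
    | zero =>
      rw [sum_range_zero]
      exact div_nonneg zero_le_one h1q.le
    | succ n ih =>
      rw [sum_range_succ', pow_zero]
      have hre : ∑ i ∈ range n, (δ * ρ) ^ (i + 1) = (δ * ρ) * ∑ i ∈ range n, (δ * ρ) ^ i := by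
        rw [mul_sum]
        exact sum_congr rfl (fun i _ => by rw [pow_succ, mul_comm])
      rw [hre]
      have h1 : (δ * ρ) * ∑ i ∈ range n, (δ * ρ) ^ i ≤ (δ * ρ) * (1 / (1 - δ * ρ)) :=
        mul_le_mul_of_nonneg_left ih hq0
      have h2 : (δ * ρ) * (1 / (1 - δ * ρ)) + 1 = 1 / (1 - δ * ρ) := by
        field_simp
        ring
      linarith
  have hre : ∑ i ∈ range n, δ ^ (m + i) * ρ ^ i = δ ^ m * ∑ i ∈ range n, (δ * ρ) ^ i := by
    rw [mul_sum]
    refine sum_congr rfl (fun i _ => ?_)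
    rw [pow_add, mul_pow, mul_assoc]
  rw [hre, div_eq_mul_one_div]
  exact mul_le_mul_of_nonneg_left (hgeom n) (pow_nonneg hδ m)

/-- **THE LAYERED FORM GIVES THE GEOMETRIC PROFILE** [folklore]: `LayeredDamped s₀ δ ρ w` with `δρ < 1` and nonnegative weights
gives the geometric profile of §10's `perParentDamped_of_fluct` / `ne5B_of_fluct`, `σ X Y ≤ (s₀/(1 − δρ))·δ^{scale X − scale Y}·w X Y`:
the damping ratio in the scale separation IS the per-collar decay `δ`. -/
theorem profile_of_layered {G : Generation C} {σ w : C.Dom → C.Dom → ℝ} {s₀ δ ρ : ℝ}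
    (hs₀ : 0 ≤ s₀) (hδ : 0 ≤ δ) (hρ : 0 ≤ ρ) (hδρ : δ * ρ < 1)
    (hw : ∀ X : C.Dom, ∀ Y ∈ G.parents X, 0 ≤ w X Y) (h : LayeredDamped G σ s₀ δ ρ w) :
    ∀ X : C.Dom, ∀ Y ∈ G.parents X, σ X Y ≤ s₀ / (1 - δ * ρ) * δ ^ (C.scale X - C.scale Y) * w X Y := by
  intro X Y hY
  have h2 := layerSum_le hδ hρ hδρ (C.scale X - C.scale Y) (C.scale Y + 1)
  calc σ X Y ≤ s₀ * (∑ i ∈ range (C.scale Y + 1), δ ^ (C.scale X - C.scale Y + i) * ρ ^ i) * w X Y := h X Y hY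
    _ ≤ s₀ * (δ ^ (C.scale X - C.scale Y) / (1 - δ * ρ)) * w X Y :=
        mul_le_mul_of_nonneg_right (mul_le_mul_of_nonneg_left h2 hs₀) (hw X Y hY)
    _ = s₀ / (1 - δ * ρ) * δ ^ (C.scale X - C.scale Y) * w X Y := by ring

/-- Conversely the plain geometric profile is layered (the `i = 0` term), for any `ρ ≥ 0` [folklore]: the binder generalises
§10's hypothesis form. -/
theorem layeredDamped_of_profile {G : Generation C} {σ w : C.Dom → C.Dom → ℝ} {s₀ δ ρ : ℝ}
    (hs₀ : 0 ≤ s₀) (hδ : 0 ≤ δ) (hρ : 0 ≤ ρ) (hw : ∀ X : C.Dom, ∀ Y ∈ G.parents X, 0 ≤ w X Y)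
    (h : ∀ X : C.Dom, ∀ Y ∈ G.parents X, σ X Y ≤ s₀ * δ ^ (C.scale X - C.scale Y) * w X Y) :
    LayeredDamped G σ s₀ δ ρ w := by
  intro X Y hY
  have hle : δ ^ (C.scale X - C.scale Y) ≤
      ∑ i ∈ range (C.scale Y + 1), δ ^ (C.scale X - C.scale Y + i) * ρ ^ i := by
    have hs := single_le_sum (f := fun i => δ ^ (C.scale X - C.scale Y + i) * ρ ^ i)
      (fun i _ => mul_nonneg (pow_nonneg hδ _) (pow_nonneg hρ _))
      (mem_range.mpr (Nat.succ_pos (C.scale Y)))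
    simpa using hs
  calc σ X Y ≤ s₀ * δ ^ (C.scale X - C.scale Y) * w X Y := h X Y hY
    _ ≤ s₀ * (∑ i ∈ range (C.scale Y + 1), δ ^ (C.scale X - C.scale Y + i) * ρ ^ i) * w X Y :=
        mul_le_mul_of_nonneg_right (mul_le_mul_of_nonneg_left hle hs₀) (hw X Y hY)

/-- §6's `PerParentDamped` for the factorised datum from the layered form [folklore]: damping ratio `δ`, constant
`kT·s₀/(1 − δρ)`. -/
theorem perParentDamped_of_layered {G : Generation C} {KT σ w : C.Dom → C.Dom → ℝ} {kT s₀ δ ρ : ℝ}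
    (hKT0 : ∀ X Y, 0 ≤ KT X Y) (hσ0 : ∀ X Y, 0 ≤ σ X Y)
    (hKT : ∀ X : C.Dom, ∀ Y ∈ G.parents X, KT X Y ≤ kT)
    (hs₀ : 0 ≤ s₀) (hδ : 0 ≤ δ) (hρ : 0 ≤ ρ) (hδρ : δ * ρ < 1)
    (hw : ∀ X : C.Dom, ∀ Y ∈ G.parents X, 0 ≤ w X Y) (h : LayeredDamped G σ s₀ δ ρ w) :
    PerParentDamped (fluctGeneration G KT σ hKT0 hσ0) δ (kT * (s₀ / (1 - δ * ρ))) w :=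
  perParentDamped_of_fluct hKT0 hσ0 hKT (profile_of_layered hs₀ hδ hρ hδρ hw h)

/-- **END-TO-END FROM THE FACTORISED LEAVES, LAYERED PROFILE** [folklore]: `RepresentsA/B` + `TiltLip KT` + `FluctDamped σ` +
`OpDisc` + admissibility of both runs' tables + the LAYERED profile of `σ` + `SliceCountGrowing` + `EKernelContracts` + the
regular inputs' rate give `NE5B` through `ne5B_of_fluct` BY NAME, with the effective-damping condition `δ·V < θ` — the
per-collar decay must beat the rate times the volume entropy — and the constant
`(Cop + lamE·CE)/(1 − kT·(s₀/(1 − δρ))·Mc·(δV/θ)/(1 − δV/θ))`. -/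
theorem ne5B_of_layered {A : Type} {G : Generation C} {ch : FluctChart C A} {ΦA : GenMap C C.BgA} {Φ : GenMap C C.BgB}
    {BA : BFunctional C C.BgA} {BB : BFunctional C C.BgB}
    {EA : Functional C.toCarriers C.BgA} {EB : Functional C.toCarriers C.BgB} {W : Set (ℕ → ℝ)}
    {Adm : (ℕ → ℝ) → BTable C C.BgB → ETable C C.BgB → Prop}
    {κ θ δ ρ kT s₀ Mc V Cop CE lamE : ℝ} {KT σ w : C.Dom → C.Dom → ℝ}
    (hRA : RepresentsA ΦA BA EA W) (hRB : RepresentsB Φ BB EB W)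
    (hT : TiltLip G ch Φ W κ Adm KT) (hF : FluctDamped G ch W κ Adm σ)
    (hKT0 : ∀ X Y, 0 ≤ KT X Y) (hσ0 : ∀ X Y, 0 ≤ σ X Y)
    (hKT : ∀ X : C.Dom, ∀ Y ∈ G.parents X, KT X Y ≤ kT)
    (hLay : LayeredDamped G σ s₀ δ ρ w)
    (hOD : OpDisc ΦA Φ BA EA W κ θ Cop)
    (hadmA : ∀ g ∈ W, Adm g (pullB BA g) (epullB EA g)) (hadmB : ∀ g ∈ W, Adm g (tabB BB g) (etabB EB g))
    (hw : ∀ X : C.Dom, ∀ Y ∈ G.parents X, 0 ≤ w X Y) (hS : SliceCountGrowing G κ w Mc V)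
    (hKE : EKernelContracts G κ θ lamE) (hE : NE5 EA EB W κ θ CE)
    (hθ : 0 < θ) (hδ : 0 ≤ δ) (hρ : 0 ≤ ρ) (hδρ : δ * ρ < 1) (hV : 0 ≤ V) (hδθ : δ * V < θ) (hkT : 0 ≤ kT)
    (hs₀ : 0 ≤ s₀) (hMc : 0 ≤ Mc)
    (hsmall : kT * (s₀ / (1 - δ * ρ)) * Mc * (δ * V / θ) / (1 - δ * V / θ) < 1)
    (hCop : 0 ≤ Cop) (hCE : 0 ≤ CE) (hlamE : 0 ≤ lamE) :
    NE5B BA BB W κ θ ((Cop + lamE * CE) / (1 - kT * (s₀ / (1 - δ * ρ)) * Mc * (δ * V / θ) / (1 - δ * V / θ))) :=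
  ne5B_of_fluct hRA hRB hT hF hKT0 hσ0 hKT (profile_of_layered hs₀ hδ hρ hδρ hw hLay) hOD hadmA hadmB hS hKE hE
    hθ hδ hV hδθ hkT (div_nonneg hs₀ (by linarith)) hMc hsmall hCop hCE hlamE

/-- **THE EXPLICIT CONSTANT IN THE COLLAR REGIME** [folklore]: if the ratio `r = δV/θ` is at most `1/(2(1 + K))`,
`K = kT·(s₀/(1 − δρ))·Mc`, then `NE5B` holds with the constant `2·(Cop + lamE·CE)` (`smallness_of_le`, `smallness_half_of_le`,
`div_le_two_mul`, `ne5B_mono` of §9/§10c). -/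
theorem ne5B_of_layered_two {A : Type} {G : Generation C} {ch : FluctChart C A} {ΦA : GenMap C C.BgA}
    {Φ : GenMap C C.BgB} {BA : BFunctional C C.BgA} {BB : BFunctional C C.BgB}
    {EA : Functional C.toCarriers C.BgA} {EB : Functional C.toCarriers C.BgB} {W : Set (ℕ → ℝ)}
    {Adm : (ℕ → ℝ) → BTable C C.BgB → ETable C C.BgB → Prop}
    {κ θ δ ρ kT s₀ Mc V Cop CE lamE : ℝ} {KT σ w : C.Dom → C.Dom → ℝ}
    (hRA : RepresentsA ΦA BA EA W) (hRB : RepresentsB Φ BB EB W)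
    (hT : TiltLip G ch Φ W κ Adm KT) (hF : FluctDamped G ch W κ Adm σ)
    (hKT0 : ∀ X Y, 0 ≤ KT X Y) (hσ0 : ∀ X Y, 0 ≤ σ X Y)
    (hKT : ∀ X : C.Dom, ∀ Y ∈ G.parents X, KT X Y ≤ kT)
    (hLay : LayeredDamped G σ s₀ δ ρ w)
    (hOD : OpDisc ΦA Φ BA EA W κ θ Cop)
    (hadmA : ∀ g ∈ W, Adm g (pullB BA g) (epullB EA g)) (hadmB : ∀ g ∈ W, Adm g (tabB BB g) (etabB EB g))
    (hw : ∀ X : C.Dom, ∀ Y ∈ G.parents X, 0 ≤ w X Y) (hS : SliceCountGrowing G κ w Mc V)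
    (hKE : EKernelContracts G κ θ lamE) (hE : NE5 EA EB W κ θ CE)
    (hθ : 0 < θ) (hδ : 0 ≤ δ) (hρ : 0 ≤ ρ) (hδρ : δ * ρ < 1) (hV : 0 ≤ V) (hkT : 0 ≤ kT) (hs₀ : 0 ≤ s₀)
    (hMc : 0 ≤ Mc) (hr : δ * V / θ ≤ 1 / (2 * (1 + kT * (s₀ / (1 - δ * ρ)) * Mc)))
    (hCop : 0 ≤ Cop) (hCE : 0 ≤ CE) (hlamE : 0 ≤ lamE) :
    NE5B BA BB W κ θ (2 * (Cop + lamE * CE)) := by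
  have hK : 0 ≤ kT * (s₀ / (1 - δ * ρ)) * Mc := mul_nonneg (mul_nonneg hkT (div_nonneg hs₀ (by linarith))) hMc
  have hr0 : 0 ≤ δ * V / θ := div_nonneg (mul_nonneg hδ hV) hθ.le
  have hr1 : δ * V / θ < 1 := by
    have h2 : 1 / (2 * (1 + kT * (s₀ / (1 - δ * ρ)) * Mc)) ≤ 1 / 2 :=
      one_div_le_one_div_of_le (by norm_num) (by linarith)
    linarith
  have hδθ : δ * V < θ := by rwa [div_lt_one hθ] at hr1
  have hsmall := smallness_of_le hK hr
  have h := ne5B_of_layered hRA hRB hT hF hKT0 hσ0 hKT hLay hOD hadmA hadmB hw hS hKE hE hθ hδ hρ hδρ hV hδθ hkT hs₀ hMc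
    hsmall hCop hCE hlamE
  exact ne5B_mono hθ.le (div_le_two_mul (by positivity) (smallness_half_of_le hK hr0 hr)) h

/-- PRINT'S CONSISTENCY SENTENCE AS AN INEQUALITY BETWEEN THE TWO TYPED RATES [folklore] (p. 277: the difference of domains,
`β2^{−(i+1)}α` at `i + 1` steps below the current one, *"is still much greater than bounds on this function"*): a displacement
bound `ε·δ^i` on the layer `i` collars below the fluctuation support stays below `β·(1/2)^{i+1}·α` for EVERY `i` as soon as the
per-collar decay is at least a halving, `δ ≤ 1/2`, and `ε ≤ ½βα` — so the printed sentence presupposes a per-layer decay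
ratio `δ ≤ 1/2` of the displacement (uniformly in the number of steps), which is the hypothesis `δ` of `LayeredDamped`. -/
theorem displacement_le_domainDifference {ε δ β α : ℝ} (hε0 : 0 ≤ ε) (hε : ε ≤ β / 2 * α) (hδ0 : 0 ≤ δ)
    (hδ : δ ≤ 1 / 2) (i : ℕ) : ε * δ ^ i ≤ β * (1 / 2) ^ (i + 1) * α := by
  have h1 : δ ^ i ≤ (1 / 2) ^ i := pow_le_pow_left₀ hδ0 hδ i
  have hβα : 0 ≤ β / 2 * α := le_trans hε0 hε
  calc ε * δ ^ i ≤ (β / 2 * α) * (1 / 2) ^ i := mul_le_mul hε h1 (pow_nonneg hδ0 i) hβα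
    _ = β * (1 / 2) ^ (i + 1) * α := by rw [pow_succ]; ring

/-- **NO-GO: THE GEOMETRIC PROFILE IS NOT THE PRINTED-SHAPE SUPER-EXPONENTIAL ONE** [folklore]: a boundary influence kernel
bounded BELOW by `k₁·r^{scale X − scale Y}` (`r > 0`) along parents of every scale separation `m + 1 ≥ 1` is not
`ExpDamped G L c k₀ w` for ANY blocking factor `L > 1`, rate `c > 0` and constant `k₀ ≥ 0` (weights normalised, `0 ≤ w ≤ 1` on
parents): §9's arbitrary-power bookkeeping (`ne5B_of_expDamped`, `ne5B_of_fluct_exp`) is NOT available for a kernel with the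
geometric profile of `LayeredDamped`/`profile_of_layered` realised from below (`star_not_expDamped`); §7/§10's geometric route
(`ne5B_of_fluct`, `ne5B_of_layered`) is, under `δ·V < θ`. -/
theorem not_expDamped_of_geometric_lower {G : Generation C} {w : C.Dom → C.Dom → ℝ} {r k₁ L c k₀ : ℝ}
    (hr : 0 < r) (hk₁ : 0 < k₁) (hL : 1 < L) (hc : 0 < c) (hk₀ : 0 ≤ k₀)
    (hw0 : ∀ X : C.Dom, ∀ Y ∈ G.parents X, 0 ≤ w X Y) (hw1 : ∀ X : C.Dom, ∀ Y ∈ G.parents X, w X Y ≤ 1)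
    (hlow : ∀ m : ℕ, ∃ X : C.Dom, ∃ Y ∈ G.parents X, C.scale X - C.scale Y = m + 1 ∧ k₁ * r ^ (m + 1) ≤ G.K X Y) :
    ¬ ExpDamped G L c k₀ w := by
  intro hX
  have hL0 : 0 < L := lt_trans zero_lt_one hL
  -- a power N' with (L^N')⁻¹ < r
  obtain ⟨N, hN⟩ := exists_pow_lt_of_lt_one hr (inv_lt_one_of_one_lt₀ hL)
  set N' : ℕ := N + 1 with hN'
  have hLN : (L ^ N')⁻¹ < r := by
    have h1 : (L ^ N')⁻¹ ≤ (L ^ N)⁻¹ := by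
      rw [inv_le_inv₀ (pow_pos hL0 _) (pow_pos hL0 _)]
      exact pow_le_pow_right₀ hL.le (Nat.le_succ N)
    have h2 : (L ^ N)⁻¹ = L⁻¹ ^ N := (inv_pow L N).symm
    linarith [h2 ▸ hN]
  -- the any-power form of `ExpDamped` (§9)
  have hP := perParentDamped_of_expDamped hL0 hc hk₀ hw0 hX N'
  set Cst : ℝ := ((N' : ℝ) / (c * Real.exp 1)) ^ N' with hCst
  have hCst0 : 0 ≤ Cst := by positivity
  -- the ratio q = (L^N')⁻¹ / r < 1
  set q : ℝ := (L ^ N')⁻¹ / r with hq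
  have hq0 : 0 ≤ q := div_nonneg (inv_nonneg.mpr (pow_nonneg hL0.le _)) hr.le
  have hq1 : q < 1 := (div_lt_one hr).mpr hLN
  have hqr : (L ^ N')⁻¹ = q * r := by rw [hq]; field_simp
  -- a separation m + 1 with (k₀·Cst)·q^{m+1} < k₁
  have hkC : 0 < k₁ / (k₀ * Cst + 1) := div_pos hk₁ (by positivity)
  obtain ⟨m, hm⟩ := exists_pow_lt_of_lt_one hkC hq1
  have hm' : (k₀ * Cst) * q ^ (m + 1) < k₁ := by
    have h1 : q ^ m * (k₀ * Cst + 1) < k₁ := by rwa [lt_div_iff₀ (by positivity)] at hm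
    have h2 : q ^ (m + 1) ≤ q ^ m := pow_le_pow_of_le_one hq0 hq1.le (Nat.le_succ m)
    have h3 : k₀ * Cst * q ^ (m + 1) ≤ k₀ * Cst * q ^ m := mul_le_mul_of_nonneg_left h2 (mul_nonneg hk₀ hCst0)
    have h4 : q ^ m * (k₀ * Cst + 1) = k₀ * Cst * q ^ m + q ^ m := by ring
    linarith [pow_nonneg hq0 m]
  obtain ⟨X, Y, hY, hsep, hK⟩ := hlow m
  have hup := hP X Y hY
  rw [hsep] at hup
  have hrm : 0 < r ^ (m + 1) := pow_pos hr (m + 1)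
  have hchain : k₁ * r ^ (m + 1) ≤ (k₀ * Cst) * q ^ (m + 1) * r ^ (m + 1) := by
    calc k₁ * r ^ (m + 1) ≤ G.K X Y := hK
      _ ≤ k₀ * Cst * ((L ^ N')⁻¹) ^ (m + 1) * w X Y := hup
      _ ≤ k₀ * Cst * ((L ^ N')⁻¹) ^ (m + 1) * 1 :=
          mul_le_mul_of_nonneg_left (hw1 X Y hY) (by positivity)
      _ = (k₀ * Cst) * q ^ (m + 1) * r ^ (m + 1) := by rw [hqr, mul_pow]; ring
  have : k₁ ≤ (k₀ * Cst) * q ^ (m + 1) := le_of_mul_le_mul_right hchain hrm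
  linarith

/-- The STAR generation datum on §4's chain carriers [folklore]: every piece `n ≥ 1` has the single oldest parent `0`, no
regular inputs, kernel `K n · = r^n` (`r ≥ 0`) — a boundary influence kernel realising EXACTLY the geometric profile in the
scale separation, at every separation (contrast `chainGeneration`, whose parents are one step older). -/
def starGeneration (r : ℝ) (hr : 0 ≤ r) : Generation chainCarriers where
  parents := fun n : ℕ => (range n).filter (fun m : ℕ => m = 0)
  parents_lt := fun n m hm => by
    have h := (mem_filter.mp hm).1
    simpa using h
  eparents := fun _ => ∅
  eparents_lt := fun _ _ h => by simp at h
  K := fun n _ => r ^ n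
  K_nonneg := fun n _ => pow_nonneg hr n
  KE := fun _ _ => 0
  KE_nonneg := fun _ _ => le_rfl

/-- On the star, the parents of the piece `n + 1` are `{0}`. [folklore] -/
theorem star_parents_succ (r : ℝ) (hr : 0 ≤ r) (n : ℕ) :
    (starGeneration r hr).parents (n + 1) = ({0} : Finset ℕ) := by
  ext m
  simp only [starGeneration, mem_filter, mem_range, mem_singleton]
  omega

/-- On the star, the piece `0` has no parents. [folklore] -/
theorem star_parents_zero (r : ℝ) (hr : 0 ≤ r) : (starGeneration r hr).parents 0 = (∅ : Finset ℕ) := by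
  ext m
  simp [starGeneration]

/-- NON-DEGENERACY [folklore]: the star kernel IS `PerParentDamped` with ratio `r`, constant 1 and unit weights (with equality) … -/
theorem star_perParentDamped {r : ℝ} (hr : 0 ≤ r) : PerParentDamped (starGeneration r hr) r 1 (fun _ _ => 1) := by
  intro n m hm
  cases n with
  | zero =>
    rw [star_parents_zero] at hm
    simp at hm
  | succ n =>
    rw [star_parents_succ, mem_singleton] at hm
    subst hm
    simp [starGeneration]

/-- … it is bounded below geometrically at every separation `m + 1` (constant 1) … [folklore] -/
theorem star_geometric_lower {r : ℝ} (hr : 0 ≤ r) :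
    ∀ m : ℕ, ∃ X : chainCarriers.Dom, ∃ Y ∈ (starGeneration r hr).parents X,
      chainCarriers.scale X - chainCarriers.scale Y = m + 1 ∧ 1 * r ^ (m + 1) ≤ (starGeneration r hr).K X Y := by
  intro m
  refine ⟨m + 1, 0, ?_, ?_, ?_⟩
  · rw [star_parents_succ]
    exact mem_singleton_self 0
  · simp
  · simp [starGeneration]

/-- … and therefore it is NOT `ExpDamped` for any `L > 1`, `c > 0`, `k₀ ≥ 0` (unit weights) — while it feeds §7/§10's geometric
route with `ω = r` (`star_perParentDamped`): the two bookkeepings are genuinely different regimes, and the boundary parents'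
layered profile belongs to the geometric one. [folklore] -/
theorem star_not_expDamped {r L c k₀ : ℝ} (hr : 0 < r) (hL : 1 < L) (hc : 0 < c) (hk₀ : 0 ≤ k₀) :
    ¬ ExpDamped (starGeneration r hr.le) L c k₀ (fun _ _ => 1) :=
  not_expDamped_of_geometric_lower hr zero_lt_one hL hc hk₀ (fun _ _ _ => zero_le_one) (fun _ _ _ => le_rfl)
    (star_geometric_lower hr.le)

/-- NUMBERS, IV [folklore]: with a per-collar decay `δ = e^{−c}` (print: collars of width `2MR_j` in each scale, p. 256, with
`R_j ≥ (log g_j^{−2})^r`, (2.5) p. 255, and the exponential decay of 𝐇_k per unit length of its scale), the volume entropy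
`V = L^b` and the rate `θ = (L^a)⁻¹`, the effective-damping condition of `ne5B_of_layered`, `δ·V < θ`, holds as soon as
`c > (a + b)·log L` — a condition on the collar constant against FIXED powers of the blocking factor, met with room for
large `R`; contrast §9's `inv_pow_mul_pow_lt`, where the printed super-exponential gain supplies any power. -/
theorem exp_neg_mul_pow_lt_inv_pow {L c : ℝ} (hL : 1 < L) {a b : ℕ} (h : ((a : ℝ) + b) * Real.log L < c) :
    Real.exp (-c) * L ^ b < (L ^ a)⁻¹ := by
  have hL0 : 0 < L := lt_trans zero_lt_one hL
  have hab : Real.exp (((a : ℝ) + b) * Real.log L) = L ^ (a + b) := by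
    rw [show ((a : ℝ) + b) = ((a + b : ℕ) : ℝ) by push_cast; ring, Real.exp_nat_mul, Real.exp_log hL0]
  have h1 : Real.exp (-c) < (L ^ (a + b))⁻¹ := by
    rw [← hab, ← Real.exp_neg]
    exact Real.exp_lt_exp.mpr (by linarith)
  calc Real.exp (-c) * L ^ b < (L ^ (a + b))⁻¹ * L ^ b := mul_lt_mul_of_pos_right h1 (pow_pos hL0 b)
    _ = (L ^ a)⁻¹ := by
        rw [pow_add, mul_inv, mul_assoc, inv_mul_cancel₀ (pow_ne_zero b hL0.ne'), mul_one]

end Literature.MathematicalPhysics.QuantumFieldTheory.Balaban1983to89.T4BoundaryRate
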